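import Literature.Probability.RandomPlanarGeometry.YangBaxterSAWBoundaryWinding
import Literature.Probability.RandomPlanarGeometry.YangBaxterSAWLocalRelations
import HarnessLib

/-!
# Glazman–Manolescu, Lemma 2.1: the winding of an excursion — local data and local computations

Topic `Literature/Probability/RandomPlanarGeometry`; companion of `YangBaxterSAWExcursion.lean`
(the discharge of the named fact `GlazmanManolescu2019_excursionWinding` of
`YangBaxterSAWGrouping.lean`, A. Glazman, I. Manolescu, arXiv:1708.00395, Lemma 2.1 / [Gl] Lemma
3.1), split off for size. This file contains the walk-independent ingredients:
* the generic angle algebra of winding numbers of closed polygons (`angAt`, `sweep`, `rung`,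
  the plaquette identity `plaquette`, the transport lemmas `sweep_sub_sweep`,
  `sweep_eq_sweep_of_closed`, `sweep_eq_zero_of_halfPlane`, from the lemmas of `HexSAWHopf.lean`);
* the canonical orientations `Canon` of a triple of sides (`canon_or_swap`) and the local data of
  the twelve canonical cases in the integer drawing of mesh `4` of
  `YangBaxterSAWBoundaryWinding.lean` (`tailOffs`, `wOff`, `tailPts`, `tailSegs`);
* the decided tables of acute configurations for the near faces (`table_tailSeg_inner`,
  `table_corner_chord`, `table_rung_inner`, `table_rung_w`, `table_local`) and the norm bound for
  the far ones (`sdot_pos_of_far4`, `sdot_pos_split`, `sdot_pos_split'`);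
* the local angle sums `L₁off`, `L₂off`, `tailExtOff`, `Loc` (offset level) and their exact
  evaluation in the twelve canonical cases (`Loc_eq`: every term is an angle at a base point
  between lattice points of a closed half-plane, `angAt_vec`, the sums telescope, and the
  surviving arguments are those of axis or diagonal Gaussian integers; the twelve proof scripts were
  generated mechanically from the case data).
-/

noncomputable section

open Complex Real

namespace Literature.Probability.RandomPlanarGeometry.SAW.YangBaxter

/-! ### Winding-number transport (generic angle algebra) -/

section A1
open Hopf Finset

open Hopf

/-- The angle at the base point `b` subtended by the step `P₀ → P₁`. [folklore] -/
def angAt (b P₀ P₁ : ℂ) : ℝ := ((Complex.arg (P₁ - b) : Real.Angle) - (Complex.arg (P₀ - b) : Real.Angle)).toReal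

/-- The angle swept by the secant from `b` along `p 0 → p 1 → ⋯ → p N`. [folklore] -/
def sweep (b : ℂ) (p : ℕ → ℂ) (N : ℕ) : ℝ := ∑ k ∈ range N, angAt b (p k) (p (k + 1))

/-- The rung angle at `P`: from the direction of `b` to that of `b'`. [folklore] -/
def rung (b b' P : ℂ) : ℝ := ((Complex.arg (b' - P) : Real.Angle) - (Complex.arg (b - P) : Real.Angle)).toReal

/-- A positive inner product forces both vectors to be nonzero. [folklore] -/
theorem re_mul_conj_pos_ne {v w : ℂ} (h : 0 < (v * (starRingEnd ℂ) w).re) : v ≠ 0 ∧ w ≠ 0 :=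
  ⟨by rintro rfl; simp at h, by rintro rfl; simp at h⟩

/-- **The plaquette identity**: if the step `P₀ → P₁` is seen from `b` and from `b'` under an angle
`< π/2` and the rung `[b, b']` is seen from `P₀` and from `P₁` under an angle `< π/2`, then
`∠_b(P₀→P₁) + rung(P₁) = ∠_{b'}(P₀→P₁) + rung(P₀)`. [folklore] -/
theorem plaquette {b b' P₀ P₁ : ℂ}
    (hX : 0 < ((P₁ - b) * (starRingEnd ℂ) (P₀ - b)).re) (hY : 0 < ((P₁ - b') * (starRingEnd ℂ) (P₀ - b')).re)
    (hZ₀ : 0 < ((b' - P₀) * (starRingEnd ℂ) (b - P₀)).re) (hZ₁ : 0 < ((b' - P₁) * (starRingEnd ℂ) (b - P₁)).re) :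
    angAt b P₀ P₁ + rung b b' P₁ = angAt b' P₀ P₁ + rung b b' P₀ := by
  unfold angAt rung
  apply toReal_add_eq_toReal_add _ (abs_toReal_argDiff_lt hX) (abs_toReal_argDiff_lt hZ₁) (abs_toReal_argDiff_lt hY)
    (abs_toReal_argDiff_lt hZ₀)
  -- the identity in `Real.Angle`, through `arg (-x) = arg x + π`
  obtain ⟨h1, h0⟩ := re_mul_conj_pos_ne hX
  obtain ⟨h1', h0'⟩ := re_mul_conj_pos_ne hY
  have e1 : (Complex.arg (b' - P₁) : Real.Angle) = Complex.arg (P₁ - b') + π := by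
    rw [← neg_sub, Complex.arg_neg_coe_angle h1']
  have e2 : (Complex.arg (b - P₁) : Real.Angle) = Complex.arg (P₁ - b) + π := by
    rw [← neg_sub, Complex.arg_neg_coe_angle h1]
  have e3 : (Complex.arg (b' - P₀) : Real.Angle) = Complex.arg (P₀ - b') + π := by
    rw [← neg_sub, Complex.arg_neg_coe_angle h0']
  have e4 : (Complex.arg (b - P₀) : Real.Angle) = Complex.arg (P₀ - b) + π := by
    rw [← neg_sub, Complex.arg_neg_coe_angle h0]
  rw [e1, e2, e3, e4]; abel

/-- **Transport of the swept angle** (open path): if all plaquettes are valid, the angles swept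
from `b` and from `b'` differ by the rung angles at the two ends. [folklore] -/
theorem sweep_sub_sweep (b b' : ℂ) (p : ℕ → ℂ) :
    ∀ N : ℕ, (∀ k < N, 0 < ((p (k + 1) - b) * (starRingEnd ℂ) (p k - b)).re) →
      (∀ k < N, 0 < ((p (k + 1) - b') * (starRingEnd ℂ) (p k - b')).re) →
      (∀ k ≤ N, 0 < ((b' - p k) * (starRingEnd ℂ) (b - p k)).re) →
      sweep b p N - sweep b' p N = rung b b' (p 0) - rung b b' (p N)
  | 0, _, _, _ => by simp [sweep]
  | N + 1, hX, hY, hZ => by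
    have ih := sweep_sub_sweep b b' p N (fun k hk => hX k (by omega)) (fun k hk => hY k (by omega))
      (fun k hk => hZ k (by omega))
    rw [sweep, sweep, sum_range_succ, sum_range_succ, ← sweep, ← sweep]
    have := plaquette (hX N (by omega)) (hY N (by omega)) (hZ N (by omega)) (hZ (N + 1) le_rfl)
    linarith

/-- **The winding angle of a closed polygon is invariant under transport of the base point.**
[folklore] -/
theorem sweep_eq_sweep_of_closed (b b' : ℂ) (p : ℕ → ℂ) (N : ℕ) (hN : p N = p 0)
    (hX : ∀ k < N, 0 < ((p (k + 1) - b) * (starRingEnd ℂ) (p k - b)).re)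
    (hY : ∀ k < N, 0 < ((p (k + 1) - b') * (starRingEnd ℂ) (p k - b')).re)
    (hZ : ∀ k ≤ N, 0 < ((b' - p k) * (starRingEnd ℂ) (b - p k)).re) : sweep b p N = sweep b' p N := by
  have := sweep_sub_sweep b b' p N hX hY hZ
  rw [hN, sub_self] at this
  linarith

/-- **The winding angle vanishes for a base point outside a half-plane containing the closed
polygon.** [folklore] -/
theorem sweep_eq_zero_of_halfPlane {c : ℂ} (hc : c ≠ 0) (b : ℂ) (p : ℕ → ℂ) (N : ℕ) (hN : p N = p 0)
    (hne : ∀ k ≤ N, p k ≠ b) (him : ∀ k ≤ N, 0 ≤ (c * (p k - b)).im)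
    (hX : ∀ k < N, 0 < ((p (k + 1) - b) * (starRingEnd ℂ) (p k - b)).re) : sweep b p N = 0 := by
  have := sum_toReal_argDiff_eq hc (fun k => p k - b) N (fun m hm => sub_ne_zero.2 (hne m hm)) him
    (fun m hm => (abs_toReal_argDiff_lt (hX m hm)).trans (by linarith [Real.pi_pos]))
  rw [sweep]
  unfold angAt
  rw [this, hN, sub_self]

/-- A term of a chain in a closed half-plane is an honest difference of rotated arguments.
[folklore] -/
theorem angAt_eq_sub {c : ℂ} (hc : c ≠ 0) {b P₀ P₁ : ℂ} (h0 : 0 ≤ (c * (P₀ - b)).im) (h1 : 0 ≤ (c * (P₁ - b)).im)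
    (hacute : 0 < ((P₁ - b) * (starRingEnd ℂ) (P₀ - b)).re) :
    angAt b P₀ P₁ = Complex.arg (c * (P₁ - b)) - Complex.arg (c * (P₀ - b)) := by
  obtain ⟨h1', h0'⟩ := re_mul_conj_pos_ne hacute
  exact toReal_argDiff_eq_sub hc h1' h0' h1 h0 ((abs_toReal_argDiff_lt hacute).trans (by linarith [Real.pi_pos]))


end A1

/-! ### Canonical triples and the local data of the twelve cases -/

/-- The canonical orientation of an excursion: the exit side is adjacent to the first side, and
either the return side is opposite to the first side, or it is opposite to the exit side and the
first arc is a `θ`-corner arc. [folklore] -/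
def Canon (z₀ z₁ z₂ : Side) : Prop :=
  z₀ ≠ z₁ ∧ z₀ ≠ z₂ ∧ z₁ ≠ z₂ ∧ z₁ ≠ z₀.opp ∧ (z₂ = z₀.opp ∨ (z₂ = z₁.opp ∧ arcKind z₀ z₁ = .corner))

/-- `Canon` is decidable. [folklore] -/
instance (z₀ z₁ z₂ : Side) : Decidable (Canon z₀ z₁ z₂) := by unfold Canon; infer_instance

/-- Every excursion or its reversal is canonical. [folklore] -/
theorem canon_or_swap {z₀ z₁ z₂ : Side} (h01 : z₀ ≠ z₁) (h02 : z₀ ≠ z₂) (h12 : z₁ ≠ z₂) :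
    Canon z₀ z₁ z₂ ∨ Canon z₀ z₂ z₁ := by
  revert h01 h02 h12; revert z₀ z₁ z₂; decide

/-- The tail of the open path after the midpoint of the return side (offsets from `r.base`; the
last point is the far base point `w`). [folklore] -/
def tailOffs : Side → Side → Side → List (ℤ × ℤ)
  | .W, .N, .E => [(3, 1), (1, 1)]
  | .W, .S, .E => [(3, 3), (1, 3)]
  | .W, .N, .S => [(1, 1)]
  | .E, .S, .W => [(1, 3), (3, 3)]
  | .E, .N, .W => [(1, 1), (3, 1)]
  | .E, .S, .N => [(3, 3)]
  | .S, .W, .N => [(3, 3), (3, 1)]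
  | .S, .E, .N => [(1, 3), (1, 1)]
  | .S, .E, .W => [(1, 1)]
  | .N, .E, .S => [(1, 1), (1, 3)]
  | .N, .W, .S => [(3, 1), (3, 3)]
  | .N, .W, .E => [(3, 3)]
  | _, _, _ => [(1, 1)]

/-- The far base point `w` (offset): the last tail point. [folklore] -/
def wOff (z₀ z₁ z₂ : Side) : ℤ × ℤ := (tailOffs z₀ z₁ z₂).getD ((tailOffs z₀ z₁ z₂).length - 1) (0, 0)

/-- The first tail point (offset). [folklore] -/
def t₀Off (z₀ z₁ z₂ : Side) : ℤ × ℤ := (tailOffs z₀ z₁ z₂).headD (1, 1)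

/-- The tail is nonempty. [folklore] -/
theorem tailOffs_length_pos (z₀ z₁ z₂ : Side) : 0 < (tailOffs z₀ z₁ z₂).length := by
  cases z₀ <;> cases z₁ <;> cases z₂ <;> decide

/-- The tail has at most two points. [folklore] -/
theorem tailOffs_length_le (z₀ z₁ z₂ : Side) : (tailOffs z₀ z₁ z₂).length ≤ 2 := by
  cases z₀ <;> cases z₁ <;> cases z₂ <;> decide

/-- Tail points are of corner type: both offsets odd, in `{1, 3}`. [folklore] -/
theorem tailOffs_mem (z₀ z₁ z₂ : Side) : ∀ p ∈ tailOffs z₀ z₁ z₂, (p.1 = 1 ∨ p.1 = 3) ∧ (p.2 = 1 ∨ p.2 = 3) := by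
  cases z₀ <;> cases z₁ <;> cases z₂ <;> decide

/-! ### Families of acute configurations (tables for near faces, a norm bound for far ones) -/

/-- Product of two integers `4d + x`, `4d + y` with `|d| ≥ 2`, `x, y ∈ [-4, 4]` is `≥ 16`. [folklore] -/
theorem mul_ge_of_far' {d x y : ℤ} (hd : 2 ≤ |d|) (hx : -4 ≤ x ∧ x ≤ 4) (hy : -4 ≤ y ∧ y ≤ 4) :
    16 ≤ (4 * d + x) * (4 * d + y) := by
  rcases le_abs'.1 hd with h | h
  · nlinarith [mul_nonneg (show (0:ℤ) ≤ -(4 * d + x) - 4 by linarith) (show (0:ℤ) ≤ -(4 * d + y) - 4 by linarith)]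
  · nlinarith [mul_nonneg (show (0:ℤ) ≤ (4 * d + x) - 4 by linarith) (show (0:ℤ) ≤ (4 * d + y) - 4 by linarith)]

/-- Product of two integers `4d + x`, `4d + y` with `x, y ∈ [-4, 3]` is `≥ -12`. [folklore] -/
theorem mul_ge_neg_twelve {d x y : ℤ} (hx : -4 ≤ x ∧ x ≤ 3) (hy : -4 ≤ y ∧ y ≤ 3) :
    -12 ≤ (4 * d + x) * (4 * d + y) := by
  rcases lt_trichotomy d 0 with h | rfl | h
  · nlinarith [mul_nonneg (show (0:ℤ) ≤ -(4 * d + x) by linarith) (show (0:ℤ) ≤ -(4 * d + y) by linarith)]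
  · simp only [mul_zero, zero_add]; nlinarith
  · nlinarith [mul_nonneg (show (0:ℤ) ≤ (4 * d + x) by linarith) (show (0:ℤ) ≤ (4 * d + y) by linarith)]

/-- Product of two integers `4d + x`, `4d + y` with `x, y ∈ [-3, 4]` is `≥ -12`. [folklore] -/
theorem mul_ge_neg_twelve' {d x y : ℤ} (hx : -3 ≤ x ∧ x ≤ 4) (hy : -3 ≤ y ∧ y ≤ 4) :
    -12 ≤ (4 * d + x) * (4 * d + y) := by
  have := mul_ge_neg_twelve (d := -d) (x := -x) (y := -y) (by omega) (by omega)
  nlinarith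

/-- **Far viewers see short segments under acute angles** (segment offsets in `[0,4]²`, viewer
offset in `[0,3]²`, frames at `ℓ∞`-distance `≥ 2`). [folklore] -/
theorem sdot_pos_of_far4 {p w₀ u u' ω : ℤ × ℤ} (hu : 0 ≤ u.1 ∧ u.1 ≤ 4 ∧ 0 ≤ u.2 ∧ u.2 ≤ 4)
    (hu' : 0 ≤ u'.1 ∧ u'.1 ≤ 4 ∧ 0 ≤ u'.2 ∧ u'.2 ≤ 4) (hω : 0 ≤ ω.1 ∧ ω.1 ≤ 3 ∧ 0 ≤ ω.2 ∧ ω.2 ≤ 3)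
    (hfar : 2 ≤ |p.1 - w₀.1| ∨ 2 ≤ |p.2 - w₀.2|) :
    0 < sdot ((4 * p.1, 4 * p.2) + u) ((4 * p.1, 4 * p.2) + u') ((4 * w₀.1, 4 * w₀.2) + ω) := by
  unfold sdot
  simp only [Prod.fst_add, Prod.snd_add]
  have e1 : 4 * p.1 + u'.1 - (4 * w₀.1 + ω.1) = 4 * (p.1 - w₀.1) + (u'.1 - ω.1) := by ring
  have e2 : 4 * p.1 + u.1 - (4 * w₀.1 + ω.1) = 4 * (p.1 - w₀.1) + (u.1 - ω.1) := by ring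
  have e3 : 4 * p.2 + u'.2 - (4 * w₀.2 + ω.2) = 4 * (p.2 - w₀.2) + (u'.2 - ω.2) := by ring
  have e4 : 4 * p.2 + u.2 - (4 * w₀.2 + ω.2) = 4 * (p.2 - w₀.2) + (u.2 - ω.2) := by ring
  rw [e1, e2, e3, e4]
  rcases hfar with h | h
  · have h1 := mul_ge_of_far' h (x := u'.1 - ω.1) (y := u.1 - ω.1) (by omega) (by omega)
    have h2 := mul_ge_neg_twelve' (d := p.2 - w₀.2) (x := u'.2 - ω.2) (y := u.2 - ω.2) (by omega) (by omega)
    linarith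
  · have h1 := mul_ge_of_far' h (x := u'.2 - ω.2) (y := u.2 - ω.2) (by omega) (by omega)
    have h2 := mul_ge_neg_twelve' (d := p.1 - w₀.1) (x := u'.1 - ω.1) (y := u.1 - ω.1) (by omega) (by omega)
    linarith

/-- Symmetric version: the viewer offset in `[0,4]²`, the segment offsets in `[0,3]²`. [folklore] -/
theorem sdot_pos_of_far4' {p w₀ u u' ω : ℤ × ℤ} (hu : 0 ≤ u.1 ∧ u.1 ≤ 3 ∧ 0 ≤ u.2 ∧ u.2 ≤ 3)
    (hu' : 0 ≤ u'.1 ∧ u'.1 ≤ 3 ∧ 0 ≤ u'.2 ∧ u'.2 ≤ 3) (hω : 0 ≤ ω.1 ∧ ω.1 ≤ 4 ∧ 0 ≤ ω.2 ∧ ω.2 ≤ 4)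
    (hfar : 2 ≤ |p.1 - w₀.1| ∨ 2 ≤ |p.2 - w₀.2|) :
    0 < sdot ((4 * p.1, 4 * p.2) + u) ((4 * p.1, 4 * p.2) + u') ((4 * w₀.1, 4 * w₀.2) + ω) := by
  unfold sdot
  simp only [Prod.fst_add, Prod.snd_add]
  have e1 : 4 * p.1 + u'.1 - (4 * w₀.1 + ω.1) = 4 * (p.1 - w₀.1) + (u'.1 - ω.1) := by ring
  have e2 : 4 * p.1 + u.1 - (4 * w₀.1 + ω.1) = 4 * (p.1 - w₀.1) + (u.1 - ω.1) := by ring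
  have e3 : 4 * p.2 + u'.2 - (4 * w₀.2 + ω.2) = 4 * (p.2 - w₀.2) + (u'.2 - ω.2) := by ring
  have e4 : 4 * p.2 + u.2 - (4 * w₀.2 + ω.2) = 4 * (p.2 - w₀.2) + (u.2 - ω.2) := by ring
  rw [e1, e2, e3, e4]
  rcases hfar with h | h
  · have h1 := mul_ge_of_far' h (x := u'.1 - ω.1) (y := u.1 - ω.1) (by omega) (by omega)
    have h2 := mul_ge_neg_twelve (d := p.2 - w₀.2) (x := u'.2 - ω.2) (y := u.2 - ω.2) (by omega) (by omega)
    linarith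
  · have h1 := mul_ge_of_far' h (x := u'.2 - ω.2) (y := u.2 - ω.2) (by omega) (by omega)
    have h2 := mul_ge_neg_twelve (d := p.1 - w₀.1) (x := u'.1 - ω.1) (y := u.1 - ω.1) (by omega) (by omega)
    linarith

/-- The near offsets. [folklore] -/
def nearOffs : List (ℤ × ℤ) := [(-1, -1), (-1, 0), (-1, 1), (0, -1), (0, 0), (0, 1), (1, -1), (1, 0), (1, 1)]

/-- Offsets of `ℓ∞`-norm `≤ 1` are the nine near offsets. [folklore] -/
theorem mem_nearOffs {d : ℤ × ℤ} (h1 : |d.1| < 2) (h2 : |d.2| < 2) : d ∈ nearOffs := by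
  obtain ⟨x, y⟩ := d
  simp only [abs_lt] at h1 h2
  simp only [nearOffs, List.mem_cons, Prod.mk.injEq, List.not_mem_nil, or_false]
  omega

/-- **Near/far splitting**: a segment in the frame of `r` is seen under an acute angle from a point
of the frame of `g`, given the far bound hypotheses on the offsets and a table for the nine near
relative positions. [folklore] -/
theorem sdot_pos_split (r g : Face) {u u' ω : ℤ × ℤ} (hu : 0 ≤ u.1 ∧ u.1 ≤ 4 ∧ 0 ≤ u.2 ∧ u.2 ≤ 4)
    (hu' : 0 ≤ u'.1 ∧ u'.1 ≤ 4 ∧ 0 ≤ u'.2 ∧ u'.2 ≤ 4) (hω : 0 ≤ ω.1 ∧ ω.1 ≤ 3 ∧ 0 ≤ ω.2 ∧ ω.2 ≤ 3)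
    (hnear : ∀ d ∈ nearOffs, g = (r.1 + d.1, r.2 + d.2) → 0 < sdot u u' ((4 * d.1, 4 * d.2) + ω)) :
    0 < sdot (r.base + u) (r.base + u') (g.base + ω) := by
  by_cases hfar : 2 ≤ |r.1 - g.1| ∨ 2 ≤ |r.2 - g.2|
  · exact sdot_pos_of_far4 hu hu' hω hfar
  · rw [not_or, not_le, not_le] at hfar
    have hd : (g.1 - r.1, g.2 - r.2) ∈ nearOffs := mem_nearOffs (by rw [abs_sub_comm]; exact hfar.1) (by rw [abs_sub_comm]; exact hfar.2)
    have key := hnear _ hd (by obtain ⟨a, b⟩ := g; obtain ⟨c, d⟩ := r; simp)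
    have e : g.base = r.base + (4 * (g.1 - r.1), 4 * (g.2 - r.2)) := by
      obtain ⟨a, b⟩ := g; obtain ⟨c, d⟩ := r; simp [Face.base]; constructor <;> ring
    have e2 : sdot (r.base + u) (r.base + u') (r.base + ((4 * (g.1 - r.1), 4 * (g.2 - r.2)) + ω)) =
        sdot u u' ((4 * (g.1 - r.1), 4 * (g.2 - r.2)) + ω) := by
      rw [add_comm r.base u, add_comm r.base u', add_comm r.base, sdot_add]
    rw [e, add_assoc, e2]
    simpa using key

/-- The same splitting with the viewer in the frame of `r` and the segment in the frame of `g`.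
[folklore] -/
theorem sdot_pos_split' (r g : Face) {u u' ω : ℤ × ℤ} (hu : 0 ≤ u.1 ∧ u.1 ≤ 3 ∧ 0 ≤ u.2 ∧ u.2 ≤ 3)
    (hu' : 0 ≤ u'.1 ∧ u'.1 ≤ 3 ∧ 0 ≤ u'.2 ∧ u'.2 ≤ 3) (hω : 0 ≤ ω.1 ∧ ω.1 ≤ 4 ∧ 0 ≤ ω.2 ∧ ω.2 ≤ 4)
    (hnear : ∀ d ∈ nearOffs, g = (r.1 + d.1, r.2 + d.2) → 0 < sdot ((4 * d.1, 4 * d.2) + u) ((4 * d.1, 4 * d.2) + u') ω) :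
    0 < sdot (g.base + u) (g.base + u') (r.base + ω) := by
  by_cases hfar : 2 ≤ |g.1 - r.1| ∨ 2 ≤ |g.2 - r.2|
  · exact sdot_pos_of_far4' hu hu' hω hfar
  · rw [not_or, not_le, not_le] at hfar
    have hd : (g.1 - r.1, g.2 - r.2) ∈ nearOffs := mem_nearOffs hfar.1 hfar.2
    have key := hnear _ hd (by obtain ⟨a, b⟩ := g; obtain ⟨c, d⟩ := r; simp)
    have e : g.base = r.base + (4 * (g.1 - r.1), 4 * (g.2 - r.2)) := by
      obtain ⟨a, b⟩ := g; obtain ⟨c, d⟩ := r; simp [Face.base]; constructor <;> ring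
    have e2 : sdot (r.base + ((4 * (g.1 - r.1), 4 * (g.2 - r.2)) + u)) (r.base + ((4 * (g.1 - r.1), 4 * (g.2 - r.2)) + u'))
        (r.base + ω) = sdot ((4 * (g.1 - r.1), 4 * (g.2 - r.2)) + u) ((4 * (g.1 - r.1), 4 * (g.2 - r.2)) + u') ω := by
      rw [add_comm r.base, add_comm r.base, add_comm r.base ω, sdot_add]
    rw [e, add_assoc, add_assoc, e2]
    simpa using key

/-! ### The decided tables -/

/-- The tail segments (offsets): from the return midpoint through the tail points. [folklore] -/
def tailSegs (z₀ z₁ z₂ : Side) : List ((ℤ × ℤ) × (ℤ × ℤ)) := (z₂.offset :: tailOffs z₀ z₁ z₂).zip (tailOffs z₀ z₁ z₂)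

/-- Table (a): tail segments are seen under acute angles from the inner points of the near faces
(for `r` itself: from `c₀` and `c₁`). [folklore] -/
theorem table_tailSeg_inner : ∀ z₀ z₁ z₂ : Side, Canon z₀ z₁ z₂ → ∀ sg ∈ tailSegs z₀ z₁ z₂, ∀ d ∈ nearOffs, ∀ σ : Side,
    (d ≠ (0, 0) ∨ σ = z₀ ∨ σ = z₁) → 0 < sdot sg.1 sg.2 ((4 * d.1, 4 * d.2) + σ.inOff) := by
  decide

/-- Table (c): chords of the near faces other than `r` are seen under acute angles from the points
of corner type of `r`. [folklore] -/
theorem table_corner_chord : ∀ p ∈ [((1 : ℤ), (1 : ℤ)), (1, 3), (3, 1), (3, 3)], ∀ d ∈ nearOffs, d ≠ (0, 0) →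
    ∀ s t : Side, s ≠ t → 0 < sdot ((4 * d.1, 4 * d.2) + s.inOff) ((4 * d.1, 4 * d.2) + t.inOff) p := by
  decide

/-- Table (L6): the midpoint rung of an arc is seen under an acute angle from the inner points of
the near faces, except, in the same face, from the inner points at its own sides and, for a
straight arc, from all four. [folklore] -/
theorem table_rung_inner : ∀ s t : Side, s ≠ t → ∀ d ∈ nearOffs, ∀ σ : Side,
    (d ≠ (0, 0) ∨ (σ ≠ s ∧ σ ≠ t ∧ arcKind s t ≠ .straight)) →
      0 < sdot s.offset t.offset ((4 * d.1, 4 * d.2) + σ.inOff) := by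
  decide

/-- Table (b): the rung `[m₀, w]` is seen under acute angles from the inner points of the near
faces (for `r` itself: from `c₁` and `c₂`). [folklore] -/
theorem table_rung_w : ∀ z₀ z₁ z₂ : Side, Canon z₀ z₁ z₂ → ∀ d ∈ nearOffs, ∀ σ : Side,
    (d ≠ (0, 0) ∨ σ = z₁ ∨ σ = z₂) → 0 < sdot z₀.offset (wOff z₀ z₁ z₂) ((4 * d.1, 4 * d.2) + σ.inOff) := by
  decide

/-- The points of the tail part of the open path, from the return midpoint on (offsets). [folklore] -/
def tailPts (z₀ z₁ z₂ : Side) : List (ℤ × ℤ) := z₂.offset :: tailOffs z₀ z₁ z₂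

/-- Table (m): the local acute configurations inside `r` (tail segments from `m₀` and from the
other tail points; the first half-segment and the first chord from the tail points; the closing
chord of `r` from `m₀` and from `w`). [folklore] -/
theorem table_local : ∀ z₀ z₁ z₂ : Side, Canon z₀ z₁ z₂ →
    (∀ i < 2, i + 1 < (tailPts z₀ z₁ z₂).length →
      0 < sdot ((tailPts z₀ z₁ z₂).getD i (0, 0)) ((tailPts z₀ z₁ z₂).getD (i + 1) (0, 0)) z₀.offset) ∧
    (∀ i : Fin 2, ∀ j : Fin 3, i.1 + 1 < (tailPts z₀ z₁ z₂).length → j.1 < (tailPts z₀ z₁ z₂).length → j.1 ≠ i.1 →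
      j.1 ≠ i.1 + 1 → 0 < sdot ((tailPts z₀ z₁ z₂).getD i.1 (0, 0)) ((tailPts z₀ z₁ z₂).getD (i.1 + 1) (0, 0))
        ((tailPts z₀ z₁ z₂).getD j.1 (0, 0))) ∧
    (∀ j < 2, j < (tailOffs z₀ z₁ z₂).length →
      0 < sdot z₀.offset z₀.inOff ((tailOffs z₀ z₁ z₂).getD j (0, 0)) ∧
      0 < sdot z₀.inOff z₁.inOff ((tailOffs z₀ z₁ z₂).getD j (0, 0))) ∧
    0 < sdot z₂.inOff z₁.inOff z₀.offset ∧ 0 < sdot z₂.inOff z₁.inOff (wOff z₀ z₁ z₂) := by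
  decide

/-! ### The local angle sums (offset level) -/

/-- The chain of points after the excursion: one unit outside the return side, its midpoint, the
tail. [folklore] -/
def Xo (z₀ z₁ z₂ : Side) (i : ℕ) : ℤ × ℤ := if i = 0 then z₂.offset - z₂.nIn else (tailPts z₀ z₁ z₂).getD (i - 1) (0, 0)

/-- The local part of the angle swept from `m₀`. [folklore] -/
def L₂off (z₀ z₁ z₂ : Side) : ℝ :=
  angAt (toC z₀.offset) (toC z₀.inOff) (toC z₁.inOff) - angAt (toC z₀.offset) (toC (Xo z₀ z₁ z₂ 0)) (toC z₂.inOff) -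
    angAt (toC z₀.offset) (toC z₂.inOff) (toC z₁.inOff) +
    ∑ i ∈ Finset.range ((tailOffs z₀ z₁ z₂).length + 1), angAt (toC z₀.offset) (toC (Xo z₀ z₁ z₂ i)) (toC (Xo z₀ z₁ z₂ (i + 1)))

/-- The local part of the angle swept into `w`. [folklore] -/
def L₁off (z₀ z₁ z₂ : Side) : ℝ :=
  angAt (toC (wOff z₀ z₁ z₂)) (toC z₀.offset) (toC z₀.inOff) + angAt (toC (wOff z₀ z₁ z₂)) (toC z₀.inOff) (toC z₁.inOff) -
    angAt (toC (wOff z₀ z₁ z₂)) (toC (Xo z₀ z₁ z₂ 0)) (toC z₂.inOff) - angAt (toC (wOff z₀ z₁ z₂)) (toC z₂.inOff) (toC z₁.inOff) +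
    ∑ i ∈ Finset.range (tailOffs z₀ z₁ z₂).length, angAt (toC (wOff z₀ z₁ z₂)) (toC (Xo z₀ z₁ z₂ i)) (toC (Xo z₀ z₁ z₂ (i + 1)))

/-- The exterior angles of the tail. [folklore] -/
def tailExtOff (z₀ z₁ z₂ : Side) : ℝ :=
  ∑ i ∈ Finset.range (tailOffs z₀ z₁ z₂).length,
    ((Complex.arg (toC (Xo z₀ z₁ z₂ (i + 2) - Xo z₀ z₁ z₂ (i + 1))) : Real.Angle) -
      (Complex.arg (toC (Xo z₀ z₁ z₂ (i + 1) - Xo z₀ z₁ z₂ i)) : Real.Angle)).toReal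

/-- **The local formula for the right-angle winding of a canonical excursion.** [folklore] -/
def Loc (z₀ z₁ z₂ : Side) : ℝ := L₁off z₀ z₁ z₂ + L₂off z₀ z₁ z₂ - arcTurn (π / 2) z₀ z₁ - tailExtOff z₀ z₁ z₂

/-- Angles at a base point are translation invariant. [folklore] -/
theorem angAt_transl (v a b c : ℤ × ℤ) : angAt (toC (v + a)) (toC (v + b)) (toC (v + c)) = angAt (toC a) (toC b) (toC c) := by
  unfold angAt
  rw [← toC_sub, ← toC_sub, ← toC_sub, ← toC_sub, add_sub_add_left_eq_sub, add_sub_add_left_eq_sub]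

/-! ### Evaluation lemmas for the local angle sums -/

/-- The inner product of two secants from a lattice point is `sdot`. [folklore] -/
theorem re_seg (A B w : ℤ × ℤ) : ((toC B - toC w) * (starRingEnd ℂ) (toC A - toC w)).re = sdot A B w := by
  rw [← toC_sub, ← toC_sub, re_toC_mul_conj, sdot]; simp only [Prod.fst_sub, Prod.snd_sub]; push_cast; ring

/-- The dot product deciding acuteness, in complex form. [folklore] -/
theorem im_I_mul_toC (v : ℤ × ℤ) : (I * toC v).im = v.1 := by simp [toC]
/-- Imaginary part after rotation by `−i`. [folklore] -/
theorem im_negI_mul_toC (v : ℤ × ℤ) : (-I * toC v).im = -v.1 := by simp [toC]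
/-- Imaginary part after the trivial rotation. [folklore] -/
theorem im_one_mul_toC (v : ℤ × ℤ) : ((1 : ℂ) * toC v).im = v.2 := by simp [toC]
/-- Imaginary part after rotation by `−1`. [folklore] -/
theorem im_neg_one_mul_toC (v : ℤ × ℤ) : ((-1 : ℂ) * toC v).im = -v.2 := by simp [toC]

/-- **Evaluation of an angle at a lattice base point in a closed half-plane** `{Im(c ·) ≥ 0}`.
[folklore] -/
theorem angAt_vec {c : ℂ} (hc : c ≠ 0) {b P₀ P₁ : ℤ × ℤ} (h0 : 0 ≤ (c * toC (P₀ - b)).im) (h1 : 0 ≤ (c * toC (P₁ - b)).im)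
    (hac : 0 < sdot P₀ P₁ b) :
    angAt (toC b) (toC P₀) (toC P₁) = Complex.arg (c * toC (P₁ - b)) - Complex.arg (c * toC (P₀ - b)) := by
  have e0 : toC P₀ - toC b = toC (P₀ - b) := (toC_sub _ _).symm
  have e1 : toC P₁ - toC b = toC (P₁ - b) := (toC_sub _ _).symm
  have := angAt_eq_sub hc (b := toC b) (P₀ := toC P₀) (P₁ := toC P₁) (by rw [e0]; exact h0) (by rw [e1]; exact h1)
    (by rw [re_seg]; exact_mod_cast hac)
  rw [this, e0, e1]

/-- `toC` of an explicit pair. [folklore] -/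
theorem toC_mk (a b : ℤ) : toC (a, b) = (a : ℂ) + (b : ℂ) * I := rfl

/-! ### The twelve local computations -/

/-- Case `(W, N, E)`. [folklore] -/
theorem Loc_W_N_E : Loc .W .N .E = excursionWinding (π / 2) .W .N .E := by
  rw [Loc, L₁off, L₂off, tailExtOff]
  simp only [tailOffs, wOff, Xo, tailPts, Side.offset, Side.inOff, Side.nIn, List.length_cons, List.length_nil,
    List.getD_cons_zero, List.getD_cons_succ, Finset.sum_range_succ, Finset.sum_range_zero, zero_add, Nat.reduceAdd,
    if_true, if_false, Nat.succ_ne_zero, Prod.mk_sub_mk, Prod.mk_add_mk, arcTurn, excursionWinding]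
  norm_num
  have hpi := Real.pi_pos
  rw [angAt_vec (c := I) (b := ((0 : ℤ), (2 : ℤ))) (P₀ := ((1 : ℤ), (2 : ℤ))) (P₁ := ((2 : ℤ), (3 : ℤ))) (by norm_num)
    (by rw [show ((1 : ℤ), (2 : ℤ)) - ((0 : ℤ), (2 : ℤ)) = ((1 : ℤ), (0 : ℤ)) from by decide, im_I_mul_toC]; norm_num)
    (by rw [show ((2 : ℤ), (3 : ℤ)) - ((0 : ℤ), (2 : ℤ)) = ((2 : ℤ), (1 : ℤ)) from by decide, im_I_mul_toC]; norm_num) (by decide),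
    show ((2 : ℤ), (3 : ℤ)) - ((0 : ℤ), (2 : ℤ)) = ((2 : ℤ), (1 : ℤ)) from by decide, show ((1 : ℤ), (2 : ℤ)) - ((0 : ℤ), (2 : ℤ)) = ((1 : ℤ), (0 : ℤ)) from by decide]
  rw [angAt_vec (c := I) (b := ((0 : ℤ), (2 : ℤ))) (P₀ := ((5 : ℤ), (2 : ℤ))) (P₁ := ((3 : ℤ), (2 : ℤ))) (by norm_num)
    (by rw [show ((5 : ℤ), (2 : ℤ)) - ((0 : ℤ), (2 : ℤ)) = ((5 : ℤ), (0 : ℤ)) from by decide, im_I_mul_toC]; norm_num)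
    (by rw [show ((3 : ℤ), (2 : ℤ)) - ((0 : ℤ), (2 : ℤ)) = ((3 : ℤ), (0 : ℤ)) from by decide, im_I_mul_toC]; norm_num) (by decide),
    show ((3 : ℤ), (2 : ℤ)) - ((0 : ℤ), (2 : ℤ)) = ((3 : ℤ), (0 : ℤ)) from by decide, show ((5 : ℤ), (2 : ℤ)) - ((0 : ℤ), (2 : ℤ)) = ((5 : ℤ), (0 : ℤ)) from by decide]
  rw [angAt_vec (c := I) (b := ((0 : ℤ), (2 : ℤ))) (P₀ := ((3 : ℤ), (2 : ℤ))) (P₁ := ((2 : ℤ), (3 : ℤ))) (by norm_num)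
    (by rw [show ((3 : ℤ), (2 : ℤ)) - ((0 : ℤ), (2 : ℤ)) = ((3 : ℤ), (0 : ℤ)) from by decide, im_I_mul_toC]; norm_num)
    (by rw [show ((2 : ℤ), (3 : ℤ)) - ((0 : ℤ), (2 : ℤ)) = ((2 : ℤ), (1 : ℤ)) from by decide, im_I_mul_toC]; norm_num) (by decide),
    show ((2 : ℤ), (3 : ℤ)) - ((0 : ℤ), (2 : ℤ)) = ((2 : ℤ), (1 : ℤ)) from by decide, show ((3 : ℤ), (2 : ℤ)) - ((0 : ℤ), (2 : ℤ)) = ((3 : ℤ), (0 : ℤ)) from by decide]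
  rw [angAt_vec (c := I) (b := ((0 : ℤ), (2 : ℤ))) (P₀ := ((5 : ℤ), (2 : ℤ))) (P₁ := ((4 : ℤ), (2 : ℤ))) (by norm_num)
    (by rw [show ((5 : ℤ), (2 : ℤ)) - ((0 : ℤ), (2 : ℤ)) = ((5 : ℤ), (0 : ℤ)) from by decide, im_I_mul_toC]; norm_num)
    (by rw [show ((4 : ℤ), (2 : ℤ)) - ((0 : ℤ), (2 : ℤ)) = ((4 : ℤ), (0 : ℤ)) from by decide, im_I_mul_toC]; norm_num) (by decide),
    show ((4 : ℤ), (2 : ℤ)) - ((0 : ℤ), (2 : ℤ)) = ((4 : ℤ), (0 : ℤ)) from by decide, show ((5 : ℤ), (2 : ℤ)) - ((0 : ℤ), (2 : ℤ)) = ((5 : ℤ), (0 : ℤ)) from by decide]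
  rw [angAt_vec (c := I) (b := ((0 : ℤ), (2 : ℤ))) (P₀ := ((4 : ℤ), (2 : ℤ))) (P₁ := ((3 : ℤ), (1 : ℤ))) (by norm_num)
    (by rw [show ((4 : ℤ), (2 : ℤ)) - ((0 : ℤ), (2 : ℤ)) = ((4 : ℤ), (0 : ℤ)) from by decide, im_I_mul_toC]; norm_num)
    (by rw [show ((3 : ℤ), (1 : ℤ)) - ((0 : ℤ), (2 : ℤ)) = ((3 : ℤ), (-1 : ℤ)) from by decide, im_I_mul_toC]; norm_num) (by decide),
    show ((3 : ℤ), (1 : ℤ)) - ((0 : ℤ), (2 : ℤ)) = ((3 : ℤ), (-1 : ℤ)) from by decide, show ((4 : ℤ), (2 : ℤ)) - ((0 : ℤ), (2 : ℤ)) = ((4 : ℤ), (0 : ℤ)) from by decide]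
  rw [angAt_vec (c := I) (b := ((0 : ℤ), (2 : ℤ))) (P₀ := ((3 : ℤ), (1 : ℤ))) (P₁ := ((1 : ℤ), (1 : ℤ))) (by norm_num)
    (by rw [show ((3 : ℤ), (1 : ℤ)) - ((0 : ℤ), (2 : ℤ)) = ((3 : ℤ), (-1 : ℤ)) from by decide, im_I_mul_toC]; norm_num)
    (by rw [show ((1 : ℤ), (1 : ℤ)) - ((0 : ℤ), (2 : ℤ)) = ((1 : ℤ), (-1 : ℤ)) from by decide, im_I_mul_toC]; norm_num) (by decide),
    show ((1 : ℤ), (1 : ℤ)) - ((0 : ℤ), (2 : ℤ)) = ((1 : ℤ), (-1 : ℤ)) from by decide, show ((3 : ℤ), (1 : ℤ)) - ((0 : ℤ), (2 : ℤ)) = ((3 : ℤ), (-1 : ℤ)) from by decide]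
  rw [angAt_vec (c := (1 : ℂ)) (b := ((1 : ℤ), (1 : ℤ))) (P₀ := ((0 : ℤ), (2 : ℤ))) (P₁ := ((1 : ℤ), (2 : ℤ))) (one_ne_zero)
    (by rw [show ((0 : ℤ), (2 : ℤ)) - ((1 : ℤ), (1 : ℤ)) = ((-1 : ℤ), (1 : ℤ)) from by decide, im_one_mul_toC]; norm_num)
    (by rw [show ((1 : ℤ), (2 : ℤ)) - ((1 : ℤ), (1 : ℤ)) = ((0 : ℤ), (1 : ℤ)) from by decide, im_one_mul_toC]; norm_num) (by decide),
    show ((1 : ℤ), (2 : ℤ)) - ((1 : ℤ), (1 : ℤ)) = ((0 : ℤ), (1 : ℤ)) from by decide, show ((0 : ℤ), (2 : ℤ)) - ((1 : ℤ), (1 : ℤ)) = ((-1 : ℤ), (1 : ℤ)) from by decide]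
  rw [angAt_vec (c := (1 : ℂ)) (b := ((1 : ℤ), (1 : ℤ))) (P₀ := ((1 : ℤ), (2 : ℤ))) (P₁ := ((2 : ℤ), (3 : ℤ))) (one_ne_zero)
    (by rw [show ((1 : ℤ), (2 : ℤ)) - ((1 : ℤ), (1 : ℤ)) = ((0 : ℤ), (1 : ℤ)) from by decide, im_one_mul_toC]; norm_num)
    (by rw [show ((2 : ℤ), (3 : ℤ)) - ((1 : ℤ), (1 : ℤ)) = ((1 : ℤ), (2 : ℤ)) from by decide, im_one_mul_toC]; norm_num) (by decide),
    show ((2 : ℤ), (3 : ℤ)) - ((1 : ℤ), (1 : ℤ)) = ((1 : ℤ), (2 : ℤ)) from by decide, show ((1 : ℤ), (2 : ℤ)) - ((1 : ℤ), (1 : ℤ)) = ((0 : ℤ), (1 : ℤ)) from by decide]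
  rw [angAt_vec (c := (1 : ℂ)) (b := ((1 : ℤ), (1 : ℤ))) (P₀ := ((5 : ℤ), (2 : ℤ))) (P₁ := ((3 : ℤ), (2 : ℤ))) (one_ne_zero)
    (by rw [show ((5 : ℤ), (2 : ℤ)) - ((1 : ℤ), (1 : ℤ)) = ((4 : ℤ), (1 : ℤ)) from by decide, im_one_mul_toC]; norm_num)
    (by rw [show ((3 : ℤ), (2 : ℤ)) - ((1 : ℤ), (1 : ℤ)) = ((2 : ℤ), (1 : ℤ)) from by decide, im_one_mul_toC]; norm_num) (by decide),
    show ((3 : ℤ), (2 : ℤ)) - ((1 : ℤ), (1 : ℤ)) = ((2 : ℤ), (1 : ℤ)) from by decide, show ((5 : ℤ), (2 : ℤ)) - ((1 : ℤ), (1 : ℤ)) = ((4 : ℤ), (1 : ℤ)) from by decide]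
  rw [angAt_vec (c := (1 : ℂ)) (b := ((1 : ℤ), (1 : ℤ))) (P₀ := ((3 : ℤ), (2 : ℤ))) (P₁ := ((2 : ℤ), (3 : ℤ))) (one_ne_zero)
    (by rw [show ((3 : ℤ), (2 : ℤ)) - ((1 : ℤ), (1 : ℤ)) = ((2 : ℤ), (1 : ℤ)) from by decide, im_one_mul_toC]; norm_num)
    (by rw [show ((2 : ℤ), (3 : ℤ)) - ((1 : ℤ), (1 : ℤ)) = ((1 : ℤ), (2 : ℤ)) from by decide, im_one_mul_toC]; norm_num) (by decide),
    show ((2 : ℤ), (3 : ℤ)) - ((1 : ℤ), (1 : ℤ)) = ((1 : ℤ), (2 : ℤ)) from by decide, show ((3 : ℤ), (2 : ℤ)) - ((1 : ℤ), (1 : ℤ)) = ((2 : ℤ), (1 : ℤ)) from by decide]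
  rw [angAt_vec (c := (1 : ℂ)) (b := ((1 : ℤ), (1 : ℤ))) (P₀ := ((5 : ℤ), (2 : ℤ))) (P₁ := ((4 : ℤ), (2 : ℤ))) (one_ne_zero)
    (by rw [show ((5 : ℤ), (2 : ℤ)) - ((1 : ℤ), (1 : ℤ)) = ((4 : ℤ), (1 : ℤ)) from by decide, im_one_mul_toC]; norm_num)
    (by rw [show ((4 : ℤ), (2 : ℤ)) - ((1 : ℤ), (1 : ℤ)) = ((3 : ℤ), (1 : ℤ)) from by decide, im_one_mul_toC]; norm_num) (by decide),
    show ((4 : ℤ), (2 : ℤ)) - ((1 : ℤ), (1 : ℤ)) = ((3 : ℤ), (1 : ℤ)) from by decide, show ((5 : ℤ), (2 : ℤ)) - ((1 : ℤ), (1 : ℤ)) = ((4 : ℤ), (1 : ℤ)) from by decide]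
  rw [angAt_vec (c := (1 : ℂ)) (b := ((1 : ℤ), (1 : ℤ))) (P₀ := ((4 : ℤ), (2 : ℤ))) (P₁ := ((3 : ℤ), (1 : ℤ))) (one_ne_zero)
    (by rw [show ((4 : ℤ), (2 : ℤ)) - ((1 : ℤ), (1 : ℤ)) = ((3 : ℤ), (1 : ℤ)) from by decide, im_one_mul_toC]; norm_num)
    (by rw [show ((3 : ℤ), (1 : ℤ)) - ((1 : ℤ), (1 : ℤ)) = ((2 : ℤ), (0 : ℤ)) from by decide, im_one_mul_toC]; norm_num) (by decide),
    show ((3 : ℤ), (1 : ℤ)) - ((1 : ℤ), (1 : ℤ)) = ((2 : ℤ), (0 : ℤ)) from by decide, show ((4 : ℤ), (2 : ℤ)) - ((1 : ℤ), (1 : ℤ)) = ((3 : ℤ), (1 : ℤ)) from by decide]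
  have ha0 : Complex.arg ((1 : ℂ) * toC ((-1 : ℤ), (1 : ℤ))) = 3 * π / 4 := by
    rw [show (1 : ℂ) * toC ((-1 : ℤ), (1 : ℤ)) = (-1 + I) by apply Complex.ext <;> simp [toC]]; exact arg_neg_one_add_I
  have ha1 : Complex.arg ((1 : ℂ) * toC ((2 : ℤ), (0 : ℤ))) = 0 := by
    rw [show (1 : ℂ) * toC ((2 : ℤ), (0 : ℤ)) = ((2 : ℝ) : ℂ) * 1 by apply Complex.ext <;> simp [toC], Complex.arg_real_mul _ (by norm_num)]
    exact Complex.arg_one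
  have ha2 : Complex.arg (I * toC ((1 : ℤ), (-1 : ℤ))) = π / 4 := by
    rw [show I * toC ((1 : ℤ), (-1 : ℤ)) = (1 + I) by apply Complex.ext <;> simp [toC]]; exact arg_one_add_I
  have ha3 : Complex.arg (I * toC ((1 : ℤ), (0 : ℤ))) = π / 2 := by
    rw [show I * toC ((1 : ℤ), (0 : ℤ)) = I by apply Complex.ext <;> simp [toC]]; exact Complex.arg_I
  have hb0_1 : Complex.arg (toC ((-1 : ℤ), (0 : ℤ))) = π := by
    rw [show toC ((-1 : ℤ), (0 : ℤ)) = -1 by apply Complex.ext <;> simp [toC]]; exact Complex.arg_neg_one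
  have hb0_2 : Complex.arg (toC ((-1 : ℤ), (-1 : ℤ))) = -(3 * π / 4) := by
    rw [show toC ((-1 : ℤ), (-1 : ℤ)) = (-1 - I) by apply Complex.ext <;> simp [toC]]; exact arg_neg_one_sub_I
  have ht0 : ((Complex.arg (toC ((-1 : ℤ), (-1 : ℤ))) : Real.Angle) - (Complex.arg (toC ((-1 : ℤ), (0 : ℤ))) : Real.Angle)).toReal = (-(3 * π / 4)) - (π) + 2 * π := by
    rw [hb0_2, hb0_1, ← Real.Angle.coe_sub]; exact toReal_coe_of_mem_add (by constructor <;> linarith)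
  have hb1_1 : Complex.arg (toC ((-1 : ℤ), (-1 : ℤ))) = -(3 * π / 4) := by
    rw [show toC ((-1 : ℤ), (-1 : ℤ)) = (-1 - I) by apply Complex.ext <;> simp [toC]]; exact arg_neg_one_sub_I
  have hb1_2 : Complex.arg (toC ((-2 : ℤ), (0 : ℤ))) = π := by
    rw [show toC ((-2 : ℤ), (0 : ℤ)) = ((2 : ℝ) : ℂ) * -1 by apply Complex.ext <;> simp [toC], Complex.arg_real_mul _ (by norm_num)]
    exact Complex.arg_neg_one
  have ht1 : ((Complex.arg (toC ((-2 : ℤ), (0 : ℤ))) : Real.Angle) - (Complex.arg (toC ((-1 : ℤ), (-1 : ℤ))) : Real.Angle)).toReal = (π) - (-(3 * π / 4)) - 2 * π := by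
    rw [hb1_2, hb1_1, ← Real.Angle.coe_sub]; exact toReal_coe_of_mem_sub (by constructor <;> linarith)
  linarith [ha0, ha1, ha2, ha3, ht0, ht1]

/-- Case `(W, S, E)`. [folklore] -/
theorem Loc_W_S_E : Loc .W .S .E = excursionWinding (π / 2) .W .S .E := by
  rw [Loc, L₁off, L₂off, tailExtOff]
  simp only [tailOffs, wOff, Xo, tailPts, Side.offset, Side.inOff, Side.nIn, List.length_cons, List.length_nil,
    List.getD_cons_zero, List.getD_cons_succ, Finset.sum_range_succ, Finset.sum_range_zero, zero_add, Nat.reduceAdd,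
    if_true, if_false, Nat.succ_ne_zero, Prod.mk_sub_mk, Prod.mk_add_mk, arcTurn, excursionWinding]
  norm_num
  have hpi := Real.pi_pos
  rw [angAt_vec (c := I) (b := ((0 : ℤ), (2 : ℤ))) (P₀ := ((1 : ℤ), (2 : ℤ))) (P₁ := ((2 : ℤ), (1 : ℤ))) (by norm_num)
    (by rw [show ((1 : ℤ), (2 : ℤ)) - ((0 : ℤ), (2 : ℤ)) = ((1 : ℤ), (0 : ℤ)) from by decide, im_I_mul_toC]; norm_num)
    (by rw [show ((2 : ℤ), (1 : ℤ)) - ((0 : ℤ), (2 : ℤ)) = ((2 : ℤ), (-1 : ℤ)) from by decide, im_I_mul_toC]; norm_num) (by decide),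
    show ((2 : ℤ), (1 : ℤ)) - ((0 : ℤ), (2 : ℤ)) = ((2 : ℤ), (-1 : ℤ)) from by decide, show ((1 : ℤ), (2 : ℤ)) - ((0 : ℤ), (2 : ℤ)) = ((1 : ℤ), (0 : ℤ)) from by decide]
  rw [angAt_vec (c := I) (b := ((0 : ℤ), (2 : ℤ))) (P₀ := ((5 : ℤ), (2 : ℤ))) (P₁ := ((3 : ℤ), (2 : ℤ))) (by norm_num)
    (by rw [show ((5 : ℤ), (2 : ℤ)) - ((0 : ℤ), (2 : ℤ)) = ((5 : ℤ), (0 : ℤ)) from by decide, im_I_mul_toC]; norm_num)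
    (by rw [show ((3 : ℤ), (2 : ℤ)) - ((0 : ℤ), (2 : ℤ)) = ((3 : ℤ), (0 : ℤ)) from by decide, im_I_mul_toC]; norm_num) (by decide),
    show ((3 : ℤ), (2 : ℤ)) - ((0 : ℤ), (2 : ℤ)) = ((3 : ℤ), (0 : ℤ)) from by decide, show ((5 : ℤ), (2 : ℤ)) - ((0 : ℤ), (2 : ℤ)) = ((5 : ℤ), (0 : ℤ)) from by decide]
  rw [angAt_vec (c := I) (b := ((0 : ℤ), (2 : ℤ))) (P₀ := ((3 : ℤ), (2 : ℤ))) (P₁ := ((2 : ℤ), (1 : ℤ))) (by norm_num)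
    (by rw [show ((3 : ℤ), (2 : ℤ)) - ((0 : ℤ), (2 : ℤ)) = ((3 : ℤ), (0 : ℤ)) from by decide, im_I_mul_toC]; norm_num)
    (by rw [show ((2 : ℤ), (1 : ℤ)) - ((0 : ℤ), (2 : ℤ)) = ((2 : ℤ), (-1 : ℤ)) from by decide, im_I_mul_toC]; norm_num) (by decide),
    show ((2 : ℤ), (1 : ℤ)) - ((0 : ℤ), (2 : ℤ)) = ((2 : ℤ), (-1 : ℤ)) from by decide, show ((3 : ℤ), (2 : ℤ)) - ((0 : ℤ), (2 : ℤ)) = ((3 : ℤ), (0 : ℤ)) from by decide]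
  rw [angAt_vec (c := I) (b := ((0 : ℤ), (2 : ℤ))) (P₀ := ((5 : ℤ), (2 : ℤ))) (P₁ := ((4 : ℤ), (2 : ℤ))) (by norm_num)
    (by rw [show ((5 : ℤ), (2 : ℤ)) - ((0 : ℤ), (2 : ℤ)) = ((5 : ℤ), (0 : ℤ)) from by decide, im_I_mul_toC]; norm_num)
    (by rw [show ((4 : ℤ), (2 : ℤ)) - ((0 : ℤ), (2 : ℤ)) = ((4 : ℤ), (0 : ℤ)) from by decide, im_I_mul_toC]; norm_num) (by decide),
    show ((4 : ℤ), (2 : ℤ)) - ((0 : ℤ), (2 : ℤ)) = ((4 : ℤ), (0 : ℤ)) from by decide, show ((5 : ℤ), (2 : ℤ)) - ((0 : ℤ), (2 : ℤ)) = ((5 : ℤ), (0 : ℤ)) from by decide]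
  rw [angAt_vec (c := I) (b := ((0 : ℤ), (2 : ℤ))) (P₀ := ((4 : ℤ), (2 : ℤ))) (P₁ := ((3 : ℤ), (3 : ℤ))) (by norm_num)
    (by rw [show ((4 : ℤ), (2 : ℤ)) - ((0 : ℤ), (2 : ℤ)) = ((4 : ℤ), (0 : ℤ)) from by decide, im_I_mul_toC]; norm_num)
    (by rw [show ((3 : ℤ), (3 : ℤ)) - ((0 : ℤ), (2 : ℤ)) = ((3 : ℤ), (1 : ℤ)) from by decide, im_I_mul_toC]; norm_num) (by decide),
    show ((3 : ℤ), (3 : ℤ)) - ((0 : ℤ), (2 : ℤ)) = ((3 : ℤ), (1 : ℤ)) from by decide, show ((4 : ℤ), (2 : ℤ)) - ((0 : ℤ), (2 : ℤ)) = ((4 : ℤ), (0 : ℤ)) from by decide]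
  rw [angAt_vec (c := I) (b := ((0 : ℤ), (2 : ℤ))) (P₀ := ((3 : ℤ), (3 : ℤ))) (P₁ := ((1 : ℤ), (3 : ℤ))) (by norm_num)
    (by rw [show ((3 : ℤ), (3 : ℤ)) - ((0 : ℤ), (2 : ℤ)) = ((3 : ℤ), (1 : ℤ)) from by decide, im_I_mul_toC]; norm_num)
    (by rw [show ((1 : ℤ), (3 : ℤ)) - ((0 : ℤ), (2 : ℤ)) = ((1 : ℤ), (1 : ℤ)) from by decide, im_I_mul_toC]; norm_num) (by decide),
    show ((1 : ℤ), (3 : ℤ)) - ((0 : ℤ), (2 : ℤ)) = ((1 : ℤ), (1 : ℤ)) from by decide, show ((3 : ℤ), (3 : ℤ)) - ((0 : ℤ), (2 : ℤ)) = ((3 : ℤ), (1 : ℤ)) from by decide]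
  rw [angAt_vec (c := (-1 : ℂ)) (b := ((1 : ℤ), (3 : ℤ))) (P₀ := ((0 : ℤ), (2 : ℤ))) (P₁ := ((1 : ℤ), (2 : ℤ))) (by norm_num)
    (by rw [show ((0 : ℤ), (2 : ℤ)) - ((1 : ℤ), (3 : ℤ)) = ((-1 : ℤ), (-1 : ℤ)) from by decide, im_neg_one_mul_toC]; norm_num)
    (by rw [show ((1 : ℤ), (2 : ℤ)) - ((1 : ℤ), (3 : ℤ)) = ((0 : ℤ), (-1 : ℤ)) from by decide, im_neg_one_mul_toC]; norm_num) (by decide),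
    show ((1 : ℤ), (2 : ℤ)) - ((1 : ℤ), (3 : ℤ)) = ((0 : ℤ), (-1 : ℤ)) from by decide, show ((0 : ℤ), (2 : ℤ)) - ((1 : ℤ), (3 : ℤ)) = ((-1 : ℤ), (-1 : ℤ)) from by decide]
  rw [angAt_vec (c := (-1 : ℂ)) (b := ((1 : ℤ), (3 : ℤ))) (P₀ := ((1 : ℤ), (2 : ℤ))) (P₁ := ((2 : ℤ), (1 : ℤ))) (by norm_num)
    (by rw [show ((1 : ℤ), (2 : ℤ)) - ((1 : ℤ), (3 : ℤ)) = ((0 : ℤ), (-1 : ℤ)) from by decide, im_neg_one_mul_toC]; norm_num)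
    (by rw [show ((2 : ℤ), (1 : ℤ)) - ((1 : ℤ), (3 : ℤ)) = ((1 : ℤ), (-2 : ℤ)) from by decide, im_neg_one_mul_toC]; norm_num) (by decide),
    show ((2 : ℤ), (1 : ℤ)) - ((1 : ℤ), (3 : ℤ)) = ((1 : ℤ), (-2 : ℤ)) from by decide, show ((1 : ℤ), (2 : ℤ)) - ((1 : ℤ), (3 : ℤ)) = ((0 : ℤ), (-1 : ℤ)) from by decide]
  rw [angAt_vec (c := (-1 : ℂ)) (b := ((1 : ℤ), (3 : ℤ))) (P₀ := ((5 : ℤ), (2 : ℤ))) (P₁ := ((3 : ℤ), (2 : ℤ))) (by norm_num)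
    (by rw [show ((5 : ℤ), (2 : ℤ)) - ((1 : ℤ), (3 : ℤ)) = ((4 : ℤ), (-1 : ℤ)) from by decide, im_neg_one_mul_toC]; norm_num)
    (by rw [show ((3 : ℤ), (2 : ℤ)) - ((1 : ℤ), (3 : ℤ)) = ((2 : ℤ), (-1 : ℤ)) from by decide, im_neg_one_mul_toC]; norm_num) (by decide),
    show ((3 : ℤ), (2 : ℤ)) - ((1 : ℤ), (3 : ℤ)) = ((2 : ℤ), (-1 : ℤ)) from by decide, show ((5 : ℤ), (2 : ℤ)) - ((1 : ℤ), (3 : ℤ)) = ((4 : ℤ), (-1 : ℤ)) from by decide]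
  rw [angAt_vec (c := (-1 : ℂ)) (b := ((1 : ℤ), (3 : ℤ))) (P₀ := ((3 : ℤ), (2 : ℤ))) (P₁ := ((2 : ℤ), (1 : ℤ))) (by norm_num)
    (by rw [show ((3 : ℤ), (2 : ℤ)) - ((1 : ℤ), (3 : ℤ)) = ((2 : ℤ), (-1 : ℤ)) from by decide, im_neg_one_mul_toC]; norm_num)
    (by rw [show ((2 : ℤ), (1 : ℤ)) - ((1 : ℤ), (3 : ℤ)) = ((1 : ℤ), (-2 : ℤ)) from by decide, im_neg_one_mul_toC]; norm_num) (by decide),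
    show ((2 : ℤ), (1 : ℤ)) - ((1 : ℤ), (3 : ℤ)) = ((1 : ℤ), (-2 : ℤ)) from by decide, show ((3 : ℤ), (2 : ℤ)) - ((1 : ℤ), (3 : ℤ)) = ((2 : ℤ), (-1 : ℤ)) from by decide]
  rw [angAt_vec (c := (-1 : ℂ)) (b := ((1 : ℤ), (3 : ℤ))) (P₀ := ((5 : ℤ), (2 : ℤ))) (P₁ := ((4 : ℤ), (2 : ℤ))) (by norm_num)
    (by rw [show ((5 : ℤ), (2 : ℤ)) - ((1 : ℤ), (3 : ℤ)) = ((4 : ℤ), (-1 : ℤ)) from by decide, im_neg_one_mul_toC]; norm_num)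
    (by rw [show ((4 : ℤ), (2 : ℤ)) - ((1 : ℤ), (3 : ℤ)) = ((3 : ℤ), (-1 : ℤ)) from by decide, im_neg_one_mul_toC]; norm_num) (by decide),
    show ((4 : ℤ), (2 : ℤ)) - ((1 : ℤ), (3 : ℤ)) = ((3 : ℤ), (-1 : ℤ)) from by decide, show ((5 : ℤ), (2 : ℤ)) - ((1 : ℤ), (3 : ℤ)) = ((4 : ℤ), (-1 : ℤ)) from by decide]
  rw [angAt_vec (c := (-1 : ℂ)) (b := ((1 : ℤ), (3 : ℤ))) (P₀ := ((4 : ℤ), (2 : ℤ))) (P₁ := ((3 : ℤ), (3 : ℤ))) (by norm_num)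
    (by rw [show ((4 : ℤ), (2 : ℤ)) - ((1 : ℤ), (3 : ℤ)) = ((3 : ℤ), (-1 : ℤ)) from by decide, im_neg_one_mul_toC]; norm_num)
    (by rw [show ((3 : ℤ), (3 : ℤ)) - ((1 : ℤ), (3 : ℤ)) = ((2 : ℤ), (0 : ℤ)) from by decide, im_neg_one_mul_toC]; norm_num) (by decide),
    show ((3 : ℤ), (3 : ℤ)) - ((1 : ℤ), (3 : ℤ)) = ((2 : ℤ), (0 : ℤ)) from by decide, show ((4 : ℤ), (2 : ℤ)) - ((1 : ℤ), (3 : ℤ)) = ((3 : ℤ), (-1 : ℤ)) from by decide]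
  have ha0 : Complex.arg ((-1 : ℂ) * toC ((-1 : ℤ), (-1 : ℤ))) = π / 4 := by
    rw [show (-1 : ℂ) * toC ((-1 : ℤ), (-1 : ℤ)) = (1 + I) by apply Complex.ext <;> simp [toC]]; exact arg_one_add_I
  have ha1 : Complex.arg ((-1 : ℂ) * toC ((2 : ℤ), (0 : ℤ))) = π := by
    rw [show (-1 : ℂ) * toC ((2 : ℤ), (0 : ℤ)) = ((2 : ℝ) : ℂ) * -1 by apply Complex.ext <;> simp [toC], Complex.arg_real_mul _ (by norm_num)]
    exact Complex.arg_neg_one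
  have ha2 : Complex.arg (I * toC ((1 : ℤ), (0 : ℤ))) = π / 2 := by
    rw [show I * toC ((1 : ℤ), (0 : ℤ)) = I by apply Complex.ext <;> simp [toC]]; exact Complex.arg_I
  have ha3 : Complex.arg (I * toC ((1 : ℤ), (1 : ℤ))) = 3 * π / 4 := by
    rw [show I * toC ((1 : ℤ), (1 : ℤ)) = (-1 + I) by apply Complex.ext <;> simp [toC]]; exact arg_neg_one_add_I
  have hb0_1 : Complex.arg (toC ((-1 : ℤ), (0 : ℤ))) = π := by
    rw [show toC ((-1 : ℤ), (0 : ℤ)) = -1 by apply Complex.ext <;> simp [toC]]; exact Complex.arg_neg_one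
  have hb0_2 : Complex.arg (toC ((-1 : ℤ), (1 : ℤ))) = 3 * π / 4 := by
    rw [show toC ((-1 : ℤ), (1 : ℤ)) = (-1 + I) by apply Complex.ext <;> simp [toC]]; exact arg_neg_one_add_I
  have ht0 : ((Complex.arg (toC ((-1 : ℤ), (1 : ℤ))) : Real.Angle) - (Complex.arg (toC ((-1 : ℤ), (0 : ℤ))) : Real.Angle)).toReal = (3 * π / 4) - (π) := by
    rw [hb0_2, hb0_1, ← Real.Angle.coe_sub]; exact toReal_coe_of_mem (by constructor <;> linarith)
  have hb1_1 : Complex.arg (toC ((-1 : ℤ), (1 : ℤ))) = 3 * π / 4 := by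
    rw [show toC ((-1 : ℤ), (1 : ℤ)) = (-1 + I) by apply Complex.ext <;> simp [toC]]; exact arg_neg_one_add_I
  have hb1_2 : Complex.arg (toC ((-2 : ℤ), (0 : ℤ))) = π := by
    rw [show toC ((-2 : ℤ), (0 : ℤ)) = ((2 : ℝ) : ℂ) * -1 by apply Complex.ext <;> simp [toC], Complex.arg_real_mul _ (by norm_num)]
    exact Complex.arg_neg_one
  have ht1 : ((Complex.arg (toC ((-2 : ℤ), (0 : ℤ))) : Real.Angle) - (Complex.arg (toC ((-1 : ℤ), (1 : ℤ))) : Real.Angle)).toReal = (π) - (3 * π / 4) := by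
    rw [hb1_2, hb1_1, ← Real.Angle.coe_sub]; exact toReal_coe_of_mem (by constructor <;> linarith)
  linarith [ha0, ha1, ha2, ha3, ht0, ht1]

/-- Case `(W, N, S)`. [folklore] -/
theorem Loc_W_N_S : Loc .W .N .S = excursionWinding (π / 2) .W .N .S := by
  rw [Loc, L₁off, L₂off, tailExtOff]
  simp only [tailOffs, wOff, Xo, tailPts, Side.offset, Side.inOff, Side.nIn, List.length_cons, List.length_nil,
    List.getD_cons_zero, List.getD_cons_succ, Finset.sum_range_succ, Finset.sum_range_zero, zero_add, Nat.reduceAdd,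
    if_true, if_false, Nat.succ_ne_zero, Prod.mk_sub_mk, Prod.mk_add_mk, arcTurn, excursionWinding]
  norm_num
  have hpi := Real.pi_pos
  rw [angAt_vec (c := I) (b := ((0 : ℤ), (2 : ℤ))) (P₀ := ((1 : ℤ), (2 : ℤ))) (P₁ := ((2 : ℤ), (3 : ℤ))) (by norm_num)
    (by rw [show ((1 : ℤ), (2 : ℤ)) - ((0 : ℤ), (2 : ℤ)) = ((1 : ℤ), (0 : ℤ)) from by decide, im_I_mul_toC]; norm_num)
    (by rw [show ((2 : ℤ), (3 : ℤ)) - ((0 : ℤ), (2 : ℤ)) = ((2 : ℤ), (1 : ℤ)) from by decide, im_I_mul_toC]; norm_num) (by decide),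
    show ((2 : ℤ), (3 : ℤ)) - ((0 : ℤ), (2 : ℤ)) = ((2 : ℤ), (1 : ℤ)) from by decide, show ((1 : ℤ), (2 : ℤ)) - ((0 : ℤ), (2 : ℤ)) = ((1 : ℤ), (0 : ℤ)) from by decide]
  rw [angAt_vec (c := I) (b := ((0 : ℤ), (2 : ℤ))) (P₀ := ((2 : ℤ), (-1 : ℤ))) (P₁ := ((2 : ℤ), (1 : ℤ))) (by norm_num)
    (by rw [show ((2 : ℤ), (-1 : ℤ)) - ((0 : ℤ), (2 : ℤ)) = ((2 : ℤ), (-3 : ℤ)) from by decide, im_I_mul_toC]; norm_num)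
    (by rw [show ((2 : ℤ), (1 : ℤ)) - ((0 : ℤ), (2 : ℤ)) = ((2 : ℤ), (-1 : ℤ)) from by decide, im_I_mul_toC]; norm_num) (by decide),
    show ((2 : ℤ), (1 : ℤ)) - ((0 : ℤ), (2 : ℤ)) = ((2 : ℤ), (-1 : ℤ)) from by decide, show ((2 : ℤ), (-1 : ℤ)) - ((0 : ℤ), (2 : ℤ)) = ((2 : ℤ), (-3 : ℤ)) from by decide]
  rw [angAt_vec (c := I) (b := ((0 : ℤ), (2 : ℤ))) (P₀ := ((2 : ℤ), (1 : ℤ))) (P₁ := ((2 : ℤ), (3 : ℤ))) (by norm_num)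
    (by rw [show ((2 : ℤ), (1 : ℤ)) - ((0 : ℤ), (2 : ℤ)) = ((2 : ℤ), (-1 : ℤ)) from by decide, im_I_mul_toC]; norm_num)
    (by rw [show ((2 : ℤ), (3 : ℤ)) - ((0 : ℤ), (2 : ℤ)) = ((2 : ℤ), (1 : ℤ)) from by decide, im_I_mul_toC]; norm_num) (by decide),
    show ((2 : ℤ), (3 : ℤ)) - ((0 : ℤ), (2 : ℤ)) = ((2 : ℤ), (1 : ℤ)) from by decide, show ((2 : ℤ), (1 : ℤ)) - ((0 : ℤ), (2 : ℤ)) = ((2 : ℤ), (-1 : ℤ)) from by decide]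
  rw [angAt_vec (c := I) (b := ((0 : ℤ), (2 : ℤ))) (P₀ := ((2 : ℤ), (-1 : ℤ))) (P₁ := ((2 : ℤ), (0 : ℤ))) (by norm_num)
    (by rw [show ((2 : ℤ), (-1 : ℤ)) - ((0 : ℤ), (2 : ℤ)) = ((2 : ℤ), (-3 : ℤ)) from by decide, im_I_mul_toC]; norm_num)
    (by rw [show ((2 : ℤ), (0 : ℤ)) - ((0 : ℤ), (2 : ℤ)) = ((2 : ℤ), (-2 : ℤ)) from by decide, im_I_mul_toC]; norm_num) (by decide),
    show ((2 : ℤ), (0 : ℤ)) - ((0 : ℤ), (2 : ℤ)) = ((2 : ℤ), (-2 : ℤ)) from by decide, show ((2 : ℤ), (-1 : ℤ)) - ((0 : ℤ), (2 : ℤ)) = ((2 : ℤ), (-3 : ℤ)) from by decide]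
  rw [angAt_vec (c := I) (b := ((0 : ℤ), (2 : ℤ))) (P₀ := ((2 : ℤ), (0 : ℤ))) (P₁ := ((1 : ℤ), (1 : ℤ))) (by norm_num)
    (by rw [show ((2 : ℤ), (0 : ℤ)) - ((0 : ℤ), (2 : ℤ)) = ((2 : ℤ), (-2 : ℤ)) from by decide, im_I_mul_toC]; norm_num)
    (by rw [show ((1 : ℤ), (1 : ℤ)) - ((0 : ℤ), (2 : ℤ)) = ((1 : ℤ), (-1 : ℤ)) from by decide, im_I_mul_toC]; norm_num) (by decide),
    show ((1 : ℤ), (1 : ℤ)) - ((0 : ℤ), (2 : ℤ)) = ((1 : ℤ), (-1 : ℤ)) from by decide, show ((2 : ℤ), (0 : ℤ)) - ((0 : ℤ), (2 : ℤ)) = ((2 : ℤ), (-2 : ℤ)) from by decide]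
  rw [angAt_vec (c := (1 : ℂ)) (b := ((1 : ℤ), (1 : ℤ))) (P₀ := ((0 : ℤ), (2 : ℤ))) (P₁ := ((1 : ℤ), (2 : ℤ))) (one_ne_zero)
    (by rw [show ((0 : ℤ), (2 : ℤ)) - ((1 : ℤ), (1 : ℤ)) = ((-1 : ℤ), (1 : ℤ)) from by decide, im_one_mul_toC]; norm_num)
    (by rw [show ((1 : ℤ), (2 : ℤ)) - ((1 : ℤ), (1 : ℤ)) = ((0 : ℤ), (1 : ℤ)) from by decide, im_one_mul_toC]; norm_num) (by decide),
    show ((1 : ℤ), (2 : ℤ)) - ((1 : ℤ), (1 : ℤ)) = ((0 : ℤ), (1 : ℤ)) from by decide, show ((0 : ℤ), (2 : ℤ)) - ((1 : ℤ), (1 : ℤ)) = ((-1 : ℤ), (1 : ℤ)) from by decide]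
  rw [angAt_vec (c := (1 : ℂ)) (b := ((1 : ℤ), (1 : ℤ))) (P₀ := ((1 : ℤ), (2 : ℤ))) (P₁ := ((2 : ℤ), (3 : ℤ))) (one_ne_zero)
    (by rw [show ((1 : ℤ), (2 : ℤ)) - ((1 : ℤ), (1 : ℤ)) = ((0 : ℤ), (1 : ℤ)) from by decide, im_one_mul_toC]; norm_num)
    (by rw [show ((2 : ℤ), (3 : ℤ)) - ((1 : ℤ), (1 : ℤ)) = ((1 : ℤ), (2 : ℤ)) from by decide, im_one_mul_toC]; norm_num) (by decide),
    show ((2 : ℤ), (3 : ℤ)) - ((1 : ℤ), (1 : ℤ)) = ((1 : ℤ), (2 : ℤ)) from by decide, show ((1 : ℤ), (2 : ℤ)) - ((1 : ℤ), (1 : ℤ)) = ((0 : ℤ), (1 : ℤ)) from by decide]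
  rw [angAt_vec (c := (-1 : ℂ)) (b := ((1 : ℤ), (1 : ℤ))) (P₀ := ((2 : ℤ), (-1 : ℤ))) (P₁ := ((2 : ℤ), (1 : ℤ))) (by norm_num)
    (by rw [show ((2 : ℤ), (-1 : ℤ)) - ((1 : ℤ), (1 : ℤ)) = ((1 : ℤ), (-2 : ℤ)) from by decide, im_neg_one_mul_toC]; norm_num)
    (by rw [show ((2 : ℤ), (1 : ℤ)) - ((1 : ℤ), (1 : ℤ)) = ((1 : ℤ), (0 : ℤ)) from by decide, im_neg_one_mul_toC]; norm_num) (by decide),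
    show ((2 : ℤ), (1 : ℤ)) - ((1 : ℤ), (1 : ℤ)) = ((1 : ℤ), (0 : ℤ)) from by decide, show ((2 : ℤ), (-1 : ℤ)) - ((1 : ℤ), (1 : ℤ)) = ((1 : ℤ), (-2 : ℤ)) from by decide]
  rw [angAt_vec (c := (1 : ℂ)) (b := ((1 : ℤ), (1 : ℤ))) (P₀ := ((2 : ℤ), (1 : ℤ))) (P₁ := ((2 : ℤ), (3 : ℤ))) (one_ne_zero)
    (by rw [show ((2 : ℤ), (1 : ℤ)) - ((1 : ℤ), (1 : ℤ)) = ((1 : ℤ), (0 : ℤ)) from by decide, im_one_mul_toC]; norm_num)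
    (by rw [show ((2 : ℤ), (3 : ℤ)) - ((1 : ℤ), (1 : ℤ)) = ((1 : ℤ), (2 : ℤ)) from by decide, im_one_mul_toC]; norm_num) (by decide),
    show ((2 : ℤ), (3 : ℤ)) - ((1 : ℤ), (1 : ℤ)) = ((1 : ℤ), (2 : ℤ)) from by decide, show ((2 : ℤ), (1 : ℤ)) - ((1 : ℤ), (1 : ℤ)) = ((1 : ℤ), (0 : ℤ)) from by decide]
  rw [angAt_vec (c := (-1 : ℂ)) (b := ((1 : ℤ), (1 : ℤ))) (P₀ := ((2 : ℤ), (-1 : ℤ))) (P₁ := ((2 : ℤ), (0 : ℤ))) (by norm_num)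
    (by rw [show ((2 : ℤ), (-1 : ℤ)) - ((1 : ℤ), (1 : ℤ)) = ((1 : ℤ), (-2 : ℤ)) from by decide, im_neg_one_mul_toC]; norm_num)
    (by rw [show ((2 : ℤ), (0 : ℤ)) - ((1 : ℤ), (1 : ℤ)) = ((1 : ℤ), (-1 : ℤ)) from by decide, im_neg_one_mul_toC]; norm_num) (by decide),
    show ((2 : ℤ), (0 : ℤ)) - ((1 : ℤ), (1 : ℤ)) = ((1 : ℤ), (-1 : ℤ)) from by decide, show ((2 : ℤ), (-1 : ℤ)) - ((1 : ℤ), (1 : ℤ)) = ((1 : ℤ), (-2 : ℤ)) from by decide]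
  have ha0 : Complex.arg ((-1 : ℂ) * toC ((1 : ℤ), (-1 : ℤ))) = 3 * π / 4 := by
    rw [show (-1 : ℂ) * toC ((1 : ℤ), (-1 : ℤ)) = (-1 + I) by apply Complex.ext <;> simp [toC]]; exact arg_neg_one_add_I
  have ha1 : Complex.arg ((-1 : ℂ) * toC ((1 : ℤ), (0 : ℤ))) = π := by
    rw [show (-1 : ℂ) * toC ((1 : ℤ), (0 : ℤ)) = -1 by apply Complex.ext <;> simp [toC]]; exact Complex.arg_neg_one
  have ha2 : Complex.arg ((1 : ℂ) * toC ((-1 : ℤ), (1 : ℤ))) = 3 * π / 4 := by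
    rw [show (1 : ℂ) * toC ((-1 : ℤ), (1 : ℤ)) = (-1 + I) by apply Complex.ext <;> simp [toC]]; exact arg_neg_one_add_I
  have ha3 : Complex.arg ((1 : ℂ) * toC ((1 : ℤ), (0 : ℤ))) = 0 := by
    rw [show (1 : ℂ) * toC ((1 : ℤ), (0 : ℤ)) = 1 by apply Complex.ext <;> simp [toC]]; exact Complex.arg_one
  have ha4 : Complex.arg (I * toC ((1 : ℤ), (-1 : ℤ))) = π / 4 := by
    rw [show I * toC ((1 : ℤ), (-1 : ℤ)) = (1 + I) by apply Complex.ext <;> simp [toC]]; exact arg_one_add_I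
  have ha5 : Complex.arg (I * toC ((1 : ℤ), (0 : ℤ))) = π / 2 := by
    rw [show I * toC ((1 : ℤ), (0 : ℤ)) = I by apply Complex.ext <;> simp [toC]]; exact Complex.arg_I
  have hb0_1 : Complex.arg (toC ((0 : ℤ), (1 : ℤ))) = π / 2 := by
    rw [show toC ((0 : ℤ), (1 : ℤ)) = I by apply Complex.ext <;> simp [toC]]; exact Complex.arg_I
  have hb0_2 : Complex.arg (toC ((-1 : ℤ), (1 : ℤ))) = 3 * π / 4 := by
    rw [show toC ((-1 : ℤ), (1 : ℤ)) = (-1 + I) by apply Complex.ext <;> simp [toC]]; exact arg_neg_one_add_I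
  have ht0 : ((Complex.arg (toC ((-1 : ℤ), (1 : ℤ))) : Real.Angle) - (Complex.arg (toC ((0 : ℤ), (1 : ℤ))) : Real.Angle)).toReal = (3 * π / 4) - (π / 2) := by
    rw [hb0_2, hb0_1, ← Real.Angle.coe_sub]; exact toReal_coe_of_mem (by constructor <;> linarith)
  linarith [ha0, ha1, ha2, ha3, ha4, ha5, ht0]

/-- Case `(E, S, W)`. [folklore] -/
theorem Loc_E_S_W : Loc .E .S .W = excursionWinding (π / 2) .E .S .W := by
  rw [Loc, L₁off, L₂off, tailExtOff]
  simp only [tailOffs, wOff, Xo, tailPts, Side.offset, Side.inOff, Side.nIn, List.length_cons, List.length_nil,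
    List.getD_cons_zero, List.getD_cons_succ, Finset.sum_range_succ, Finset.sum_range_zero, zero_add, Nat.reduceAdd,
    if_true, if_false, Nat.succ_ne_zero, Prod.mk_sub_mk, Prod.mk_add_mk, arcTurn, excursionWinding]
  norm_num
  have hpi := Real.pi_pos
  rw [angAt_vec (c := -I) (b := ((4 : ℤ), (2 : ℤ))) (P₀ := ((3 : ℤ), (2 : ℤ))) (P₁ := ((2 : ℤ), (1 : ℤ))) (by norm_num)
    (by rw [show ((3 : ℤ), (2 : ℤ)) - ((4 : ℤ), (2 : ℤ)) = ((-1 : ℤ), (0 : ℤ)) from by decide, im_negI_mul_toC]; norm_num)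
    (by rw [show ((2 : ℤ), (1 : ℤ)) - ((4 : ℤ), (2 : ℤ)) = ((-2 : ℤ), (-1 : ℤ)) from by decide, im_negI_mul_toC]; norm_num) (by decide),
    show ((2 : ℤ), (1 : ℤ)) - ((4 : ℤ), (2 : ℤ)) = ((-2 : ℤ), (-1 : ℤ)) from by decide, show ((3 : ℤ), (2 : ℤ)) - ((4 : ℤ), (2 : ℤ)) = ((-1 : ℤ), (0 : ℤ)) from by decide]
  rw [angAt_vec (c := -I) (b := ((4 : ℤ), (2 : ℤ))) (P₀ := ((-1 : ℤ), (2 : ℤ))) (P₁ := ((1 : ℤ), (2 : ℤ))) (by norm_num)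
    (by rw [show ((-1 : ℤ), (2 : ℤ)) - ((4 : ℤ), (2 : ℤ)) = ((-5 : ℤ), (0 : ℤ)) from by decide, im_negI_mul_toC]; norm_num)
    (by rw [show ((1 : ℤ), (2 : ℤ)) - ((4 : ℤ), (2 : ℤ)) = ((-3 : ℤ), (0 : ℤ)) from by decide, im_negI_mul_toC]; norm_num) (by decide),
    show ((1 : ℤ), (2 : ℤ)) - ((4 : ℤ), (2 : ℤ)) = ((-3 : ℤ), (0 : ℤ)) from by decide, show ((-1 : ℤ), (2 : ℤ)) - ((4 : ℤ), (2 : ℤ)) = ((-5 : ℤ), (0 : ℤ)) from by decide]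
  rw [angAt_vec (c := -I) (b := ((4 : ℤ), (2 : ℤ))) (P₀ := ((1 : ℤ), (2 : ℤ))) (P₁ := ((2 : ℤ), (1 : ℤ))) (by norm_num)
    (by rw [show ((1 : ℤ), (2 : ℤ)) - ((4 : ℤ), (2 : ℤ)) = ((-3 : ℤ), (0 : ℤ)) from by decide, im_negI_mul_toC]; norm_num)
    (by rw [show ((2 : ℤ), (1 : ℤ)) - ((4 : ℤ), (2 : ℤ)) = ((-2 : ℤ), (-1 : ℤ)) from by decide, im_negI_mul_toC]; norm_num) (by decide),
    show ((2 : ℤ), (1 : ℤ)) - ((4 : ℤ), (2 : ℤ)) = ((-2 : ℤ), (-1 : ℤ)) from by decide, show ((1 : ℤ), (2 : ℤ)) - ((4 : ℤ), (2 : ℤ)) = ((-3 : ℤ), (0 : ℤ)) from by decide]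
  rw [angAt_vec (c := -I) (b := ((4 : ℤ), (2 : ℤ))) (P₀ := ((-1 : ℤ), (2 : ℤ))) (P₁ := ((0 : ℤ), (2 : ℤ))) (by norm_num)
    (by rw [show ((-1 : ℤ), (2 : ℤ)) - ((4 : ℤ), (2 : ℤ)) = ((-5 : ℤ), (0 : ℤ)) from by decide, im_negI_mul_toC]; norm_num)
    (by rw [show ((0 : ℤ), (2 : ℤ)) - ((4 : ℤ), (2 : ℤ)) = ((-4 : ℤ), (0 : ℤ)) from by decide, im_negI_mul_toC]; norm_num) (by decide),
    show ((0 : ℤ), (2 : ℤ)) - ((4 : ℤ), (2 : ℤ)) = ((-4 : ℤ), (0 : ℤ)) from by decide, show ((-1 : ℤ), (2 : ℤ)) - ((4 : ℤ), (2 : ℤ)) = ((-5 : ℤ), (0 : ℤ)) from by decide]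
  rw [angAt_vec (c := -I) (b := ((4 : ℤ), (2 : ℤ))) (P₀ := ((0 : ℤ), (2 : ℤ))) (P₁ := ((1 : ℤ), (3 : ℤ))) (by norm_num)
    (by rw [show ((0 : ℤ), (2 : ℤ)) - ((4 : ℤ), (2 : ℤ)) = ((-4 : ℤ), (0 : ℤ)) from by decide, im_negI_mul_toC]; norm_num)
    (by rw [show ((1 : ℤ), (3 : ℤ)) - ((4 : ℤ), (2 : ℤ)) = ((-3 : ℤ), (1 : ℤ)) from by decide, im_negI_mul_toC]; norm_num) (by decide),
    show ((1 : ℤ), (3 : ℤ)) - ((4 : ℤ), (2 : ℤ)) = ((-3 : ℤ), (1 : ℤ)) from by decide, show ((0 : ℤ), (2 : ℤ)) - ((4 : ℤ), (2 : ℤ)) = ((-4 : ℤ), (0 : ℤ)) from by decide]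
  rw [angAt_vec (c := -I) (b := ((4 : ℤ), (2 : ℤ))) (P₀ := ((1 : ℤ), (3 : ℤ))) (P₁ := ((3 : ℤ), (3 : ℤ))) (by norm_num)
    (by rw [show ((1 : ℤ), (3 : ℤ)) - ((4 : ℤ), (2 : ℤ)) = ((-3 : ℤ), (1 : ℤ)) from by decide, im_negI_mul_toC]; norm_num)
    (by rw [show ((3 : ℤ), (3 : ℤ)) - ((4 : ℤ), (2 : ℤ)) = ((-1 : ℤ), (1 : ℤ)) from by decide, im_negI_mul_toC]; norm_num) (by decide),
    show ((3 : ℤ), (3 : ℤ)) - ((4 : ℤ), (2 : ℤ)) = ((-1 : ℤ), (1 : ℤ)) from by decide, show ((1 : ℤ), (3 : ℤ)) - ((4 : ℤ), (2 : ℤ)) = ((-3 : ℤ), (1 : ℤ)) from by decide]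
  rw [angAt_vec (c := (-1 : ℂ)) (b := ((3 : ℤ), (3 : ℤ))) (P₀ := ((4 : ℤ), (2 : ℤ))) (P₁ := ((3 : ℤ), (2 : ℤ))) (by norm_num)
    (by rw [show ((4 : ℤ), (2 : ℤ)) - ((3 : ℤ), (3 : ℤ)) = ((1 : ℤ), (-1 : ℤ)) from by decide, im_neg_one_mul_toC]; norm_num)
    (by rw [show ((3 : ℤ), (2 : ℤ)) - ((3 : ℤ), (3 : ℤ)) = ((0 : ℤ), (-1 : ℤ)) from by decide, im_neg_one_mul_toC]; norm_num) (by decide),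
    show ((3 : ℤ), (2 : ℤ)) - ((3 : ℤ), (3 : ℤ)) = ((0 : ℤ), (-1 : ℤ)) from by decide, show ((4 : ℤ), (2 : ℤ)) - ((3 : ℤ), (3 : ℤ)) = ((1 : ℤ), (-1 : ℤ)) from by decide]
  rw [angAt_vec (c := (-1 : ℂ)) (b := ((3 : ℤ), (3 : ℤ))) (P₀ := ((3 : ℤ), (2 : ℤ))) (P₁ := ((2 : ℤ), (1 : ℤ))) (by norm_num)
    (by rw [show ((3 : ℤ), (2 : ℤ)) - ((3 : ℤ), (3 : ℤ)) = ((0 : ℤ), (-1 : ℤ)) from by decide, im_neg_one_mul_toC]; norm_num)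
    (by rw [show ((2 : ℤ), (1 : ℤ)) - ((3 : ℤ), (3 : ℤ)) = ((-1 : ℤ), (-2 : ℤ)) from by decide, im_neg_one_mul_toC]; norm_num) (by decide),
    show ((2 : ℤ), (1 : ℤ)) - ((3 : ℤ), (3 : ℤ)) = ((-1 : ℤ), (-2 : ℤ)) from by decide, show ((3 : ℤ), (2 : ℤ)) - ((3 : ℤ), (3 : ℤ)) = ((0 : ℤ), (-1 : ℤ)) from by decide]
  rw [angAt_vec (c := (-1 : ℂ)) (b := ((3 : ℤ), (3 : ℤ))) (P₀ := ((-1 : ℤ), (2 : ℤ))) (P₁ := ((1 : ℤ), (2 : ℤ))) (by norm_num)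
    (by rw [show ((-1 : ℤ), (2 : ℤ)) - ((3 : ℤ), (3 : ℤ)) = ((-4 : ℤ), (-1 : ℤ)) from by decide, im_neg_one_mul_toC]; norm_num)
    (by rw [show ((1 : ℤ), (2 : ℤ)) - ((3 : ℤ), (3 : ℤ)) = ((-2 : ℤ), (-1 : ℤ)) from by decide, im_neg_one_mul_toC]; norm_num) (by decide),
    show ((1 : ℤ), (2 : ℤ)) - ((3 : ℤ), (3 : ℤ)) = ((-2 : ℤ), (-1 : ℤ)) from by decide, show ((-1 : ℤ), (2 : ℤ)) - ((3 : ℤ), (3 : ℤ)) = ((-4 : ℤ), (-1 : ℤ)) from by decide]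
  rw [angAt_vec (c := (-1 : ℂ)) (b := ((3 : ℤ), (3 : ℤ))) (P₀ := ((1 : ℤ), (2 : ℤ))) (P₁ := ((2 : ℤ), (1 : ℤ))) (by norm_num)
    (by rw [show ((1 : ℤ), (2 : ℤ)) - ((3 : ℤ), (3 : ℤ)) = ((-2 : ℤ), (-1 : ℤ)) from by decide, im_neg_one_mul_toC]; norm_num)
    (by rw [show ((2 : ℤ), (1 : ℤ)) - ((3 : ℤ), (3 : ℤ)) = ((-1 : ℤ), (-2 : ℤ)) from by decide, im_neg_one_mul_toC]; norm_num) (by decide),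
    show ((2 : ℤ), (1 : ℤ)) - ((3 : ℤ), (3 : ℤ)) = ((-1 : ℤ), (-2 : ℤ)) from by decide, show ((1 : ℤ), (2 : ℤ)) - ((3 : ℤ), (3 : ℤ)) = ((-2 : ℤ), (-1 : ℤ)) from by decide]
  rw [angAt_vec (c := (-1 : ℂ)) (b := ((3 : ℤ), (3 : ℤ))) (P₀ := ((-1 : ℤ), (2 : ℤ))) (P₁ := ((0 : ℤ), (2 : ℤ))) (by norm_num)
    (by rw [show ((-1 : ℤ), (2 : ℤ)) - ((3 : ℤ), (3 : ℤ)) = ((-4 : ℤ), (-1 : ℤ)) from by decide, im_neg_one_mul_toC]; norm_num)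
    (by rw [show ((0 : ℤ), (2 : ℤ)) - ((3 : ℤ), (3 : ℤ)) = ((-3 : ℤ), (-1 : ℤ)) from by decide, im_neg_one_mul_toC]; norm_num) (by decide),
    show ((0 : ℤ), (2 : ℤ)) - ((3 : ℤ), (3 : ℤ)) = ((-3 : ℤ), (-1 : ℤ)) from by decide, show ((-1 : ℤ), (2 : ℤ)) - ((3 : ℤ), (3 : ℤ)) = ((-4 : ℤ), (-1 : ℤ)) from by decide]
  rw [angAt_vec (c := (-1 : ℂ)) (b := ((3 : ℤ), (3 : ℤ))) (P₀ := ((0 : ℤ), (2 : ℤ))) (P₁ := ((1 : ℤ), (3 : ℤ))) (by norm_num)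
    (by rw [show ((0 : ℤ), (2 : ℤ)) - ((3 : ℤ), (3 : ℤ)) = ((-3 : ℤ), (-1 : ℤ)) from by decide, im_neg_one_mul_toC]; norm_num)
    (by rw [show ((1 : ℤ), (3 : ℤ)) - ((3 : ℤ), (3 : ℤ)) = ((-2 : ℤ), (0 : ℤ)) from by decide, im_neg_one_mul_toC]; norm_num) (by decide),
    show ((1 : ℤ), (3 : ℤ)) - ((3 : ℤ), (3 : ℤ)) = ((-2 : ℤ), (0 : ℤ)) from by decide, show ((0 : ℤ), (2 : ℤ)) - ((3 : ℤ), (3 : ℤ)) = ((-3 : ℤ), (-1 : ℤ)) from by decide]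
  have ha0 : Complex.arg ((-1 : ℂ) * toC ((-2 : ℤ), (0 : ℤ))) = 0 := by
    rw [show (-1 : ℂ) * toC ((-2 : ℤ), (0 : ℤ)) = ((2 : ℝ) : ℂ) * 1 by apply Complex.ext <;> simp [toC], Complex.arg_real_mul _ (by norm_num)]
    exact Complex.arg_one
  have ha1 : Complex.arg ((-1 : ℂ) * toC ((1 : ℤ), (-1 : ℤ))) = 3 * π / 4 := by
    rw [show (-1 : ℂ) * toC ((1 : ℤ), (-1 : ℤ)) = (-1 + I) by apply Complex.ext <;> simp [toC]]; exact arg_neg_one_add_I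
  have ha2 : Complex.arg (-I * toC ((-1 : ℤ), (0 : ℤ))) = π / 2 := by
    rw [show -I * toC ((-1 : ℤ), (0 : ℤ)) = I by apply Complex.ext <;> simp [toC]]; exact Complex.arg_I
  have ha3 : Complex.arg (-I * toC ((-1 : ℤ), (1 : ℤ))) = π / 4 := by
    rw [show -I * toC ((-1 : ℤ), (1 : ℤ)) = (1 + I) by apply Complex.ext <;> simp [toC]]; exact arg_one_add_I
  have hb0_1 : Complex.arg (toC ((1 : ℤ), (0 : ℤ))) = 0 := by
    rw [show toC ((1 : ℤ), (0 : ℤ)) = 1 by apply Complex.ext <;> simp [toC]]; exact Complex.arg_one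
  have hb0_2 : Complex.arg (toC ((1 : ℤ), (1 : ℤ))) = π / 4 := by
    rw [show toC ((1 : ℤ), (1 : ℤ)) = (1 + I) by apply Complex.ext <;> simp [toC]]; exact arg_one_add_I
  have ht0 : ((Complex.arg (toC ((1 : ℤ), (1 : ℤ))) : Real.Angle) - (Complex.arg (toC ((1 : ℤ), (0 : ℤ))) : Real.Angle)).toReal = (π / 4) - (0) := by
    rw [hb0_2, hb0_1, ← Real.Angle.coe_sub]; exact toReal_coe_of_mem (by constructor <;> linarith)
  have hb1_1 : Complex.arg (toC ((1 : ℤ), (1 : ℤ))) = π / 4 := by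
    rw [show toC ((1 : ℤ), (1 : ℤ)) = (1 + I) by apply Complex.ext <;> simp [toC]]; exact arg_one_add_I
  have hb1_2 : Complex.arg (toC ((2 : ℤ), (0 : ℤ))) = 0 := by
    rw [show toC ((2 : ℤ), (0 : ℤ)) = ((2 : ℝ) : ℂ) * 1 by apply Complex.ext <;> simp [toC], Complex.arg_real_mul _ (by norm_num)]
    exact Complex.arg_one
  have ht1 : ((Complex.arg (toC ((2 : ℤ), (0 : ℤ))) : Real.Angle) - (Complex.arg (toC ((1 : ℤ), (1 : ℤ))) : Real.Angle)).toReal = (0) - (π / 4) := by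
    rw [hb1_2, hb1_1, ← Real.Angle.coe_sub]; exact toReal_coe_of_mem (by constructor <;> linarith)
  linarith [ha0, ha1, ha2, ha3, ht0, ht1]

/-- Case `(E, N, W)`. [folklore] -/
theorem Loc_E_N_W : Loc .E .N .W = excursionWinding (π / 2) .E .N .W := by
  rw [Loc, L₁off, L₂off, tailExtOff]
  simp only [tailOffs, wOff, Xo, tailPts, Side.offset, Side.inOff, Side.nIn, List.length_cons, List.length_nil,
    List.getD_cons_zero, List.getD_cons_succ, Finset.sum_range_succ, Finset.sum_range_zero, zero_add, Nat.reduceAdd,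
    if_true, if_false, Nat.succ_ne_zero, Prod.mk_sub_mk, Prod.mk_add_mk, arcTurn, excursionWinding]
  norm_num
  have hpi := Real.pi_pos
  rw [angAt_vec (c := -I) (b := ((4 : ℤ), (2 : ℤ))) (P₀ := ((3 : ℤ), (2 : ℤ))) (P₁ := ((2 : ℤ), (3 : ℤ))) (by norm_num)
    (by rw [show ((3 : ℤ), (2 : ℤ)) - ((4 : ℤ), (2 : ℤ)) = ((-1 : ℤ), (0 : ℤ)) from by decide, im_negI_mul_toC]; norm_num)
    (by rw [show ((2 : ℤ), (3 : ℤ)) - ((4 : ℤ), (2 : ℤ)) = ((-2 : ℤ), (1 : ℤ)) from by decide, im_negI_mul_toC]; norm_num) (by decide),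
    show ((2 : ℤ), (3 : ℤ)) - ((4 : ℤ), (2 : ℤ)) = ((-2 : ℤ), (1 : ℤ)) from by decide, show ((3 : ℤ), (2 : ℤ)) - ((4 : ℤ), (2 : ℤ)) = ((-1 : ℤ), (0 : ℤ)) from by decide]
  rw [angAt_vec (c := -I) (b := ((4 : ℤ), (2 : ℤ))) (P₀ := ((-1 : ℤ), (2 : ℤ))) (P₁ := ((1 : ℤ), (2 : ℤ))) (by norm_num)
    (by rw [show ((-1 : ℤ), (2 : ℤ)) - ((4 : ℤ), (2 : ℤ)) = ((-5 : ℤ), (0 : ℤ)) from by decide, im_negI_mul_toC]; norm_num)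
    (by rw [show ((1 : ℤ), (2 : ℤ)) - ((4 : ℤ), (2 : ℤ)) = ((-3 : ℤ), (0 : ℤ)) from by decide, im_negI_mul_toC]; norm_num) (by decide),
    show ((1 : ℤ), (2 : ℤ)) - ((4 : ℤ), (2 : ℤ)) = ((-3 : ℤ), (0 : ℤ)) from by decide, show ((-1 : ℤ), (2 : ℤ)) - ((4 : ℤ), (2 : ℤ)) = ((-5 : ℤ), (0 : ℤ)) from by decide]
  rw [angAt_vec (c := -I) (b := ((4 : ℤ), (2 : ℤ))) (P₀ := ((1 : ℤ), (2 : ℤ))) (P₁ := ((2 : ℤ), (3 : ℤ))) (by norm_num)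
    (by rw [show ((1 : ℤ), (2 : ℤ)) - ((4 : ℤ), (2 : ℤ)) = ((-3 : ℤ), (0 : ℤ)) from by decide, im_negI_mul_toC]; norm_num)
    (by rw [show ((2 : ℤ), (3 : ℤ)) - ((4 : ℤ), (2 : ℤ)) = ((-2 : ℤ), (1 : ℤ)) from by decide, im_negI_mul_toC]; norm_num) (by decide),
    show ((2 : ℤ), (3 : ℤ)) - ((4 : ℤ), (2 : ℤ)) = ((-2 : ℤ), (1 : ℤ)) from by decide, show ((1 : ℤ), (2 : ℤ)) - ((4 : ℤ), (2 : ℤ)) = ((-3 : ℤ), (0 : ℤ)) from by decide]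
  rw [angAt_vec (c := -I) (b := ((4 : ℤ), (2 : ℤ))) (P₀ := ((-1 : ℤ), (2 : ℤ))) (P₁ := ((0 : ℤ), (2 : ℤ))) (by norm_num)
    (by rw [show ((-1 : ℤ), (2 : ℤ)) - ((4 : ℤ), (2 : ℤ)) = ((-5 : ℤ), (0 : ℤ)) from by decide, im_negI_mul_toC]; norm_num)
    (by rw [show ((0 : ℤ), (2 : ℤ)) - ((4 : ℤ), (2 : ℤ)) = ((-4 : ℤ), (0 : ℤ)) from by decide, im_negI_mul_toC]; norm_num) (by decide),
    show ((0 : ℤ), (2 : ℤ)) - ((4 : ℤ), (2 : ℤ)) = ((-4 : ℤ), (0 : ℤ)) from by decide, show ((-1 : ℤ), (2 : ℤ)) - ((4 : ℤ), (2 : ℤ)) = ((-5 : ℤ), (0 : ℤ)) from by decide]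
  rw [angAt_vec (c := -I) (b := ((4 : ℤ), (2 : ℤ))) (P₀ := ((0 : ℤ), (2 : ℤ))) (P₁ := ((1 : ℤ), (1 : ℤ))) (by norm_num)
    (by rw [show ((0 : ℤ), (2 : ℤ)) - ((4 : ℤ), (2 : ℤ)) = ((-4 : ℤ), (0 : ℤ)) from by decide, im_negI_mul_toC]; norm_num)
    (by rw [show ((1 : ℤ), (1 : ℤ)) - ((4 : ℤ), (2 : ℤ)) = ((-3 : ℤ), (-1 : ℤ)) from by decide, im_negI_mul_toC]; norm_num) (by decide),
    show ((1 : ℤ), (1 : ℤ)) - ((4 : ℤ), (2 : ℤ)) = ((-3 : ℤ), (-1 : ℤ)) from by decide, show ((0 : ℤ), (2 : ℤ)) - ((4 : ℤ), (2 : ℤ)) = ((-4 : ℤ), (0 : ℤ)) from by decide]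
  rw [angAt_vec (c := -I) (b := ((4 : ℤ), (2 : ℤ))) (P₀ := ((1 : ℤ), (1 : ℤ))) (P₁ := ((3 : ℤ), (1 : ℤ))) (by norm_num)
    (by rw [show ((1 : ℤ), (1 : ℤ)) - ((4 : ℤ), (2 : ℤ)) = ((-3 : ℤ), (-1 : ℤ)) from by decide, im_negI_mul_toC]; norm_num)
    (by rw [show ((3 : ℤ), (1 : ℤ)) - ((4 : ℤ), (2 : ℤ)) = ((-1 : ℤ), (-1 : ℤ)) from by decide, im_negI_mul_toC]; norm_num) (by decide),
    show ((3 : ℤ), (1 : ℤ)) - ((4 : ℤ), (2 : ℤ)) = ((-1 : ℤ), (-1 : ℤ)) from by decide, show ((1 : ℤ), (1 : ℤ)) - ((4 : ℤ), (2 : ℤ)) = ((-3 : ℤ), (-1 : ℤ)) from by decide]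
  rw [angAt_vec (c := (1 : ℂ)) (b := ((3 : ℤ), (1 : ℤ))) (P₀ := ((4 : ℤ), (2 : ℤ))) (P₁ := ((3 : ℤ), (2 : ℤ))) (one_ne_zero)
    (by rw [show ((4 : ℤ), (2 : ℤ)) - ((3 : ℤ), (1 : ℤ)) = ((1 : ℤ), (1 : ℤ)) from by decide, im_one_mul_toC]; norm_num)
    (by rw [show ((3 : ℤ), (2 : ℤ)) - ((3 : ℤ), (1 : ℤ)) = ((0 : ℤ), (1 : ℤ)) from by decide, im_one_mul_toC]; norm_num) (by decide),
    show ((3 : ℤ), (2 : ℤ)) - ((3 : ℤ), (1 : ℤ)) = ((0 : ℤ), (1 : ℤ)) from by decide, show ((4 : ℤ), (2 : ℤ)) - ((3 : ℤ), (1 : ℤ)) = ((1 : ℤ), (1 : ℤ)) from by decide]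
  rw [angAt_vec (c := (1 : ℂ)) (b := ((3 : ℤ), (1 : ℤ))) (P₀ := ((3 : ℤ), (2 : ℤ))) (P₁ := ((2 : ℤ), (3 : ℤ))) (one_ne_zero)
    (by rw [show ((3 : ℤ), (2 : ℤ)) - ((3 : ℤ), (1 : ℤ)) = ((0 : ℤ), (1 : ℤ)) from by decide, im_one_mul_toC]; norm_num)
    (by rw [show ((2 : ℤ), (3 : ℤ)) - ((3 : ℤ), (1 : ℤ)) = ((-1 : ℤ), (2 : ℤ)) from by decide, im_one_mul_toC]; norm_num) (by decide),
    show ((2 : ℤ), (3 : ℤ)) - ((3 : ℤ), (1 : ℤ)) = ((-1 : ℤ), (2 : ℤ)) from by decide, show ((3 : ℤ), (2 : ℤ)) - ((3 : ℤ), (1 : ℤ)) = ((0 : ℤ), (1 : ℤ)) from by decide]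
  rw [angAt_vec (c := (1 : ℂ)) (b := ((3 : ℤ), (1 : ℤ))) (P₀ := ((-1 : ℤ), (2 : ℤ))) (P₁ := ((1 : ℤ), (2 : ℤ))) (one_ne_zero)
    (by rw [show ((-1 : ℤ), (2 : ℤ)) - ((3 : ℤ), (1 : ℤ)) = ((-4 : ℤ), (1 : ℤ)) from by decide, im_one_mul_toC]; norm_num)
    (by rw [show ((1 : ℤ), (2 : ℤ)) - ((3 : ℤ), (1 : ℤ)) = ((-2 : ℤ), (1 : ℤ)) from by decide, im_one_mul_toC]; norm_num) (by decide),
    show ((1 : ℤ), (2 : ℤ)) - ((3 : ℤ), (1 : ℤ)) = ((-2 : ℤ), (1 : ℤ)) from by decide, show ((-1 : ℤ), (2 : ℤ)) - ((3 : ℤ), (1 : ℤ)) = ((-4 : ℤ), (1 : ℤ)) from by decide]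
  rw [angAt_vec (c := (1 : ℂ)) (b := ((3 : ℤ), (1 : ℤ))) (P₀ := ((1 : ℤ), (2 : ℤ))) (P₁ := ((2 : ℤ), (3 : ℤ))) (one_ne_zero)
    (by rw [show ((1 : ℤ), (2 : ℤ)) - ((3 : ℤ), (1 : ℤ)) = ((-2 : ℤ), (1 : ℤ)) from by decide, im_one_mul_toC]; norm_num)
    (by rw [show ((2 : ℤ), (3 : ℤ)) - ((3 : ℤ), (1 : ℤ)) = ((-1 : ℤ), (2 : ℤ)) from by decide, im_one_mul_toC]; norm_num) (by decide),
    show ((2 : ℤ), (3 : ℤ)) - ((3 : ℤ), (1 : ℤ)) = ((-1 : ℤ), (2 : ℤ)) from by decide, show ((1 : ℤ), (2 : ℤ)) - ((3 : ℤ), (1 : ℤ)) = ((-2 : ℤ), (1 : ℤ)) from by decide]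
  rw [angAt_vec (c := (1 : ℂ)) (b := ((3 : ℤ), (1 : ℤ))) (P₀ := ((-1 : ℤ), (2 : ℤ))) (P₁ := ((0 : ℤ), (2 : ℤ))) (one_ne_zero)
    (by rw [show ((-1 : ℤ), (2 : ℤ)) - ((3 : ℤ), (1 : ℤ)) = ((-4 : ℤ), (1 : ℤ)) from by decide, im_one_mul_toC]; norm_num)
    (by rw [show ((0 : ℤ), (2 : ℤ)) - ((3 : ℤ), (1 : ℤ)) = ((-3 : ℤ), (1 : ℤ)) from by decide, im_one_mul_toC]; norm_num) (by decide),
    show ((0 : ℤ), (2 : ℤ)) - ((3 : ℤ), (1 : ℤ)) = ((-3 : ℤ), (1 : ℤ)) from by decide, show ((-1 : ℤ), (2 : ℤ)) - ((3 : ℤ), (1 : ℤ)) = ((-4 : ℤ), (1 : ℤ)) from by decide]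
  rw [angAt_vec (c := (1 : ℂ)) (b := ((3 : ℤ), (1 : ℤ))) (P₀ := ((0 : ℤ), (2 : ℤ))) (P₁ := ((1 : ℤ), (1 : ℤ))) (one_ne_zero)
    (by rw [show ((0 : ℤ), (2 : ℤ)) - ((3 : ℤ), (1 : ℤ)) = ((-3 : ℤ), (1 : ℤ)) from by decide, im_one_mul_toC]; norm_num)
    (by rw [show ((1 : ℤ), (1 : ℤ)) - ((3 : ℤ), (1 : ℤ)) = ((-2 : ℤ), (0 : ℤ)) from by decide, im_one_mul_toC]; norm_num) (by decide),
    show ((1 : ℤ), (1 : ℤ)) - ((3 : ℤ), (1 : ℤ)) = ((-2 : ℤ), (0 : ℤ)) from by decide, show ((0 : ℤ), (2 : ℤ)) - ((3 : ℤ), (1 : ℤ)) = ((-3 : ℤ), (1 : ℤ)) from by decide]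
  have ha0 : Complex.arg (-I * toC ((-1 : ℤ), (-1 : ℤ))) = 3 * π / 4 := by
    rw [show -I * toC ((-1 : ℤ), (-1 : ℤ)) = (-1 + I) by apply Complex.ext <;> simp [toC]]; exact arg_neg_one_add_I
  have ha1 : Complex.arg (-I * toC ((-1 : ℤ), (0 : ℤ))) = π / 2 := by
    rw [show -I * toC ((-1 : ℤ), (0 : ℤ)) = I by apply Complex.ext <;> simp [toC]]; exact Complex.arg_I
  have ha2 : Complex.arg ((1 : ℂ) * toC ((-2 : ℤ), (0 : ℤ))) = π := by
    rw [show (1 : ℂ) * toC ((-2 : ℤ), (0 : ℤ)) = ((2 : ℝ) : ℂ) * -1 by apply Complex.ext <;> simp [toC], Complex.arg_real_mul _ (by norm_num)]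
    exact Complex.arg_neg_one
  have ha3 : Complex.arg ((1 : ℂ) * toC ((1 : ℤ), (1 : ℤ))) = π / 4 := by
    rw [show (1 : ℂ) * toC ((1 : ℤ), (1 : ℤ)) = (1 + I) by apply Complex.ext <;> simp [toC]]; exact arg_one_add_I
  have hb0_1 : Complex.arg (toC ((1 : ℤ), (0 : ℤ))) = 0 := by
    rw [show toC ((1 : ℤ), (0 : ℤ)) = 1 by apply Complex.ext <;> simp [toC]]; exact Complex.arg_one
  have hb0_2 : Complex.arg (toC ((1 : ℤ), (-1 : ℤ))) = -(π / 4) := by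
    rw [show toC ((1 : ℤ), (-1 : ℤ)) = (1 - I) by apply Complex.ext <;> simp [toC]]; exact arg_one_sub_I
  have ht0 : ((Complex.arg (toC ((1 : ℤ), (-1 : ℤ))) : Real.Angle) - (Complex.arg (toC ((1 : ℤ), (0 : ℤ))) : Real.Angle)).toReal = (-(π / 4)) - (0) := by
    rw [hb0_2, hb0_1, ← Real.Angle.coe_sub]; exact toReal_coe_of_mem (by constructor <;> linarith)
  have hb1_1 : Complex.arg (toC ((1 : ℤ), (-1 : ℤ))) = -(π / 4) := by
    rw [show toC ((1 : ℤ), (-1 : ℤ)) = (1 - I) by apply Complex.ext <;> simp [toC]]; exact arg_one_sub_I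
  have hb1_2 : Complex.arg (toC ((2 : ℤ), (0 : ℤ))) = 0 := by
    rw [show toC ((2 : ℤ), (0 : ℤ)) = ((2 : ℝ) : ℂ) * 1 by apply Complex.ext <;> simp [toC], Complex.arg_real_mul _ (by norm_num)]
    exact Complex.arg_one
  have ht1 : ((Complex.arg (toC ((2 : ℤ), (0 : ℤ))) : Real.Angle) - (Complex.arg (toC ((1 : ℤ), (-1 : ℤ))) : Real.Angle)).toReal = (0) - (-(π / 4)) := by
    rw [hb1_2, hb1_1, ← Real.Angle.coe_sub]; exact toReal_coe_of_mem (by constructor <;> linarith)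
  linarith [ha0, ha1, ha2, ha3, ht0, ht1]

/-- Case `(E, S, N)`. [folklore] -/
theorem Loc_E_S_N : Loc .E .S .N = excursionWinding (π / 2) .E .S .N := by
  rw [Loc, L₁off, L₂off, tailExtOff]
  simp only [tailOffs, wOff, Xo, tailPts, Side.offset, Side.inOff, Side.nIn, List.length_cons, List.length_nil,
    List.getD_cons_zero, List.getD_cons_succ, Finset.sum_range_succ, Finset.sum_range_zero, zero_add, Nat.reduceAdd,
    if_true, if_false, Nat.succ_ne_zero, Prod.mk_sub_mk, Prod.mk_add_mk, arcTurn, excursionWinding]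
  norm_num
  have hpi := Real.pi_pos
  rw [angAt_vec (c := -I) (b := ((4 : ℤ), (2 : ℤ))) (P₀ := ((3 : ℤ), (2 : ℤ))) (P₁ := ((2 : ℤ), (1 : ℤ))) (by norm_num)
    (by rw [show ((3 : ℤ), (2 : ℤ)) - ((4 : ℤ), (2 : ℤ)) = ((-1 : ℤ), (0 : ℤ)) from by decide, im_negI_mul_toC]; norm_num)
    (by rw [show ((2 : ℤ), (1 : ℤ)) - ((4 : ℤ), (2 : ℤ)) = ((-2 : ℤ), (-1 : ℤ)) from by decide, im_negI_mul_toC]; norm_num) (by decide),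
    show ((2 : ℤ), (1 : ℤ)) - ((4 : ℤ), (2 : ℤ)) = ((-2 : ℤ), (-1 : ℤ)) from by decide, show ((3 : ℤ), (2 : ℤ)) - ((4 : ℤ), (2 : ℤ)) = ((-1 : ℤ), (0 : ℤ)) from by decide]
  rw [angAt_vec (c := -I) (b := ((4 : ℤ), (2 : ℤ))) (P₀ := ((2 : ℤ), (5 : ℤ))) (P₁ := ((2 : ℤ), (3 : ℤ))) (by norm_num)
    (by rw [show ((2 : ℤ), (5 : ℤ)) - ((4 : ℤ), (2 : ℤ)) = ((-2 : ℤ), (3 : ℤ)) from by decide, im_negI_mul_toC]; norm_num)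
    (by rw [show ((2 : ℤ), (3 : ℤ)) - ((4 : ℤ), (2 : ℤ)) = ((-2 : ℤ), (1 : ℤ)) from by decide, im_negI_mul_toC]; norm_num) (by decide),
    show ((2 : ℤ), (3 : ℤ)) - ((4 : ℤ), (2 : ℤ)) = ((-2 : ℤ), (1 : ℤ)) from by decide, show ((2 : ℤ), (5 : ℤ)) - ((4 : ℤ), (2 : ℤ)) = ((-2 : ℤ), (3 : ℤ)) from by decide]
  rw [angAt_vec (c := -I) (b := ((4 : ℤ), (2 : ℤ))) (P₀ := ((2 : ℤ), (3 : ℤ))) (P₁ := ((2 : ℤ), (1 : ℤ))) (by norm_num)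
    (by rw [show ((2 : ℤ), (3 : ℤ)) - ((4 : ℤ), (2 : ℤ)) = ((-2 : ℤ), (1 : ℤ)) from by decide, im_negI_mul_toC]; norm_num)
    (by rw [show ((2 : ℤ), (1 : ℤ)) - ((4 : ℤ), (2 : ℤ)) = ((-2 : ℤ), (-1 : ℤ)) from by decide, im_negI_mul_toC]; norm_num) (by decide),
    show ((2 : ℤ), (1 : ℤ)) - ((4 : ℤ), (2 : ℤ)) = ((-2 : ℤ), (-1 : ℤ)) from by decide, show ((2 : ℤ), (3 : ℤ)) - ((4 : ℤ), (2 : ℤ)) = ((-2 : ℤ), (1 : ℤ)) from by decide]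
  rw [angAt_vec (c := -I) (b := ((4 : ℤ), (2 : ℤ))) (P₀ := ((2 : ℤ), (5 : ℤ))) (P₁ := ((2 : ℤ), (4 : ℤ))) (by norm_num)
    (by rw [show ((2 : ℤ), (5 : ℤ)) - ((4 : ℤ), (2 : ℤ)) = ((-2 : ℤ), (3 : ℤ)) from by decide, im_negI_mul_toC]; norm_num)
    (by rw [show ((2 : ℤ), (4 : ℤ)) - ((4 : ℤ), (2 : ℤ)) = ((-2 : ℤ), (2 : ℤ)) from by decide, im_negI_mul_toC]; norm_num) (by decide),
    show ((2 : ℤ), (4 : ℤ)) - ((4 : ℤ), (2 : ℤ)) = ((-2 : ℤ), (2 : ℤ)) from by decide, show ((2 : ℤ), (5 : ℤ)) - ((4 : ℤ), (2 : ℤ)) = ((-2 : ℤ), (3 : ℤ)) from by decide]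
  rw [angAt_vec (c := -I) (b := ((4 : ℤ), (2 : ℤ))) (P₀ := ((2 : ℤ), (4 : ℤ))) (P₁ := ((3 : ℤ), (3 : ℤ))) (by norm_num)
    (by rw [show ((2 : ℤ), (4 : ℤ)) - ((4 : ℤ), (2 : ℤ)) = ((-2 : ℤ), (2 : ℤ)) from by decide, im_negI_mul_toC]; norm_num)
    (by rw [show ((3 : ℤ), (3 : ℤ)) - ((4 : ℤ), (2 : ℤ)) = ((-1 : ℤ), (1 : ℤ)) from by decide, im_negI_mul_toC]; norm_num) (by decide),
    show ((3 : ℤ), (3 : ℤ)) - ((4 : ℤ), (2 : ℤ)) = ((-1 : ℤ), (1 : ℤ)) from by decide, show ((2 : ℤ), (4 : ℤ)) - ((4 : ℤ), (2 : ℤ)) = ((-2 : ℤ), (2 : ℤ)) from by decide]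
  rw [angAt_vec (c := (-1 : ℂ)) (b := ((3 : ℤ), (3 : ℤ))) (P₀ := ((4 : ℤ), (2 : ℤ))) (P₁ := ((3 : ℤ), (2 : ℤ))) (by norm_num)
    (by rw [show ((4 : ℤ), (2 : ℤ)) - ((3 : ℤ), (3 : ℤ)) = ((1 : ℤ), (-1 : ℤ)) from by decide, im_neg_one_mul_toC]; norm_num)
    (by rw [show ((3 : ℤ), (2 : ℤ)) - ((3 : ℤ), (3 : ℤ)) = ((0 : ℤ), (-1 : ℤ)) from by decide, im_neg_one_mul_toC]; norm_num) (by decide),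
    show ((3 : ℤ), (2 : ℤ)) - ((3 : ℤ), (3 : ℤ)) = ((0 : ℤ), (-1 : ℤ)) from by decide, show ((4 : ℤ), (2 : ℤ)) - ((3 : ℤ), (3 : ℤ)) = ((1 : ℤ), (-1 : ℤ)) from by decide]
  rw [angAt_vec (c := (-1 : ℂ)) (b := ((3 : ℤ), (3 : ℤ))) (P₀ := ((3 : ℤ), (2 : ℤ))) (P₁ := ((2 : ℤ), (1 : ℤ))) (by norm_num)
    (by rw [show ((3 : ℤ), (2 : ℤ)) - ((3 : ℤ), (3 : ℤ)) = ((0 : ℤ), (-1 : ℤ)) from by decide, im_neg_one_mul_toC]; norm_num)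
    (by rw [show ((2 : ℤ), (1 : ℤ)) - ((3 : ℤ), (3 : ℤ)) = ((-1 : ℤ), (-2 : ℤ)) from by decide, im_neg_one_mul_toC]; norm_num) (by decide),
    show ((2 : ℤ), (1 : ℤ)) - ((3 : ℤ), (3 : ℤ)) = ((-1 : ℤ), (-2 : ℤ)) from by decide, show ((3 : ℤ), (2 : ℤ)) - ((3 : ℤ), (3 : ℤ)) = ((0 : ℤ), (-1 : ℤ)) from by decide]
  rw [angAt_vec (c := (1 : ℂ)) (b := ((3 : ℤ), (3 : ℤ))) (P₀ := ((2 : ℤ), (5 : ℤ))) (P₁ := ((2 : ℤ), (3 : ℤ))) (one_ne_zero)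
    (by rw [show ((2 : ℤ), (5 : ℤ)) - ((3 : ℤ), (3 : ℤ)) = ((-1 : ℤ), (2 : ℤ)) from by decide, im_one_mul_toC]; norm_num)
    (by rw [show ((2 : ℤ), (3 : ℤ)) - ((3 : ℤ), (3 : ℤ)) = ((-1 : ℤ), (0 : ℤ)) from by decide, im_one_mul_toC]; norm_num) (by decide),
    show ((2 : ℤ), (3 : ℤ)) - ((3 : ℤ), (3 : ℤ)) = ((-1 : ℤ), (0 : ℤ)) from by decide, show ((2 : ℤ), (5 : ℤ)) - ((3 : ℤ), (3 : ℤ)) = ((-1 : ℤ), (2 : ℤ)) from by decide]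
  rw [angAt_vec (c := (-1 : ℂ)) (b := ((3 : ℤ), (3 : ℤ))) (P₀ := ((2 : ℤ), (3 : ℤ))) (P₁ := ((2 : ℤ), (1 : ℤ))) (by norm_num)
    (by rw [show ((2 : ℤ), (3 : ℤ)) - ((3 : ℤ), (3 : ℤ)) = ((-1 : ℤ), (0 : ℤ)) from by decide, im_neg_one_mul_toC]; norm_num)
    (by rw [show ((2 : ℤ), (1 : ℤ)) - ((3 : ℤ), (3 : ℤ)) = ((-1 : ℤ), (-2 : ℤ)) from by decide, im_neg_one_mul_toC]; norm_num) (by decide),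
    show ((2 : ℤ), (1 : ℤ)) - ((3 : ℤ), (3 : ℤ)) = ((-1 : ℤ), (-2 : ℤ)) from by decide, show ((2 : ℤ), (3 : ℤ)) - ((3 : ℤ), (3 : ℤ)) = ((-1 : ℤ), (0 : ℤ)) from by decide]
  rw [angAt_vec (c := (1 : ℂ)) (b := ((3 : ℤ), (3 : ℤ))) (P₀ := ((2 : ℤ), (5 : ℤ))) (P₁ := ((2 : ℤ), (4 : ℤ))) (one_ne_zero)
    (by rw [show ((2 : ℤ), (5 : ℤ)) - ((3 : ℤ), (3 : ℤ)) = ((-1 : ℤ), (2 : ℤ)) from by decide, im_one_mul_toC]; norm_num)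
    (by rw [show ((2 : ℤ), (4 : ℤ)) - ((3 : ℤ), (3 : ℤ)) = ((-1 : ℤ), (1 : ℤ)) from by decide, im_one_mul_toC]; norm_num) (by decide),
    show ((2 : ℤ), (4 : ℤ)) - ((3 : ℤ), (3 : ℤ)) = ((-1 : ℤ), (1 : ℤ)) from by decide, show ((2 : ℤ), (5 : ℤ)) - ((3 : ℤ), (3 : ℤ)) = ((-1 : ℤ), (2 : ℤ)) from by decide]
  have ha0 : Complex.arg ((-1 : ℂ) * toC ((-1 : ℤ), (0 : ℤ))) = 0 := by
    rw [show (-1 : ℂ) * toC ((-1 : ℤ), (0 : ℤ)) = 1 by apply Complex.ext <;> simp [toC]]; exact Complex.arg_one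
  have ha1 : Complex.arg ((-1 : ℂ) * toC ((1 : ℤ), (-1 : ℤ))) = 3 * π / 4 := by
    rw [show (-1 : ℂ) * toC ((1 : ℤ), (-1 : ℤ)) = (-1 + I) by apply Complex.ext <;> simp [toC]]; exact arg_neg_one_add_I
  have ha2 : Complex.arg (-I * toC ((-1 : ℤ), (0 : ℤ))) = π / 2 := by
    rw [show -I * toC ((-1 : ℤ), (0 : ℤ)) = I by apply Complex.ext <;> simp [toC]]; exact Complex.arg_I
  have ha3 : Complex.arg (-I * toC ((-1 : ℤ), (1 : ℤ))) = π / 4 := by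
    rw [show -I * toC ((-1 : ℤ), (1 : ℤ)) = (1 + I) by apply Complex.ext <;> simp [toC]]; exact arg_one_add_I
  have ha4 : Complex.arg ((1 : ℂ) * toC ((-1 : ℤ), (0 : ℤ))) = π := by
    rw [show (1 : ℂ) * toC ((-1 : ℤ), (0 : ℤ)) = -1 by apply Complex.ext <;> simp [toC]]; exact Complex.arg_neg_one
  have ha5 : Complex.arg ((1 : ℂ) * toC ((-1 : ℤ), (1 : ℤ))) = 3 * π / 4 := by
    rw [show (1 : ℂ) * toC ((-1 : ℤ), (1 : ℤ)) = (-1 + I) by apply Complex.ext <;> simp [toC]]; exact arg_neg_one_add_I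
  have hb0_1 : Complex.arg (toC ((0 : ℤ), (-1 : ℤ))) = -(π / 2) := by
    rw [show toC ((0 : ℤ), (-1 : ℤ)) = -I by apply Complex.ext <;> simp [toC]]; exact Complex.arg_neg_I
  have hb0_2 : Complex.arg (toC ((1 : ℤ), (-1 : ℤ))) = -(π / 4) := by
    rw [show toC ((1 : ℤ), (-1 : ℤ)) = (1 - I) by apply Complex.ext <;> simp [toC]]; exact arg_one_sub_I
  have ht0 : ((Complex.arg (toC ((1 : ℤ), (-1 : ℤ))) : Real.Angle) - (Complex.arg (toC ((0 : ℤ), (-1 : ℤ))) : Real.Angle)).toReal = (-(π / 4)) - (-(π / 2)) := by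
    rw [hb0_2, hb0_1, ← Real.Angle.coe_sub]; exact toReal_coe_of_mem (by constructor <;> linarith)
  linarith [ha0, ha1, ha2, ha3, ha4, ha5, ht0]

/-- Case `(S, W, N)`. [folklore] -/
theorem Loc_S_W_N : Loc .S .W .N = excursionWinding (π / 2) .S .W .N := by
  rw [Loc, L₁off, L₂off, tailExtOff]
  simp only [tailOffs, wOff, Xo, tailPts, Side.offset, Side.inOff, Side.nIn, List.length_cons, List.length_nil,
    List.getD_cons_zero, List.getD_cons_succ, Finset.sum_range_succ, Finset.sum_range_zero, zero_add, Nat.reduceAdd,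
    if_true, if_false, Nat.succ_ne_zero, Prod.mk_sub_mk, Prod.mk_add_mk, arcTurn, excursionWinding]
  norm_num
  have hpi := Real.pi_pos
  rw [angAt_vec (c := (1 : ℂ)) (b := ((2 : ℤ), (0 : ℤ))) (P₀ := ((2 : ℤ), (1 : ℤ))) (P₁ := ((1 : ℤ), (2 : ℤ))) (one_ne_zero)
    (by rw [show ((2 : ℤ), (1 : ℤ)) - ((2 : ℤ), (0 : ℤ)) = ((0 : ℤ), (1 : ℤ)) from by decide, im_one_mul_toC]; norm_num)
    (by rw [show ((1 : ℤ), (2 : ℤ)) - ((2 : ℤ), (0 : ℤ)) = ((-1 : ℤ), (2 : ℤ)) from by decide, im_one_mul_toC]; norm_num) (by decide),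
    show ((1 : ℤ), (2 : ℤ)) - ((2 : ℤ), (0 : ℤ)) = ((-1 : ℤ), (2 : ℤ)) from by decide, show ((2 : ℤ), (1 : ℤ)) - ((2 : ℤ), (0 : ℤ)) = ((0 : ℤ), (1 : ℤ)) from by decide]
  rw [angAt_vec (c := (1 : ℂ)) (b := ((2 : ℤ), (0 : ℤ))) (P₀ := ((2 : ℤ), (5 : ℤ))) (P₁ := ((2 : ℤ), (3 : ℤ))) (one_ne_zero)
    (by rw [show ((2 : ℤ), (5 : ℤ)) - ((2 : ℤ), (0 : ℤ)) = ((0 : ℤ), (5 : ℤ)) from by decide, im_one_mul_toC]; norm_num)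
    (by rw [show ((2 : ℤ), (3 : ℤ)) - ((2 : ℤ), (0 : ℤ)) = ((0 : ℤ), (3 : ℤ)) from by decide, im_one_mul_toC]; norm_num) (by decide),
    show ((2 : ℤ), (3 : ℤ)) - ((2 : ℤ), (0 : ℤ)) = ((0 : ℤ), (3 : ℤ)) from by decide, show ((2 : ℤ), (5 : ℤ)) - ((2 : ℤ), (0 : ℤ)) = ((0 : ℤ), (5 : ℤ)) from by decide]
  rw [angAt_vec (c := (1 : ℂ)) (b := ((2 : ℤ), (0 : ℤ))) (P₀ := ((2 : ℤ), (3 : ℤ))) (P₁ := ((1 : ℤ), (2 : ℤ))) (one_ne_zero)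
    (by rw [show ((2 : ℤ), (3 : ℤ)) - ((2 : ℤ), (0 : ℤ)) = ((0 : ℤ), (3 : ℤ)) from by decide, im_one_mul_toC]; norm_num)
    (by rw [show ((1 : ℤ), (2 : ℤ)) - ((2 : ℤ), (0 : ℤ)) = ((-1 : ℤ), (2 : ℤ)) from by decide, im_one_mul_toC]; norm_num) (by decide),
    show ((1 : ℤ), (2 : ℤ)) - ((2 : ℤ), (0 : ℤ)) = ((-1 : ℤ), (2 : ℤ)) from by decide, show ((2 : ℤ), (3 : ℤ)) - ((2 : ℤ), (0 : ℤ)) = ((0 : ℤ), (3 : ℤ)) from by decide]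
  rw [angAt_vec (c := (1 : ℂ)) (b := ((2 : ℤ), (0 : ℤ))) (P₀ := ((2 : ℤ), (5 : ℤ))) (P₁ := ((2 : ℤ), (4 : ℤ))) (one_ne_zero)
    (by rw [show ((2 : ℤ), (5 : ℤ)) - ((2 : ℤ), (0 : ℤ)) = ((0 : ℤ), (5 : ℤ)) from by decide, im_one_mul_toC]; norm_num)
    (by rw [show ((2 : ℤ), (4 : ℤ)) - ((2 : ℤ), (0 : ℤ)) = ((0 : ℤ), (4 : ℤ)) from by decide, im_one_mul_toC]; norm_num) (by decide),
    show ((2 : ℤ), (4 : ℤ)) - ((2 : ℤ), (0 : ℤ)) = ((0 : ℤ), (4 : ℤ)) from by decide, show ((2 : ℤ), (5 : ℤ)) - ((2 : ℤ), (0 : ℤ)) = ((0 : ℤ), (5 : ℤ)) from by decide]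
  rw [angAt_vec (c := (1 : ℂ)) (b := ((2 : ℤ), (0 : ℤ))) (P₀ := ((2 : ℤ), (4 : ℤ))) (P₁ := ((3 : ℤ), (3 : ℤ))) (one_ne_zero)
    (by rw [show ((2 : ℤ), (4 : ℤ)) - ((2 : ℤ), (0 : ℤ)) = ((0 : ℤ), (4 : ℤ)) from by decide, im_one_mul_toC]; norm_num)
    (by rw [show ((3 : ℤ), (3 : ℤ)) - ((2 : ℤ), (0 : ℤ)) = ((1 : ℤ), (3 : ℤ)) from by decide, im_one_mul_toC]; norm_num) (by decide),
    show ((3 : ℤ), (3 : ℤ)) - ((2 : ℤ), (0 : ℤ)) = ((1 : ℤ), (3 : ℤ)) from by decide, show ((2 : ℤ), (4 : ℤ)) - ((2 : ℤ), (0 : ℤ)) = ((0 : ℤ), (4 : ℤ)) from by decide]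
  rw [angAt_vec (c := (1 : ℂ)) (b := ((2 : ℤ), (0 : ℤ))) (P₀ := ((3 : ℤ), (3 : ℤ))) (P₁ := ((3 : ℤ), (1 : ℤ))) (one_ne_zero)
    (by rw [show ((3 : ℤ), (3 : ℤ)) - ((2 : ℤ), (0 : ℤ)) = ((1 : ℤ), (3 : ℤ)) from by decide, im_one_mul_toC]; norm_num)
    (by rw [show ((3 : ℤ), (1 : ℤ)) - ((2 : ℤ), (0 : ℤ)) = ((1 : ℤ), (1 : ℤ)) from by decide, im_one_mul_toC]; norm_num) (by decide),
    show ((3 : ℤ), (1 : ℤ)) - ((2 : ℤ), (0 : ℤ)) = ((1 : ℤ), (1 : ℤ)) from by decide, show ((3 : ℤ), (3 : ℤ)) - ((2 : ℤ), (0 : ℤ)) = ((1 : ℤ), (3 : ℤ)) from by decide]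
  rw [angAt_vec (c := -I) (b := ((3 : ℤ), (1 : ℤ))) (P₀ := ((2 : ℤ), (0 : ℤ))) (P₁ := ((2 : ℤ), (1 : ℤ))) (by norm_num)
    (by rw [show ((2 : ℤ), (0 : ℤ)) - ((3 : ℤ), (1 : ℤ)) = ((-1 : ℤ), (-1 : ℤ)) from by decide, im_negI_mul_toC]; norm_num)
    (by rw [show ((2 : ℤ), (1 : ℤ)) - ((3 : ℤ), (1 : ℤ)) = ((-1 : ℤ), (0 : ℤ)) from by decide, im_negI_mul_toC]; norm_num) (by decide),
    show ((2 : ℤ), (1 : ℤ)) - ((3 : ℤ), (1 : ℤ)) = ((-1 : ℤ), (0 : ℤ)) from by decide, show ((2 : ℤ), (0 : ℤ)) - ((3 : ℤ), (1 : ℤ)) = ((-1 : ℤ), (-1 : ℤ)) from by decide]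
  rw [angAt_vec (c := -I) (b := ((3 : ℤ), (1 : ℤ))) (P₀ := ((2 : ℤ), (1 : ℤ))) (P₁ := ((1 : ℤ), (2 : ℤ))) (by norm_num)
    (by rw [show ((2 : ℤ), (1 : ℤ)) - ((3 : ℤ), (1 : ℤ)) = ((-1 : ℤ), (0 : ℤ)) from by decide, im_negI_mul_toC]; norm_num)
    (by rw [show ((1 : ℤ), (2 : ℤ)) - ((3 : ℤ), (1 : ℤ)) = ((-2 : ℤ), (1 : ℤ)) from by decide, im_negI_mul_toC]; norm_num) (by decide),
    show ((1 : ℤ), (2 : ℤ)) - ((3 : ℤ), (1 : ℤ)) = ((-2 : ℤ), (1 : ℤ)) from by decide, show ((2 : ℤ), (1 : ℤ)) - ((3 : ℤ), (1 : ℤ)) = ((-1 : ℤ), (0 : ℤ)) from by decide]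
  rw [angAt_vec (c := -I) (b := ((3 : ℤ), (1 : ℤ))) (P₀ := ((2 : ℤ), (5 : ℤ))) (P₁ := ((2 : ℤ), (3 : ℤ))) (by norm_num)
    (by rw [show ((2 : ℤ), (5 : ℤ)) - ((3 : ℤ), (1 : ℤ)) = ((-1 : ℤ), (4 : ℤ)) from by decide, im_negI_mul_toC]; norm_num)
    (by rw [show ((2 : ℤ), (3 : ℤ)) - ((3 : ℤ), (1 : ℤ)) = ((-1 : ℤ), (2 : ℤ)) from by decide, im_negI_mul_toC]; norm_num) (by decide),
    show ((2 : ℤ), (3 : ℤ)) - ((3 : ℤ), (1 : ℤ)) = ((-1 : ℤ), (2 : ℤ)) from by decide, show ((2 : ℤ), (5 : ℤ)) - ((3 : ℤ), (1 : ℤ)) = ((-1 : ℤ), (4 : ℤ)) from by decide]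
  rw [angAt_vec (c := -I) (b := ((3 : ℤ), (1 : ℤ))) (P₀ := ((2 : ℤ), (3 : ℤ))) (P₁ := ((1 : ℤ), (2 : ℤ))) (by norm_num)
    (by rw [show ((2 : ℤ), (3 : ℤ)) - ((3 : ℤ), (1 : ℤ)) = ((-1 : ℤ), (2 : ℤ)) from by decide, im_negI_mul_toC]; norm_num)
    (by rw [show ((1 : ℤ), (2 : ℤ)) - ((3 : ℤ), (1 : ℤ)) = ((-2 : ℤ), (1 : ℤ)) from by decide, im_negI_mul_toC]; norm_num) (by decide),
    show ((1 : ℤ), (2 : ℤ)) - ((3 : ℤ), (1 : ℤ)) = ((-2 : ℤ), (1 : ℤ)) from by decide, show ((2 : ℤ), (3 : ℤ)) - ((3 : ℤ), (1 : ℤ)) = ((-1 : ℤ), (2 : ℤ)) from by decide]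
  rw [angAt_vec (c := -I) (b := ((3 : ℤ), (1 : ℤ))) (P₀ := ((2 : ℤ), (5 : ℤ))) (P₁ := ((2 : ℤ), (4 : ℤ))) (by norm_num)
    (by rw [show ((2 : ℤ), (5 : ℤ)) - ((3 : ℤ), (1 : ℤ)) = ((-1 : ℤ), (4 : ℤ)) from by decide, im_negI_mul_toC]; norm_num)
    (by rw [show ((2 : ℤ), (4 : ℤ)) - ((3 : ℤ), (1 : ℤ)) = ((-1 : ℤ), (3 : ℤ)) from by decide, im_negI_mul_toC]; norm_num) (by decide),
    show ((2 : ℤ), (4 : ℤ)) - ((3 : ℤ), (1 : ℤ)) = ((-1 : ℤ), (3 : ℤ)) from by decide, show ((2 : ℤ), (5 : ℤ)) - ((3 : ℤ), (1 : ℤ)) = ((-1 : ℤ), (4 : ℤ)) from by decide]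
  rw [angAt_vec (c := -I) (b := ((3 : ℤ), (1 : ℤ))) (P₀ := ((2 : ℤ), (4 : ℤ))) (P₁ := ((3 : ℤ), (3 : ℤ))) (by norm_num)
    (by rw [show ((2 : ℤ), (4 : ℤ)) - ((3 : ℤ), (1 : ℤ)) = ((-1 : ℤ), (3 : ℤ)) from by decide, im_negI_mul_toC]; norm_num)
    (by rw [show ((3 : ℤ), (3 : ℤ)) - ((3 : ℤ), (1 : ℤ)) = ((0 : ℤ), (2 : ℤ)) from by decide, im_negI_mul_toC]; norm_num) (by decide),
    show ((3 : ℤ), (3 : ℤ)) - ((3 : ℤ), (1 : ℤ)) = ((0 : ℤ), (2 : ℤ)) from by decide, show ((2 : ℤ), (4 : ℤ)) - ((3 : ℤ), (1 : ℤ)) = ((-1 : ℤ), (3 : ℤ)) from by decide]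
  have ha0 : Complex.arg (-I * toC ((-1 : ℤ), (-1 : ℤ))) = 3 * π / 4 := by
    rw [show -I * toC ((-1 : ℤ), (-1 : ℤ)) = (-1 + I) by apply Complex.ext <;> simp [toC]]; exact arg_neg_one_add_I
  have ha1 : Complex.arg (-I * toC ((0 : ℤ), (2 : ℤ))) = 0 := by
    rw [show -I * toC ((0 : ℤ), (2 : ℤ)) = ((2 : ℝ) : ℂ) * 1 by apply Complex.ext <;> simp [toC], Complex.arg_real_mul _ (by norm_num)]
    exact Complex.arg_one
  have ha2 : Complex.arg ((1 : ℂ) * toC ((0 : ℤ), (1 : ℤ))) = π / 2 := by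
    rw [show (1 : ℂ) * toC ((0 : ℤ), (1 : ℤ)) = I by apply Complex.ext <;> simp [toC]]; exact Complex.arg_I
  have ha3 : Complex.arg ((1 : ℂ) * toC ((1 : ℤ), (1 : ℤ))) = π / 4 := by
    rw [show (1 : ℂ) * toC ((1 : ℤ), (1 : ℤ)) = (1 + I) by apply Complex.ext <;> simp [toC]]; exact arg_one_add_I
  have hb0_1 : Complex.arg (toC ((0 : ℤ), (-1 : ℤ))) = -(π / 2) := by
    rw [show toC ((0 : ℤ), (-1 : ℤ)) = -I by apply Complex.ext <;> simp [toC]]; exact Complex.arg_neg_I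
  have hb0_2 : Complex.arg (toC ((1 : ℤ), (-1 : ℤ))) = -(π / 4) := by
    rw [show toC ((1 : ℤ), (-1 : ℤ)) = (1 - I) by apply Complex.ext <;> simp [toC]]; exact arg_one_sub_I
  have ht0 : ((Complex.arg (toC ((1 : ℤ), (-1 : ℤ))) : Real.Angle) - (Complex.arg (toC ((0 : ℤ), (-1 : ℤ))) : Real.Angle)).toReal = (-(π / 4)) - (-(π / 2)) := by
    rw [hb0_2, hb0_1, ← Real.Angle.coe_sub]; exact toReal_coe_of_mem (by constructor <;> linarith)
  have hb1_1 : Complex.arg (toC ((1 : ℤ), (-1 : ℤ))) = -(π / 4) := by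
    rw [show toC ((1 : ℤ), (-1 : ℤ)) = (1 - I) by apply Complex.ext <;> simp [toC]]; exact arg_one_sub_I
  have hb1_2 : Complex.arg (toC ((0 : ℤ), (-2 : ℤ))) = -(π / 2) := by
    rw [show toC ((0 : ℤ), (-2 : ℤ)) = ((2 : ℝ) : ℂ) * -I by apply Complex.ext <;> simp [toC], Complex.arg_real_mul _ (by norm_num)]
    exact Complex.arg_neg_I
  have ht1 : ((Complex.arg (toC ((0 : ℤ), (-2 : ℤ))) : Real.Angle) - (Complex.arg (toC ((1 : ℤ), (-1 : ℤ))) : Real.Angle)).toReal = (-(π / 2)) - (-(π / 4)) := by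
    rw [hb1_2, hb1_1, ← Real.Angle.coe_sub]; exact toReal_coe_of_mem (by constructor <;> linarith)
  linarith [ha0, ha1, ha2, ha3, ht0, ht1]

/-- Case `(S, E, N)`. [folklore] -/
theorem Loc_S_E_N : Loc .S .E .N = excursionWinding (π / 2) .S .E .N := by
  rw [Loc, L₁off, L₂off, tailExtOff]
  simp only [tailOffs, wOff, Xo, tailPts, Side.offset, Side.inOff, Side.nIn, List.length_cons, List.length_nil,
    List.getD_cons_zero, List.getD_cons_succ, Finset.sum_range_succ, Finset.sum_range_zero, zero_add, Nat.reduceAdd,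
    if_true, if_false, Nat.succ_ne_zero, Prod.mk_sub_mk, Prod.mk_add_mk, arcTurn, excursionWinding]
  norm_num
  have hpi := Real.pi_pos
  rw [angAt_vec (c := (1 : ℂ)) (b := ((2 : ℤ), (0 : ℤ))) (P₀ := ((2 : ℤ), (1 : ℤ))) (P₁ := ((3 : ℤ), (2 : ℤ))) (one_ne_zero)
    (by rw [show ((2 : ℤ), (1 : ℤ)) - ((2 : ℤ), (0 : ℤ)) = ((0 : ℤ), (1 : ℤ)) from by decide, im_one_mul_toC]; norm_num)
    (by rw [show ((3 : ℤ), (2 : ℤ)) - ((2 : ℤ), (0 : ℤ)) = ((1 : ℤ), (2 : ℤ)) from by decide, im_one_mul_toC]; norm_num) (by decide),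
    show ((3 : ℤ), (2 : ℤ)) - ((2 : ℤ), (0 : ℤ)) = ((1 : ℤ), (2 : ℤ)) from by decide, show ((2 : ℤ), (1 : ℤ)) - ((2 : ℤ), (0 : ℤ)) = ((0 : ℤ), (1 : ℤ)) from by decide]
  rw [angAt_vec (c := (1 : ℂ)) (b := ((2 : ℤ), (0 : ℤ))) (P₀ := ((2 : ℤ), (5 : ℤ))) (P₁ := ((2 : ℤ), (3 : ℤ))) (one_ne_zero)
    (by rw [show ((2 : ℤ), (5 : ℤ)) - ((2 : ℤ), (0 : ℤ)) = ((0 : ℤ), (5 : ℤ)) from by decide, im_one_mul_toC]; norm_num)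
    (by rw [show ((2 : ℤ), (3 : ℤ)) - ((2 : ℤ), (0 : ℤ)) = ((0 : ℤ), (3 : ℤ)) from by decide, im_one_mul_toC]; norm_num) (by decide),
    show ((2 : ℤ), (3 : ℤ)) - ((2 : ℤ), (0 : ℤ)) = ((0 : ℤ), (3 : ℤ)) from by decide, show ((2 : ℤ), (5 : ℤ)) - ((2 : ℤ), (0 : ℤ)) = ((0 : ℤ), (5 : ℤ)) from by decide]
  rw [angAt_vec (c := (1 : ℂ)) (b := ((2 : ℤ), (0 : ℤ))) (P₀ := ((2 : ℤ), (3 : ℤ))) (P₁ := ((3 : ℤ), (2 : ℤ))) (one_ne_zero)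
    (by rw [show ((2 : ℤ), (3 : ℤ)) - ((2 : ℤ), (0 : ℤ)) = ((0 : ℤ), (3 : ℤ)) from by decide, im_one_mul_toC]; norm_num)
    (by rw [show ((3 : ℤ), (2 : ℤ)) - ((2 : ℤ), (0 : ℤ)) = ((1 : ℤ), (2 : ℤ)) from by decide, im_one_mul_toC]; norm_num) (by decide),
    show ((3 : ℤ), (2 : ℤ)) - ((2 : ℤ), (0 : ℤ)) = ((1 : ℤ), (2 : ℤ)) from by decide, show ((2 : ℤ), (3 : ℤ)) - ((2 : ℤ), (0 : ℤ)) = ((0 : ℤ), (3 : ℤ)) from by decide]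
  rw [angAt_vec (c := (1 : ℂ)) (b := ((2 : ℤ), (0 : ℤ))) (P₀ := ((2 : ℤ), (5 : ℤ))) (P₁ := ((2 : ℤ), (4 : ℤ))) (one_ne_zero)
    (by rw [show ((2 : ℤ), (5 : ℤ)) - ((2 : ℤ), (0 : ℤ)) = ((0 : ℤ), (5 : ℤ)) from by decide, im_one_mul_toC]; norm_num)
    (by rw [show ((2 : ℤ), (4 : ℤ)) - ((2 : ℤ), (0 : ℤ)) = ((0 : ℤ), (4 : ℤ)) from by decide, im_one_mul_toC]; norm_num) (by decide),
    show ((2 : ℤ), (4 : ℤ)) - ((2 : ℤ), (0 : ℤ)) = ((0 : ℤ), (4 : ℤ)) from by decide, show ((2 : ℤ), (5 : ℤ)) - ((2 : ℤ), (0 : ℤ)) = ((0 : ℤ), (5 : ℤ)) from by decide]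
  rw [angAt_vec (c := (1 : ℂ)) (b := ((2 : ℤ), (0 : ℤ))) (P₀ := ((2 : ℤ), (4 : ℤ))) (P₁ := ((1 : ℤ), (3 : ℤ))) (one_ne_zero)
    (by rw [show ((2 : ℤ), (4 : ℤ)) - ((2 : ℤ), (0 : ℤ)) = ((0 : ℤ), (4 : ℤ)) from by decide, im_one_mul_toC]; norm_num)
    (by rw [show ((1 : ℤ), (3 : ℤ)) - ((2 : ℤ), (0 : ℤ)) = ((-1 : ℤ), (3 : ℤ)) from by decide, im_one_mul_toC]; norm_num) (by decide),
    show ((1 : ℤ), (3 : ℤ)) - ((2 : ℤ), (0 : ℤ)) = ((-1 : ℤ), (3 : ℤ)) from by decide, show ((2 : ℤ), (4 : ℤ)) - ((2 : ℤ), (0 : ℤ)) = ((0 : ℤ), (4 : ℤ)) from by decide]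
  rw [angAt_vec (c := (1 : ℂ)) (b := ((2 : ℤ), (0 : ℤ))) (P₀ := ((1 : ℤ), (3 : ℤ))) (P₁ := ((1 : ℤ), (1 : ℤ))) (one_ne_zero)
    (by rw [show ((1 : ℤ), (3 : ℤ)) - ((2 : ℤ), (0 : ℤ)) = ((-1 : ℤ), (3 : ℤ)) from by decide, im_one_mul_toC]; norm_num)
    (by rw [show ((1 : ℤ), (1 : ℤ)) - ((2 : ℤ), (0 : ℤ)) = ((-1 : ℤ), (1 : ℤ)) from by decide, im_one_mul_toC]; norm_num) (by decide),
    show ((1 : ℤ), (1 : ℤ)) - ((2 : ℤ), (0 : ℤ)) = ((-1 : ℤ), (1 : ℤ)) from by decide, show ((1 : ℤ), (3 : ℤ)) - ((2 : ℤ), (0 : ℤ)) = ((-1 : ℤ), (3 : ℤ)) from by decide]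
  rw [angAt_vec (c := I) (b := ((1 : ℤ), (1 : ℤ))) (P₀ := ((2 : ℤ), (0 : ℤ))) (P₁ := ((2 : ℤ), (1 : ℤ))) (by norm_num)
    (by rw [show ((2 : ℤ), (0 : ℤ)) - ((1 : ℤ), (1 : ℤ)) = ((1 : ℤ), (-1 : ℤ)) from by decide, im_I_mul_toC]; norm_num)
    (by rw [show ((2 : ℤ), (1 : ℤ)) - ((1 : ℤ), (1 : ℤ)) = ((1 : ℤ), (0 : ℤ)) from by decide, im_I_mul_toC]; norm_num) (by decide),
    show ((2 : ℤ), (1 : ℤ)) - ((1 : ℤ), (1 : ℤ)) = ((1 : ℤ), (0 : ℤ)) from by decide, show ((2 : ℤ), (0 : ℤ)) - ((1 : ℤ), (1 : ℤ)) = ((1 : ℤ), (-1 : ℤ)) from by decide]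
  rw [angAt_vec (c := I) (b := ((1 : ℤ), (1 : ℤ))) (P₀ := ((2 : ℤ), (1 : ℤ))) (P₁ := ((3 : ℤ), (2 : ℤ))) (by norm_num)
    (by rw [show ((2 : ℤ), (1 : ℤ)) - ((1 : ℤ), (1 : ℤ)) = ((1 : ℤ), (0 : ℤ)) from by decide, im_I_mul_toC]; norm_num)
    (by rw [show ((3 : ℤ), (2 : ℤ)) - ((1 : ℤ), (1 : ℤ)) = ((2 : ℤ), (1 : ℤ)) from by decide, im_I_mul_toC]; norm_num) (by decide),
    show ((3 : ℤ), (2 : ℤ)) - ((1 : ℤ), (1 : ℤ)) = ((2 : ℤ), (1 : ℤ)) from by decide, show ((2 : ℤ), (1 : ℤ)) - ((1 : ℤ), (1 : ℤ)) = ((1 : ℤ), (0 : ℤ)) from by decide]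
  rw [angAt_vec (c := I) (b := ((1 : ℤ), (1 : ℤ))) (P₀ := ((2 : ℤ), (5 : ℤ))) (P₁ := ((2 : ℤ), (3 : ℤ))) (by norm_num)
    (by rw [show ((2 : ℤ), (5 : ℤ)) - ((1 : ℤ), (1 : ℤ)) = ((1 : ℤ), (4 : ℤ)) from by decide, im_I_mul_toC]; norm_num)
    (by rw [show ((2 : ℤ), (3 : ℤ)) - ((1 : ℤ), (1 : ℤ)) = ((1 : ℤ), (2 : ℤ)) from by decide, im_I_mul_toC]; norm_num) (by decide),
    show ((2 : ℤ), (3 : ℤ)) - ((1 : ℤ), (1 : ℤ)) = ((1 : ℤ), (2 : ℤ)) from by decide, show ((2 : ℤ), (5 : ℤ)) - ((1 : ℤ), (1 : ℤ)) = ((1 : ℤ), (4 : ℤ)) from by decide]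
  rw [angAt_vec (c := I) (b := ((1 : ℤ), (1 : ℤ))) (P₀ := ((2 : ℤ), (3 : ℤ))) (P₁ := ((3 : ℤ), (2 : ℤ))) (by norm_num)
    (by rw [show ((2 : ℤ), (3 : ℤ)) - ((1 : ℤ), (1 : ℤ)) = ((1 : ℤ), (2 : ℤ)) from by decide, im_I_mul_toC]; norm_num)
    (by rw [show ((3 : ℤ), (2 : ℤ)) - ((1 : ℤ), (1 : ℤ)) = ((2 : ℤ), (1 : ℤ)) from by decide, im_I_mul_toC]; norm_num) (by decide),
    show ((3 : ℤ), (2 : ℤ)) - ((1 : ℤ), (1 : ℤ)) = ((2 : ℤ), (1 : ℤ)) from by decide, show ((2 : ℤ), (3 : ℤ)) - ((1 : ℤ), (1 : ℤ)) = ((1 : ℤ), (2 : ℤ)) from by decide]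
  rw [angAt_vec (c := I) (b := ((1 : ℤ), (1 : ℤ))) (P₀ := ((2 : ℤ), (5 : ℤ))) (P₁ := ((2 : ℤ), (4 : ℤ))) (by norm_num)
    (by rw [show ((2 : ℤ), (5 : ℤ)) - ((1 : ℤ), (1 : ℤ)) = ((1 : ℤ), (4 : ℤ)) from by decide, im_I_mul_toC]; norm_num)
    (by rw [show ((2 : ℤ), (4 : ℤ)) - ((1 : ℤ), (1 : ℤ)) = ((1 : ℤ), (3 : ℤ)) from by decide, im_I_mul_toC]; norm_num) (by decide),
    show ((2 : ℤ), (4 : ℤ)) - ((1 : ℤ), (1 : ℤ)) = ((1 : ℤ), (3 : ℤ)) from by decide, show ((2 : ℤ), (5 : ℤ)) - ((1 : ℤ), (1 : ℤ)) = ((1 : ℤ), (4 : ℤ)) from by decide]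
  rw [angAt_vec (c := I) (b := ((1 : ℤ), (1 : ℤ))) (P₀ := ((2 : ℤ), (4 : ℤ))) (P₁ := ((1 : ℤ), (3 : ℤ))) (by norm_num)
    (by rw [show ((2 : ℤ), (4 : ℤ)) - ((1 : ℤ), (1 : ℤ)) = ((1 : ℤ), (3 : ℤ)) from by decide, im_I_mul_toC]; norm_num)
    (by rw [show ((1 : ℤ), (3 : ℤ)) - ((1 : ℤ), (1 : ℤ)) = ((0 : ℤ), (2 : ℤ)) from by decide, im_I_mul_toC]; norm_num) (by decide),
    show ((1 : ℤ), (3 : ℤ)) - ((1 : ℤ), (1 : ℤ)) = ((0 : ℤ), (2 : ℤ)) from by decide, show ((2 : ℤ), (4 : ℤ)) - ((1 : ℤ), (1 : ℤ)) = ((1 : ℤ), (3 : ℤ)) from by decide]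
  have ha0 : Complex.arg ((1 : ℂ) * toC ((-1 : ℤ), (1 : ℤ))) = 3 * π / 4 := by
    rw [show (1 : ℂ) * toC ((-1 : ℤ), (1 : ℤ)) = (-1 + I) by apply Complex.ext <;> simp [toC]]; exact arg_neg_one_add_I
  have ha1 : Complex.arg ((1 : ℂ) * toC ((0 : ℤ), (1 : ℤ))) = π / 2 := by
    rw [show (1 : ℂ) * toC ((0 : ℤ), (1 : ℤ)) = I by apply Complex.ext <;> simp [toC]]; exact Complex.arg_I
  have ha2 : Complex.arg (I * toC ((0 : ℤ), (2 : ℤ))) = π := by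
    rw [show I * toC ((0 : ℤ), (2 : ℤ)) = ((2 : ℝ) : ℂ) * -1 by apply Complex.ext <;> simp [toC], Complex.arg_real_mul _ (by norm_num)]
    exact Complex.arg_neg_one
  have ha3 : Complex.arg (I * toC ((1 : ℤ), (-1 : ℤ))) = π / 4 := by
    rw [show I * toC ((1 : ℤ), (-1 : ℤ)) = (1 + I) by apply Complex.ext <;> simp [toC]]; exact arg_one_add_I
  have hb0_1 : Complex.arg (toC ((0 : ℤ), (-1 : ℤ))) = -(π / 2) := by
    rw [show toC ((0 : ℤ), (-1 : ℤ)) = -I by apply Complex.ext <;> simp [toC]]; exact Complex.arg_neg_I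
  have hb0_2 : Complex.arg (toC ((-1 : ℤ), (-1 : ℤ))) = -(3 * π / 4) := by
    rw [show toC ((-1 : ℤ), (-1 : ℤ)) = (-1 - I) by apply Complex.ext <;> simp [toC]]; exact arg_neg_one_sub_I
  have ht0 : ((Complex.arg (toC ((-1 : ℤ), (-1 : ℤ))) : Real.Angle) - (Complex.arg (toC ((0 : ℤ), (-1 : ℤ))) : Real.Angle)).toReal = (-(3 * π / 4)) - (-(π / 2)) := by
    rw [hb0_2, hb0_1, ← Real.Angle.coe_sub]; exact toReal_coe_of_mem (by constructor <;> linarith)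
  have hb1_1 : Complex.arg (toC ((-1 : ℤ), (-1 : ℤ))) = -(3 * π / 4) := by
    rw [show toC ((-1 : ℤ), (-1 : ℤ)) = (-1 - I) by apply Complex.ext <;> simp [toC]]; exact arg_neg_one_sub_I
  have hb1_2 : Complex.arg (toC ((0 : ℤ), (-2 : ℤ))) = -(π / 2) := by
    rw [show toC ((0 : ℤ), (-2 : ℤ)) = ((2 : ℝ) : ℂ) * -I by apply Complex.ext <;> simp [toC], Complex.arg_real_mul _ (by norm_num)]
    exact Complex.arg_neg_I
  have ht1 : ((Complex.arg (toC ((0 : ℤ), (-2 : ℤ))) : Real.Angle) - (Complex.arg (toC ((-1 : ℤ), (-1 : ℤ))) : Real.Angle)).toReal = (-(π / 2)) - (-(3 * π / 4)) := by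
    rw [hb1_2, hb1_1, ← Real.Angle.coe_sub]; exact toReal_coe_of_mem (by constructor <;> linarith)
  linarith [ha0, ha1, ha2, ha3, ht0, ht1]

/-- Case `(S, E, W)`. [folklore] -/
theorem Loc_S_E_W : Loc .S .E .W = excursionWinding (π / 2) .S .E .W := by
  rw [Loc, L₁off, L₂off, tailExtOff]
  simp only [tailOffs, wOff, Xo, tailPts, Side.offset, Side.inOff, Side.nIn, List.length_cons, List.length_nil,
    List.getD_cons_zero, List.getD_cons_succ, Finset.sum_range_succ, Finset.sum_range_zero, zero_add, Nat.reduceAdd,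
    if_true, if_false, Nat.succ_ne_zero, Prod.mk_sub_mk, Prod.mk_add_mk, arcTurn, excursionWinding]
  norm_num
  have hpi := Real.pi_pos
  rw [angAt_vec (c := (1 : ℂ)) (b := ((2 : ℤ), (0 : ℤ))) (P₀ := ((2 : ℤ), (1 : ℤ))) (P₁ := ((3 : ℤ), (2 : ℤ))) (one_ne_zero)
    (by rw [show ((2 : ℤ), (1 : ℤ)) - ((2 : ℤ), (0 : ℤ)) = ((0 : ℤ), (1 : ℤ)) from by decide, im_one_mul_toC]; norm_num)
    (by rw [show ((3 : ℤ), (2 : ℤ)) - ((2 : ℤ), (0 : ℤ)) = ((1 : ℤ), (2 : ℤ)) from by decide, im_one_mul_toC]; norm_num) (by decide),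
    show ((3 : ℤ), (2 : ℤ)) - ((2 : ℤ), (0 : ℤ)) = ((1 : ℤ), (2 : ℤ)) from by decide, show ((2 : ℤ), (1 : ℤ)) - ((2 : ℤ), (0 : ℤ)) = ((0 : ℤ), (1 : ℤ)) from by decide]
  rw [angAt_vec (c := (1 : ℂ)) (b := ((2 : ℤ), (0 : ℤ))) (P₀ := ((-1 : ℤ), (2 : ℤ))) (P₁ := ((1 : ℤ), (2 : ℤ))) (one_ne_zero)
    (by rw [show ((-1 : ℤ), (2 : ℤ)) - ((2 : ℤ), (0 : ℤ)) = ((-3 : ℤ), (2 : ℤ)) from by decide, im_one_mul_toC]; norm_num)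
    (by rw [show ((1 : ℤ), (2 : ℤ)) - ((2 : ℤ), (0 : ℤ)) = ((-1 : ℤ), (2 : ℤ)) from by decide, im_one_mul_toC]; norm_num) (by decide),
    show ((1 : ℤ), (2 : ℤ)) - ((2 : ℤ), (0 : ℤ)) = ((-1 : ℤ), (2 : ℤ)) from by decide, show ((-1 : ℤ), (2 : ℤ)) - ((2 : ℤ), (0 : ℤ)) = ((-3 : ℤ), (2 : ℤ)) from by decide]
  rw [angAt_vec (c := (1 : ℂ)) (b := ((2 : ℤ), (0 : ℤ))) (P₀ := ((1 : ℤ), (2 : ℤ))) (P₁ := ((3 : ℤ), (2 : ℤ))) (one_ne_zero)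
    (by rw [show ((1 : ℤ), (2 : ℤ)) - ((2 : ℤ), (0 : ℤ)) = ((-1 : ℤ), (2 : ℤ)) from by decide, im_one_mul_toC]; norm_num)
    (by rw [show ((3 : ℤ), (2 : ℤ)) - ((2 : ℤ), (0 : ℤ)) = ((1 : ℤ), (2 : ℤ)) from by decide, im_one_mul_toC]; norm_num) (by decide),
    show ((3 : ℤ), (2 : ℤ)) - ((2 : ℤ), (0 : ℤ)) = ((1 : ℤ), (2 : ℤ)) from by decide, show ((1 : ℤ), (2 : ℤ)) - ((2 : ℤ), (0 : ℤ)) = ((-1 : ℤ), (2 : ℤ)) from by decide]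
  rw [angAt_vec (c := (1 : ℂ)) (b := ((2 : ℤ), (0 : ℤ))) (P₀ := ((-1 : ℤ), (2 : ℤ))) (P₁ := ((0 : ℤ), (2 : ℤ))) (one_ne_zero)
    (by rw [show ((-1 : ℤ), (2 : ℤ)) - ((2 : ℤ), (0 : ℤ)) = ((-3 : ℤ), (2 : ℤ)) from by decide, im_one_mul_toC]; norm_num)
    (by rw [show ((0 : ℤ), (2 : ℤ)) - ((2 : ℤ), (0 : ℤ)) = ((-2 : ℤ), (2 : ℤ)) from by decide, im_one_mul_toC]; norm_num) (by decide),
    show ((0 : ℤ), (2 : ℤ)) - ((2 : ℤ), (0 : ℤ)) = ((-2 : ℤ), (2 : ℤ)) from by decide, show ((-1 : ℤ), (2 : ℤ)) - ((2 : ℤ), (0 : ℤ)) = ((-3 : ℤ), (2 : ℤ)) from by decide]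
  rw [angAt_vec (c := (1 : ℂ)) (b := ((2 : ℤ), (0 : ℤ))) (P₀ := ((0 : ℤ), (2 : ℤ))) (P₁ := ((1 : ℤ), (1 : ℤ))) (one_ne_zero)
    (by rw [show ((0 : ℤ), (2 : ℤ)) - ((2 : ℤ), (0 : ℤ)) = ((-2 : ℤ), (2 : ℤ)) from by decide, im_one_mul_toC]; norm_num)
    (by rw [show ((1 : ℤ), (1 : ℤ)) - ((2 : ℤ), (0 : ℤ)) = ((-1 : ℤ), (1 : ℤ)) from by decide, im_one_mul_toC]; norm_num) (by decide),
    show ((1 : ℤ), (1 : ℤ)) - ((2 : ℤ), (0 : ℤ)) = ((-1 : ℤ), (1 : ℤ)) from by decide, show ((0 : ℤ), (2 : ℤ)) - ((2 : ℤ), (0 : ℤ)) = ((-2 : ℤ), (2 : ℤ)) from by decide]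
  rw [angAt_vec (c := (-1 : ℂ)) (b := ((1 : ℤ), (1 : ℤ))) (P₀ := ((2 : ℤ), (0 : ℤ))) (P₁ := ((2 : ℤ), (1 : ℤ))) (by norm_num)
    (by rw [show ((2 : ℤ), (0 : ℤ)) - ((1 : ℤ), (1 : ℤ)) = ((1 : ℤ), (-1 : ℤ)) from by decide, im_neg_one_mul_toC]; norm_num)
    (by rw [show ((2 : ℤ), (1 : ℤ)) - ((1 : ℤ), (1 : ℤ)) = ((1 : ℤ), (0 : ℤ)) from by decide, im_neg_one_mul_toC]; norm_num) (by decide),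
    show ((2 : ℤ), (1 : ℤ)) - ((1 : ℤ), (1 : ℤ)) = ((1 : ℤ), (0 : ℤ)) from by decide, show ((2 : ℤ), (0 : ℤ)) - ((1 : ℤ), (1 : ℤ)) = ((1 : ℤ), (-1 : ℤ)) from by decide]
  rw [angAt_vec (c := (1 : ℂ)) (b := ((1 : ℤ), (1 : ℤ))) (P₀ := ((2 : ℤ), (1 : ℤ))) (P₁ := ((3 : ℤ), (2 : ℤ))) (one_ne_zero)
    (by rw [show ((2 : ℤ), (1 : ℤ)) - ((1 : ℤ), (1 : ℤ)) = ((1 : ℤ), (0 : ℤ)) from by decide, im_one_mul_toC]; norm_num)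
    (by rw [show ((3 : ℤ), (2 : ℤ)) - ((1 : ℤ), (1 : ℤ)) = ((2 : ℤ), (1 : ℤ)) from by decide, im_one_mul_toC]; norm_num) (by decide),
    show ((3 : ℤ), (2 : ℤ)) - ((1 : ℤ), (1 : ℤ)) = ((2 : ℤ), (1 : ℤ)) from by decide, show ((2 : ℤ), (1 : ℤ)) - ((1 : ℤ), (1 : ℤ)) = ((1 : ℤ), (0 : ℤ)) from by decide]
  rw [angAt_vec (c := (1 : ℂ)) (b := ((1 : ℤ), (1 : ℤ))) (P₀ := ((-1 : ℤ), (2 : ℤ))) (P₁ := ((1 : ℤ), (2 : ℤ))) (one_ne_zero)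
    (by rw [show ((-1 : ℤ), (2 : ℤ)) - ((1 : ℤ), (1 : ℤ)) = ((-2 : ℤ), (1 : ℤ)) from by decide, im_one_mul_toC]; norm_num)
    (by rw [show ((1 : ℤ), (2 : ℤ)) - ((1 : ℤ), (1 : ℤ)) = ((0 : ℤ), (1 : ℤ)) from by decide, im_one_mul_toC]; norm_num) (by decide),
    show ((1 : ℤ), (2 : ℤ)) - ((1 : ℤ), (1 : ℤ)) = ((0 : ℤ), (1 : ℤ)) from by decide, show ((-1 : ℤ), (2 : ℤ)) - ((1 : ℤ), (1 : ℤ)) = ((-2 : ℤ), (1 : ℤ)) from by decide]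
  rw [angAt_vec (c := (1 : ℂ)) (b := ((1 : ℤ), (1 : ℤ))) (P₀ := ((1 : ℤ), (2 : ℤ))) (P₁ := ((3 : ℤ), (2 : ℤ))) (one_ne_zero)
    (by rw [show ((1 : ℤ), (2 : ℤ)) - ((1 : ℤ), (1 : ℤ)) = ((0 : ℤ), (1 : ℤ)) from by decide, im_one_mul_toC]; norm_num)
    (by rw [show ((3 : ℤ), (2 : ℤ)) - ((1 : ℤ), (1 : ℤ)) = ((2 : ℤ), (1 : ℤ)) from by decide, im_one_mul_toC]; norm_num) (by decide),
    show ((3 : ℤ), (2 : ℤ)) - ((1 : ℤ), (1 : ℤ)) = ((2 : ℤ), (1 : ℤ)) from by decide, show ((1 : ℤ), (2 : ℤ)) - ((1 : ℤ), (1 : ℤ)) = ((0 : ℤ), (1 : ℤ)) from by decide]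
  rw [angAt_vec (c := (1 : ℂ)) (b := ((1 : ℤ), (1 : ℤ))) (P₀ := ((-1 : ℤ), (2 : ℤ))) (P₁ := ((0 : ℤ), (2 : ℤ))) (one_ne_zero)
    (by rw [show ((-1 : ℤ), (2 : ℤ)) - ((1 : ℤ), (1 : ℤ)) = ((-2 : ℤ), (1 : ℤ)) from by decide, im_one_mul_toC]; norm_num)
    (by rw [show ((0 : ℤ), (2 : ℤ)) - ((1 : ℤ), (1 : ℤ)) = ((-1 : ℤ), (1 : ℤ)) from by decide, im_one_mul_toC]; norm_num) (by decide),
    show ((0 : ℤ), (2 : ℤ)) - ((1 : ℤ), (1 : ℤ)) = ((-1 : ℤ), (1 : ℤ)) from by decide, show ((-1 : ℤ), (2 : ℤ)) - ((1 : ℤ), (1 : ℤ)) = ((-2 : ℤ), (1 : ℤ)) from by decide]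
  have ha0 : Complex.arg ((-1 : ℂ) * toC ((1 : ℤ), (-1 : ℤ))) = 3 * π / 4 := by
    rw [show (-1 : ℂ) * toC ((1 : ℤ), (-1 : ℤ)) = (-1 + I) by apply Complex.ext <;> simp [toC]]; exact arg_neg_one_add_I
  have ha1 : Complex.arg ((-1 : ℂ) * toC ((1 : ℤ), (0 : ℤ))) = π := by
    rw [show (-1 : ℂ) * toC ((1 : ℤ), (0 : ℤ)) = -1 by apply Complex.ext <;> simp [toC]]; exact Complex.arg_neg_one
  have ha2 : Complex.arg ((1 : ℂ) * toC ((-1 : ℤ), (1 : ℤ))) = 3 * π / 4 := by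
    rw [show (1 : ℂ) * toC ((-1 : ℤ), (1 : ℤ)) = (-1 + I) by apply Complex.ext <;> simp [toC]]; exact arg_neg_one_add_I
  have ha3 : Complex.arg ((1 : ℂ) * toC ((0 : ℤ), (1 : ℤ))) = π / 2 := by
    rw [show (1 : ℂ) * toC ((0 : ℤ), (1 : ℤ)) = I by apply Complex.ext <;> simp [toC]]; exact Complex.arg_I
  have ha4 : Complex.arg ((1 : ℂ) * toC ((1 : ℤ), (0 : ℤ))) = 0 := by
    rw [show (1 : ℂ) * toC ((1 : ℤ), (0 : ℤ)) = 1 by apply Complex.ext <;> simp [toC]]; exact Complex.arg_one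
  have hb0_1 : Complex.arg (toC ((1 : ℤ), (0 : ℤ))) = 0 := by
    rw [show toC ((1 : ℤ), (0 : ℤ)) = 1 by apply Complex.ext <;> simp [toC]]; exact Complex.arg_one
  have hb0_2 : Complex.arg (toC ((1 : ℤ), (-1 : ℤ))) = -(π / 4) := by
    rw [show toC ((1 : ℤ), (-1 : ℤ)) = (1 - I) by apply Complex.ext <;> simp [toC]]; exact arg_one_sub_I
  have ht0 : ((Complex.arg (toC ((1 : ℤ), (-1 : ℤ))) : Real.Angle) - (Complex.arg (toC ((1 : ℤ), (0 : ℤ))) : Real.Angle)).toReal = (-(π / 4)) - (0) := by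
    rw [hb0_2, hb0_1, ← Real.Angle.coe_sub]; exact toReal_coe_of_mem (by constructor <;> linarith)
  linarith [ha0, ha1, ha2, ha3, ha4, ht0]

/-- Case `(N, E, S)`. [folklore] -/
theorem Loc_N_E_S : Loc .N .E .S = excursionWinding (π / 2) .N .E .S := by
  rw [Loc, L₁off, L₂off, tailExtOff]
  simp only [tailOffs, wOff, Xo, tailPts, Side.offset, Side.inOff, Side.nIn, List.length_cons, List.length_nil,
    List.getD_cons_zero, List.getD_cons_succ, Finset.sum_range_succ, Finset.sum_range_zero, zero_add, Nat.reduceAdd,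
    if_true, if_false, Nat.succ_ne_zero, Prod.mk_sub_mk, Prod.mk_add_mk, arcTurn, excursionWinding]
  norm_num
  have hpi := Real.pi_pos
  rw [angAt_vec (c := (-1 : ℂ)) (b := ((2 : ℤ), (4 : ℤ))) (P₀ := ((2 : ℤ), (3 : ℤ))) (P₁ := ((3 : ℤ), (2 : ℤ))) (by norm_num)
    (by rw [show ((2 : ℤ), (3 : ℤ)) - ((2 : ℤ), (4 : ℤ)) = ((0 : ℤ), (-1 : ℤ)) from by decide, im_neg_one_mul_toC]; norm_num)
    (by rw [show ((3 : ℤ), (2 : ℤ)) - ((2 : ℤ), (4 : ℤ)) = ((1 : ℤ), (-2 : ℤ)) from by decide, im_neg_one_mul_toC]; norm_num) (by decide),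
    show ((3 : ℤ), (2 : ℤ)) - ((2 : ℤ), (4 : ℤ)) = ((1 : ℤ), (-2 : ℤ)) from by decide, show ((2 : ℤ), (3 : ℤ)) - ((2 : ℤ), (4 : ℤ)) = ((0 : ℤ), (-1 : ℤ)) from by decide]
  rw [angAt_vec (c := (-1 : ℂ)) (b := ((2 : ℤ), (4 : ℤ))) (P₀ := ((2 : ℤ), (-1 : ℤ))) (P₁ := ((2 : ℤ), (1 : ℤ))) (by norm_num)
    (by rw [show ((2 : ℤ), (-1 : ℤ)) - ((2 : ℤ), (4 : ℤ)) = ((0 : ℤ), (-5 : ℤ)) from by decide, im_neg_one_mul_toC]; norm_num)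
    (by rw [show ((2 : ℤ), (1 : ℤ)) - ((2 : ℤ), (4 : ℤ)) = ((0 : ℤ), (-3 : ℤ)) from by decide, im_neg_one_mul_toC]; norm_num) (by decide),
    show ((2 : ℤ), (1 : ℤ)) - ((2 : ℤ), (4 : ℤ)) = ((0 : ℤ), (-3 : ℤ)) from by decide, show ((2 : ℤ), (-1 : ℤ)) - ((2 : ℤ), (4 : ℤ)) = ((0 : ℤ), (-5 : ℤ)) from by decide]
  rw [angAt_vec (c := (-1 : ℂ)) (b := ((2 : ℤ), (4 : ℤ))) (P₀ := ((2 : ℤ), (1 : ℤ))) (P₁ := ((3 : ℤ), (2 : ℤ))) (by norm_num)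
    (by rw [show ((2 : ℤ), (1 : ℤ)) - ((2 : ℤ), (4 : ℤ)) = ((0 : ℤ), (-3 : ℤ)) from by decide, im_neg_one_mul_toC]; norm_num)
    (by rw [show ((3 : ℤ), (2 : ℤ)) - ((2 : ℤ), (4 : ℤ)) = ((1 : ℤ), (-2 : ℤ)) from by decide, im_neg_one_mul_toC]; norm_num) (by decide),
    show ((3 : ℤ), (2 : ℤ)) - ((2 : ℤ), (4 : ℤ)) = ((1 : ℤ), (-2 : ℤ)) from by decide, show ((2 : ℤ), (1 : ℤ)) - ((2 : ℤ), (4 : ℤ)) = ((0 : ℤ), (-3 : ℤ)) from by decide]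
  rw [angAt_vec (c := (-1 : ℂ)) (b := ((2 : ℤ), (4 : ℤ))) (P₀ := ((2 : ℤ), (-1 : ℤ))) (P₁ := ((2 : ℤ), (0 : ℤ))) (by norm_num)
    (by rw [show ((2 : ℤ), (-1 : ℤ)) - ((2 : ℤ), (4 : ℤ)) = ((0 : ℤ), (-5 : ℤ)) from by decide, im_neg_one_mul_toC]; norm_num)
    (by rw [show ((2 : ℤ), (0 : ℤ)) - ((2 : ℤ), (4 : ℤ)) = ((0 : ℤ), (-4 : ℤ)) from by decide, im_neg_one_mul_toC]; norm_num) (by decide),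
    show ((2 : ℤ), (0 : ℤ)) - ((2 : ℤ), (4 : ℤ)) = ((0 : ℤ), (-4 : ℤ)) from by decide, show ((2 : ℤ), (-1 : ℤ)) - ((2 : ℤ), (4 : ℤ)) = ((0 : ℤ), (-5 : ℤ)) from by decide]
  rw [angAt_vec (c := (-1 : ℂ)) (b := ((2 : ℤ), (4 : ℤ))) (P₀ := ((2 : ℤ), (0 : ℤ))) (P₁ := ((1 : ℤ), (1 : ℤ))) (by norm_num)
    (by rw [show ((2 : ℤ), (0 : ℤ)) - ((2 : ℤ), (4 : ℤ)) = ((0 : ℤ), (-4 : ℤ)) from by decide, im_neg_one_mul_toC]; norm_num)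
    (by rw [show ((1 : ℤ), (1 : ℤ)) - ((2 : ℤ), (4 : ℤ)) = ((-1 : ℤ), (-3 : ℤ)) from by decide, im_neg_one_mul_toC]; norm_num) (by decide),
    show ((1 : ℤ), (1 : ℤ)) - ((2 : ℤ), (4 : ℤ)) = ((-1 : ℤ), (-3 : ℤ)) from by decide, show ((2 : ℤ), (0 : ℤ)) - ((2 : ℤ), (4 : ℤ)) = ((0 : ℤ), (-4 : ℤ)) from by decide]
  rw [angAt_vec (c := (-1 : ℂ)) (b := ((2 : ℤ), (4 : ℤ))) (P₀ := ((1 : ℤ), (1 : ℤ))) (P₁ := ((1 : ℤ), (3 : ℤ))) (by norm_num)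
    (by rw [show ((1 : ℤ), (1 : ℤ)) - ((2 : ℤ), (4 : ℤ)) = ((-1 : ℤ), (-3 : ℤ)) from by decide, im_neg_one_mul_toC]; norm_num)
    (by rw [show ((1 : ℤ), (3 : ℤ)) - ((2 : ℤ), (4 : ℤ)) = ((-1 : ℤ), (-1 : ℤ)) from by decide, im_neg_one_mul_toC]; norm_num) (by decide),
    show ((1 : ℤ), (3 : ℤ)) - ((2 : ℤ), (4 : ℤ)) = ((-1 : ℤ), (-1 : ℤ)) from by decide, show ((1 : ℤ), (1 : ℤ)) - ((2 : ℤ), (4 : ℤ)) = ((-1 : ℤ), (-3 : ℤ)) from by decide]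
  rw [angAt_vec (c := I) (b := ((1 : ℤ), (3 : ℤ))) (P₀ := ((2 : ℤ), (4 : ℤ))) (P₁ := ((2 : ℤ), (3 : ℤ))) (by norm_num)
    (by rw [show ((2 : ℤ), (4 : ℤ)) - ((1 : ℤ), (3 : ℤ)) = ((1 : ℤ), (1 : ℤ)) from by decide, im_I_mul_toC]; norm_num)
    (by rw [show ((2 : ℤ), (3 : ℤ)) - ((1 : ℤ), (3 : ℤ)) = ((1 : ℤ), (0 : ℤ)) from by decide, im_I_mul_toC]; norm_num) (by decide),
    show ((2 : ℤ), (3 : ℤ)) - ((1 : ℤ), (3 : ℤ)) = ((1 : ℤ), (0 : ℤ)) from by decide, show ((2 : ℤ), (4 : ℤ)) - ((1 : ℤ), (3 : ℤ)) = ((1 : ℤ), (1 : ℤ)) from by decide]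
  rw [angAt_vec (c := I) (b := ((1 : ℤ), (3 : ℤ))) (P₀ := ((2 : ℤ), (3 : ℤ))) (P₁ := ((3 : ℤ), (2 : ℤ))) (by norm_num)
    (by rw [show ((2 : ℤ), (3 : ℤ)) - ((1 : ℤ), (3 : ℤ)) = ((1 : ℤ), (0 : ℤ)) from by decide, im_I_mul_toC]; norm_num)
    (by rw [show ((3 : ℤ), (2 : ℤ)) - ((1 : ℤ), (3 : ℤ)) = ((2 : ℤ), (-1 : ℤ)) from by decide, im_I_mul_toC]; norm_num) (by decide),
    show ((3 : ℤ), (2 : ℤ)) - ((1 : ℤ), (3 : ℤ)) = ((2 : ℤ), (-1 : ℤ)) from by decide, show ((2 : ℤ), (3 : ℤ)) - ((1 : ℤ), (3 : ℤ)) = ((1 : ℤ), (0 : ℤ)) from by decide]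
  rw [angAt_vec (c := I) (b := ((1 : ℤ), (3 : ℤ))) (P₀ := ((2 : ℤ), (-1 : ℤ))) (P₁ := ((2 : ℤ), (1 : ℤ))) (by norm_num)
    (by rw [show ((2 : ℤ), (-1 : ℤ)) - ((1 : ℤ), (3 : ℤ)) = ((1 : ℤ), (-4 : ℤ)) from by decide, im_I_mul_toC]; norm_num)
    (by rw [show ((2 : ℤ), (1 : ℤ)) - ((1 : ℤ), (3 : ℤ)) = ((1 : ℤ), (-2 : ℤ)) from by decide, im_I_mul_toC]; norm_num) (by decide),
    show ((2 : ℤ), (1 : ℤ)) - ((1 : ℤ), (3 : ℤ)) = ((1 : ℤ), (-2 : ℤ)) from by decide, show ((2 : ℤ), (-1 : ℤ)) - ((1 : ℤ), (3 : ℤ)) = ((1 : ℤ), (-4 : ℤ)) from by decide]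
  rw [angAt_vec (c := I) (b := ((1 : ℤ), (3 : ℤ))) (P₀ := ((2 : ℤ), (1 : ℤ))) (P₁ := ((3 : ℤ), (2 : ℤ))) (by norm_num)
    (by rw [show ((2 : ℤ), (1 : ℤ)) - ((1 : ℤ), (3 : ℤ)) = ((1 : ℤ), (-2 : ℤ)) from by decide, im_I_mul_toC]; norm_num)
    (by rw [show ((3 : ℤ), (2 : ℤ)) - ((1 : ℤ), (3 : ℤ)) = ((2 : ℤ), (-1 : ℤ)) from by decide, im_I_mul_toC]; norm_num) (by decide),
    show ((3 : ℤ), (2 : ℤ)) - ((1 : ℤ), (3 : ℤ)) = ((2 : ℤ), (-1 : ℤ)) from by decide, show ((2 : ℤ), (1 : ℤ)) - ((1 : ℤ), (3 : ℤ)) = ((1 : ℤ), (-2 : ℤ)) from by decide]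
  rw [angAt_vec (c := I) (b := ((1 : ℤ), (3 : ℤ))) (P₀ := ((2 : ℤ), (-1 : ℤ))) (P₁ := ((2 : ℤ), (0 : ℤ))) (by norm_num)
    (by rw [show ((2 : ℤ), (-1 : ℤ)) - ((1 : ℤ), (3 : ℤ)) = ((1 : ℤ), (-4 : ℤ)) from by decide, im_I_mul_toC]; norm_num)
    (by rw [show ((2 : ℤ), (0 : ℤ)) - ((1 : ℤ), (3 : ℤ)) = ((1 : ℤ), (-3 : ℤ)) from by decide, im_I_mul_toC]; norm_num) (by decide),
    show ((2 : ℤ), (0 : ℤ)) - ((1 : ℤ), (3 : ℤ)) = ((1 : ℤ), (-3 : ℤ)) from by decide, show ((2 : ℤ), (-1 : ℤ)) - ((1 : ℤ), (3 : ℤ)) = ((1 : ℤ), (-4 : ℤ)) from by decide]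
  rw [angAt_vec (c := I) (b := ((1 : ℤ), (3 : ℤ))) (P₀ := ((2 : ℤ), (0 : ℤ))) (P₁ := ((1 : ℤ), (1 : ℤ))) (by norm_num)
    (by rw [show ((2 : ℤ), (0 : ℤ)) - ((1 : ℤ), (3 : ℤ)) = ((1 : ℤ), (-3 : ℤ)) from by decide, im_I_mul_toC]; norm_num)
    (by rw [show ((1 : ℤ), (1 : ℤ)) - ((1 : ℤ), (3 : ℤ)) = ((0 : ℤ), (-2 : ℤ)) from by decide, im_I_mul_toC]; norm_num) (by decide),
    show ((1 : ℤ), (1 : ℤ)) - ((1 : ℤ), (3 : ℤ)) = ((0 : ℤ), (-2 : ℤ)) from by decide, show ((2 : ℤ), (0 : ℤ)) - ((1 : ℤ), (3 : ℤ)) = ((1 : ℤ), (-3 : ℤ)) from by decide]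
  have ha0 : Complex.arg ((-1 : ℂ) * toC ((-1 : ℤ), (-1 : ℤ))) = π / 4 := by
    rw [show (-1 : ℂ) * toC ((-1 : ℤ), (-1 : ℤ)) = (1 + I) by apply Complex.ext <;> simp [toC]]; exact arg_one_add_I
  have ha1 : Complex.arg ((-1 : ℂ) * toC ((0 : ℤ), (-1 : ℤ))) = π / 2 := by
    rw [show (-1 : ℂ) * toC ((0 : ℤ), (-1 : ℤ)) = I by apply Complex.ext <;> simp [toC]]; exact Complex.arg_I
  have ha2 : Complex.arg (I * toC ((0 : ℤ), (-2 : ℤ))) = 0 := by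
    rw [show I * toC ((0 : ℤ), (-2 : ℤ)) = ((2 : ℝ) : ℂ) * 1 by apply Complex.ext <;> simp [toC], Complex.arg_real_mul _ (by norm_num)]
    exact Complex.arg_one
  have ha3 : Complex.arg (I * toC ((1 : ℤ), (1 : ℤ))) = 3 * π / 4 := by
    rw [show I * toC ((1 : ℤ), (1 : ℤ)) = (-1 + I) by apply Complex.ext <;> simp [toC]]; exact arg_neg_one_add_I
  have hb0_1 : Complex.arg (toC ((0 : ℤ), (1 : ℤ))) = π / 2 := by
    rw [show toC ((0 : ℤ), (1 : ℤ)) = I by apply Complex.ext <;> simp [toC]]; exact Complex.arg_I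
  have hb0_2 : Complex.arg (toC ((-1 : ℤ), (1 : ℤ))) = 3 * π / 4 := by
    rw [show toC ((-1 : ℤ), (1 : ℤ)) = (-1 + I) by apply Complex.ext <;> simp [toC]]; exact arg_neg_one_add_I
  have ht0 : ((Complex.arg (toC ((-1 : ℤ), (1 : ℤ))) : Real.Angle) - (Complex.arg (toC ((0 : ℤ), (1 : ℤ))) : Real.Angle)).toReal = (3 * π / 4) - (π / 2) := by
    rw [hb0_2, hb0_1, ← Real.Angle.coe_sub]; exact toReal_coe_of_mem (by constructor <;> linarith)
  have hb1_1 : Complex.arg (toC ((-1 : ℤ), (1 : ℤ))) = 3 * π / 4 := by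
    rw [show toC ((-1 : ℤ), (1 : ℤ)) = (-1 + I) by apply Complex.ext <;> simp [toC]]; exact arg_neg_one_add_I
  have hb1_2 : Complex.arg (toC ((0 : ℤ), (2 : ℤ))) = π / 2 := by
    rw [show toC ((0 : ℤ), (2 : ℤ)) = ((2 : ℝ) : ℂ) * I by apply Complex.ext <;> simp [toC], Complex.arg_real_mul _ (by norm_num)]
    exact Complex.arg_I
  have ht1 : ((Complex.arg (toC ((0 : ℤ), (2 : ℤ))) : Real.Angle) - (Complex.arg (toC ((-1 : ℤ), (1 : ℤ))) : Real.Angle)).toReal = (π / 2) - (3 * π / 4) := by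
    rw [hb1_2, hb1_1, ← Real.Angle.coe_sub]; exact toReal_coe_of_mem (by constructor <;> linarith)
  linarith [ha0, ha1, ha2, ha3, ht0, ht1]

/-- Case `(N, W, S)`. [folklore] -/
theorem Loc_N_W_S : Loc .N .W .S = excursionWinding (π / 2) .N .W .S := by
  rw [Loc, L₁off, L₂off, tailExtOff]
  simp only [tailOffs, wOff, Xo, tailPts, Side.offset, Side.inOff, Side.nIn, List.length_cons, List.length_nil,
    List.getD_cons_zero, List.getD_cons_succ, Finset.sum_range_succ, Finset.sum_range_zero, zero_add, Nat.reduceAdd,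
    if_true, if_false, Nat.succ_ne_zero, Prod.mk_sub_mk, Prod.mk_add_mk, arcTurn, excursionWinding]
  norm_num
  have hpi := Real.pi_pos
  rw [angAt_vec (c := (-1 : ℂ)) (b := ((2 : ℤ), (4 : ℤ))) (P₀ := ((2 : ℤ), (3 : ℤ))) (P₁ := ((1 : ℤ), (2 : ℤ))) (by norm_num)
    (by rw [show ((2 : ℤ), (3 : ℤ)) - ((2 : ℤ), (4 : ℤ)) = ((0 : ℤ), (-1 : ℤ)) from by decide, im_neg_one_mul_toC]; norm_num)
    (by rw [show ((1 : ℤ), (2 : ℤ)) - ((2 : ℤ), (4 : ℤ)) = ((-1 : ℤ), (-2 : ℤ)) from by decide, im_neg_one_mul_toC]; norm_num) (by decide),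
    show ((1 : ℤ), (2 : ℤ)) - ((2 : ℤ), (4 : ℤ)) = ((-1 : ℤ), (-2 : ℤ)) from by decide, show ((2 : ℤ), (3 : ℤ)) - ((2 : ℤ), (4 : ℤ)) = ((0 : ℤ), (-1 : ℤ)) from by decide]
  rw [angAt_vec (c := (-1 : ℂ)) (b := ((2 : ℤ), (4 : ℤ))) (P₀ := ((2 : ℤ), (-1 : ℤ))) (P₁ := ((2 : ℤ), (1 : ℤ))) (by norm_num)
    (by rw [show ((2 : ℤ), (-1 : ℤ)) - ((2 : ℤ), (4 : ℤ)) = ((0 : ℤ), (-5 : ℤ)) from by decide, im_neg_one_mul_toC]; norm_num)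
    (by rw [show ((2 : ℤ), (1 : ℤ)) - ((2 : ℤ), (4 : ℤ)) = ((0 : ℤ), (-3 : ℤ)) from by decide, im_neg_one_mul_toC]; norm_num) (by decide),
    show ((2 : ℤ), (1 : ℤ)) - ((2 : ℤ), (4 : ℤ)) = ((0 : ℤ), (-3 : ℤ)) from by decide, show ((2 : ℤ), (-1 : ℤ)) - ((2 : ℤ), (4 : ℤ)) = ((0 : ℤ), (-5 : ℤ)) from by decide]
  rw [angAt_vec (c := (-1 : ℂ)) (b := ((2 : ℤ), (4 : ℤ))) (P₀ := ((2 : ℤ), (1 : ℤ))) (P₁ := ((1 : ℤ), (2 : ℤ))) (by norm_num)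
    (by rw [show ((2 : ℤ), (1 : ℤ)) - ((2 : ℤ), (4 : ℤ)) = ((0 : ℤ), (-3 : ℤ)) from by decide, im_neg_one_mul_toC]; norm_num)
    (by rw [show ((1 : ℤ), (2 : ℤ)) - ((2 : ℤ), (4 : ℤ)) = ((-1 : ℤ), (-2 : ℤ)) from by decide, im_neg_one_mul_toC]; norm_num) (by decide),
    show ((1 : ℤ), (2 : ℤ)) - ((2 : ℤ), (4 : ℤ)) = ((-1 : ℤ), (-2 : ℤ)) from by decide, show ((2 : ℤ), (1 : ℤ)) - ((2 : ℤ), (4 : ℤ)) = ((0 : ℤ), (-3 : ℤ)) from by decide]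
  rw [angAt_vec (c := (-1 : ℂ)) (b := ((2 : ℤ), (4 : ℤ))) (P₀ := ((2 : ℤ), (-1 : ℤ))) (P₁ := ((2 : ℤ), (0 : ℤ))) (by norm_num)
    (by rw [show ((2 : ℤ), (-1 : ℤ)) - ((2 : ℤ), (4 : ℤ)) = ((0 : ℤ), (-5 : ℤ)) from by decide, im_neg_one_mul_toC]; norm_num)
    (by rw [show ((2 : ℤ), (0 : ℤ)) - ((2 : ℤ), (4 : ℤ)) = ((0 : ℤ), (-4 : ℤ)) from by decide, im_neg_one_mul_toC]; norm_num) (by decide),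
    show ((2 : ℤ), (0 : ℤ)) - ((2 : ℤ), (4 : ℤ)) = ((0 : ℤ), (-4 : ℤ)) from by decide, show ((2 : ℤ), (-1 : ℤ)) - ((2 : ℤ), (4 : ℤ)) = ((0 : ℤ), (-5 : ℤ)) from by decide]
  rw [angAt_vec (c := (-1 : ℂ)) (b := ((2 : ℤ), (4 : ℤ))) (P₀ := ((2 : ℤ), (0 : ℤ))) (P₁ := ((3 : ℤ), (1 : ℤ))) (by norm_num)
    (by rw [show ((2 : ℤ), (0 : ℤ)) - ((2 : ℤ), (4 : ℤ)) = ((0 : ℤ), (-4 : ℤ)) from by decide, im_neg_one_mul_toC]; norm_num)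
    (by rw [show ((3 : ℤ), (1 : ℤ)) - ((2 : ℤ), (4 : ℤ)) = ((1 : ℤ), (-3 : ℤ)) from by decide, im_neg_one_mul_toC]; norm_num) (by decide),
    show ((3 : ℤ), (1 : ℤ)) - ((2 : ℤ), (4 : ℤ)) = ((1 : ℤ), (-3 : ℤ)) from by decide, show ((2 : ℤ), (0 : ℤ)) - ((2 : ℤ), (4 : ℤ)) = ((0 : ℤ), (-4 : ℤ)) from by decide]
  rw [angAt_vec (c := (-1 : ℂ)) (b := ((2 : ℤ), (4 : ℤ))) (P₀ := ((3 : ℤ), (1 : ℤ))) (P₁ := ((3 : ℤ), (3 : ℤ))) (by norm_num)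
    (by rw [show ((3 : ℤ), (1 : ℤ)) - ((2 : ℤ), (4 : ℤ)) = ((1 : ℤ), (-3 : ℤ)) from by decide, im_neg_one_mul_toC]; norm_num)
    (by rw [show ((3 : ℤ), (3 : ℤ)) - ((2 : ℤ), (4 : ℤ)) = ((1 : ℤ), (-1 : ℤ)) from by decide, im_neg_one_mul_toC]; norm_num) (by decide),
    show ((3 : ℤ), (3 : ℤ)) - ((2 : ℤ), (4 : ℤ)) = ((1 : ℤ), (-1 : ℤ)) from by decide, show ((3 : ℤ), (1 : ℤ)) - ((2 : ℤ), (4 : ℤ)) = ((1 : ℤ), (-3 : ℤ)) from by decide]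
  rw [angAt_vec (c := -I) (b := ((3 : ℤ), (3 : ℤ))) (P₀ := ((2 : ℤ), (4 : ℤ))) (P₁ := ((2 : ℤ), (3 : ℤ))) (by norm_num)
    (by rw [show ((2 : ℤ), (4 : ℤ)) - ((3 : ℤ), (3 : ℤ)) = ((-1 : ℤ), (1 : ℤ)) from by decide, im_negI_mul_toC]; norm_num)
    (by rw [show ((2 : ℤ), (3 : ℤ)) - ((3 : ℤ), (3 : ℤ)) = ((-1 : ℤ), (0 : ℤ)) from by decide, im_negI_mul_toC]; norm_num) (by decide),
    show ((2 : ℤ), (3 : ℤ)) - ((3 : ℤ), (3 : ℤ)) = ((-1 : ℤ), (0 : ℤ)) from by decide, show ((2 : ℤ), (4 : ℤ)) - ((3 : ℤ), (3 : ℤ)) = ((-1 : ℤ), (1 : ℤ)) from by decide]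
  rw [angAt_vec (c := -I) (b := ((3 : ℤ), (3 : ℤ))) (P₀ := ((2 : ℤ), (3 : ℤ))) (P₁ := ((1 : ℤ), (2 : ℤ))) (by norm_num)
    (by rw [show ((2 : ℤ), (3 : ℤ)) - ((3 : ℤ), (3 : ℤ)) = ((-1 : ℤ), (0 : ℤ)) from by decide, im_negI_mul_toC]; norm_num)
    (by rw [show ((1 : ℤ), (2 : ℤ)) - ((3 : ℤ), (3 : ℤ)) = ((-2 : ℤ), (-1 : ℤ)) from by decide, im_negI_mul_toC]; norm_num) (by decide),
    show ((1 : ℤ), (2 : ℤ)) - ((3 : ℤ), (3 : ℤ)) = ((-2 : ℤ), (-1 : ℤ)) from by decide, show ((2 : ℤ), (3 : ℤ)) - ((3 : ℤ), (3 : ℤ)) = ((-1 : ℤ), (0 : ℤ)) from by decide]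
  rw [angAt_vec (c := -I) (b := ((3 : ℤ), (3 : ℤ))) (P₀ := ((2 : ℤ), (-1 : ℤ))) (P₁ := ((2 : ℤ), (1 : ℤ))) (by norm_num)
    (by rw [show ((2 : ℤ), (-1 : ℤ)) - ((3 : ℤ), (3 : ℤ)) = ((-1 : ℤ), (-4 : ℤ)) from by decide, im_negI_mul_toC]; norm_num)
    (by rw [show ((2 : ℤ), (1 : ℤ)) - ((3 : ℤ), (3 : ℤ)) = ((-1 : ℤ), (-2 : ℤ)) from by decide, im_negI_mul_toC]; norm_num) (by decide),
    show ((2 : ℤ), (1 : ℤ)) - ((3 : ℤ), (3 : ℤ)) = ((-1 : ℤ), (-2 : ℤ)) from by decide, show ((2 : ℤ), (-1 : ℤ)) - ((3 : ℤ), (3 : ℤ)) = ((-1 : ℤ), (-4 : ℤ)) from by decide]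
  rw [angAt_vec (c := -I) (b := ((3 : ℤ), (3 : ℤ))) (P₀ := ((2 : ℤ), (1 : ℤ))) (P₁ := ((1 : ℤ), (2 : ℤ))) (by norm_num)
    (by rw [show ((2 : ℤ), (1 : ℤ)) - ((3 : ℤ), (3 : ℤ)) = ((-1 : ℤ), (-2 : ℤ)) from by decide, im_negI_mul_toC]; norm_num)
    (by rw [show ((1 : ℤ), (2 : ℤ)) - ((3 : ℤ), (3 : ℤ)) = ((-2 : ℤ), (-1 : ℤ)) from by decide, im_negI_mul_toC]; norm_num) (by decide),
    show ((1 : ℤ), (2 : ℤ)) - ((3 : ℤ), (3 : ℤ)) = ((-2 : ℤ), (-1 : ℤ)) from by decide, show ((2 : ℤ), (1 : ℤ)) - ((3 : ℤ), (3 : ℤ)) = ((-1 : ℤ), (-2 : ℤ)) from by decide]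
  rw [angAt_vec (c := -I) (b := ((3 : ℤ), (3 : ℤ))) (P₀ := ((2 : ℤ), (-1 : ℤ))) (P₁ := ((2 : ℤ), (0 : ℤ))) (by norm_num)
    (by rw [show ((2 : ℤ), (-1 : ℤ)) - ((3 : ℤ), (3 : ℤ)) = ((-1 : ℤ), (-4 : ℤ)) from by decide, im_negI_mul_toC]; norm_num)
    (by rw [show ((2 : ℤ), (0 : ℤ)) - ((3 : ℤ), (3 : ℤ)) = ((-1 : ℤ), (-3 : ℤ)) from by decide, im_negI_mul_toC]; norm_num) (by decide),
    show ((2 : ℤ), (0 : ℤ)) - ((3 : ℤ), (3 : ℤ)) = ((-1 : ℤ), (-3 : ℤ)) from by decide, show ((2 : ℤ), (-1 : ℤ)) - ((3 : ℤ), (3 : ℤ)) = ((-1 : ℤ), (-4 : ℤ)) from by decide]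
  rw [angAt_vec (c := -I) (b := ((3 : ℤ), (3 : ℤ))) (P₀ := ((2 : ℤ), (0 : ℤ))) (P₁ := ((3 : ℤ), (1 : ℤ))) (by norm_num)
    (by rw [show ((2 : ℤ), (0 : ℤ)) - ((3 : ℤ), (3 : ℤ)) = ((-1 : ℤ), (-3 : ℤ)) from by decide, im_negI_mul_toC]; norm_num)
    (by rw [show ((3 : ℤ), (1 : ℤ)) - ((3 : ℤ), (3 : ℤ)) = ((0 : ℤ), (-2 : ℤ)) from by decide, im_negI_mul_toC]; norm_num) (by decide),
    show ((3 : ℤ), (1 : ℤ)) - ((3 : ℤ), (3 : ℤ)) = ((0 : ℤ), (-2 : ℤ)) from by decide, show ((2 : ℤ), (0 : ℤ)) - ((3 : ℤ), (3 : ℤ)) = ((-1 : ℤ), (-3 : ℤ)) from by decide]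
  have ha0 : Complex.arg ((-1 : ℂ) * toC ((0 : ℤ), (-1 : ℤ))) = π / 2 := by
    rw [show (-1 : ℂ) * toC ((0 : ℤ), (-1 : ℤ)) = I by apply Complex.ext <;> simp [toC]]; exact Complex.arg_I
  have ha1 : Complex.arg ((-1 : ℂ) * toC ((1 : ℤ), (-1 : ℤ))) = 3 * π / 4 := by
    rw [show (-1 : ℂ) * toC ((1 : ℤ), (-1 : ℤ)) = (-1 + I) by apply Complex.ext <;> simp [toC]]; exact arg_neg_one_add_I
  have ha2 : Complex.arg (-I * toC ((-1 : ℤ), (1 : ℤ))) = π / 4 := by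
    rw [show -I * toC ((-1 : ℤ), (1 : ℤ)) = (1 + I) by apply Complex.ext <;> simp [toC]]; exact arg_one_add_I
  have ha3 : Complex.arg (-I * toC ((0 : ℤ), (-2 : ℤ))) = π := by
    rw [show -I * toC ((0 : ℤ), (-2 : ℤ)) = ((2 : ℝ) : ℂ) * -1 by apply Complex.ext <;> simp [toC], Complex.arg_real_mul _ (by norm_num)]
    exact Complex.arg_neg_one
  have hb0_1 : Complex.arg (toC ((0 : ℤ), (1 : ℤ))) = π / 2 := by
    rw [show toC ((0 : ℤ), (1 : ℤ)) = I by apply Complex.ext <;> simp [toC]]; exact Complex.arg_I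
  have hb0_2 : Complex.arg (toC ((1 : ℤ), (1 : ℤ))) = π / 4 := by
    rw [show toC ((1 : ℤ), (1 : ℤ)) = (1 + I) by apply Complex.ext <;> simp [toC]]; exact arg_one_add_I
  have ht0 : ((Complex.arg (toC ((1 : ℤ), (1 : ℤ))) : Real.Angle) - (Complex.arg (toC ((0 : ℤ), (1 : ℤ))) : Real.Angle)).toReal = (π / 4) - (π / 2) := by
    rw [hb0_2, hb0_1, ← Real.Angle.coe_sub]; exact toReal_coe_of_mem (by constructor <;> linarith)
  have hb1_1 : Complex.arg (toC ((1 : ℤ), (1 : ℤ))) = π / 4 := by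
    rw [show toC ((1 : ℤ), (1 : ℤ)) = (1 + I) by apply Complex.ext <;> simp [toC]]; exact arg_one_add_I
  have hb1_2 : Complex.arg (toC ((0 : ℤ), (2 : ℤ))) = π / 2 := by
    rw [show toC ((0 : ℤ), (2 : ℤ)) = ((2 : ℝ) : ℂ) * I by apply Complex.ext <;> simp [toC], Complex.arg_real_mul _ (by norm_num)]
    exact Complex.arg_I
  have ht1 : ((Complex.arg (toC ((0 : ℤ), (2 : ℤ))) : Real.Angle) - (Complex.arg (toC ((1 : ℤ), (1 : ℤ))) : Real.Angle)).toReal = (π / 2) - (π / 4) := by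
    rw [hb1_2, hb1_1, ← Real.Angle.coe_sub]; exact toReal_coe_of_mem (by constructor <;> linarith)
  linarith [ha0, ha1, ha2, ha3, ht0, ht1]

/-- Case `(N, W, E)`. [folklore] -/
theorem Loc_N_W_E : Loc .N .W .E = excursionWinding (π / 2) .N .W .E := by
  rw [Loc, L₁off, L₂off, tailExtOff]
  simp only [tailOffs, wOff, Xo, tailPts, Side.offset, Side.inOff, Side.nIn, List.length_cons, List.length_nil,
    List.getD_cons_zero, List.getD_cons_succ, Finset.sum_range_succ, Finset.sum_range_zero, zero_add, Nat.reduceAdd,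
    if_true, if_false, Nat.succ_ne_zero, Prod.mk_sub_mk, Prod.mk_add_mk, arcTurn, excursionWinding]
  norm_num
  have hpi := Real.pi_pos
  rw [angAt_vec (c := (-1 : ℂ)) (b := ((2 : ℤ), (4 : ℤ))) (P₀ := ((2 : ℤ), (3 : ℤ))) (P₁ := ((1 : ℤ), (2 : ℤ))) (by norm_num)
    (by rw [show ((2 : ℤ), (3 : ℤ)) - ((2 : ℤ), (4 : ℤ)) = ((0 : ℤ), (-1 : ℤ)) from by decide, im_neg_one_mul_toC]; norm_num)
    (by rw [show ((1 : ℤ), (2 : ℤ)) - ((2 : ℤ), (4 : ℤ)) = ((-1 : ℤ), (-2 : ℤ)) from by decide, im_neg_one_mul_toC]; norm_num) (by decide),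
    show ((1 : ℤ), (2 : ℤ)) - ((2 : ℤ), (4 : ℤ)) = ((-1 : ℤ), (-2 : ℤ)) from by decide, show ((2 : ℤ), (3 : ℤ)) - ((2 : ℤ), (4 : ℤ)) = ((0 : ℤ), (-1 : ℤ)) from by decide]
  rw [angAt_vec (c := (-1 : ℂ)) (b := ((2 : ℤ), (4 : ℤ))) (P₀ := ((5 : ℤ), (2 : ℤ))) (P₁ := ((3 : ℤ), (2 : ℤ))) (by norm_num)
    (by rw [show ((5 : ℤ), (2 : ℤ)) - ((2 : ℤ), (4 : ℤ)) = ((3 : ℤ), (-2 : ℤ)) from by decide, im_neg_one_mul_toC]; norm_num)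
    (by rw [show ((3 : ℤ), (2 : ℤ)) - ((2 : ℤ), (4 : ℤ)) = ((1 : ℤ), (-2 : ℤ)) from by decide, im_neg_one_mul_toC]; norm_num) (by decide),
    show ((3 : ℤ), (2 : ℤ)) - ((2 : ℤ), (4 : ℤ)) = ((1 : ℤ), (-2 : ℤ)) from by decide, show ((5 : ℤ), (2 : ℤ)) - ((2 : ℤ), (4 : ℤ)) = ((3 : ℤ), (-2 : ℤ)) from by decide]
  rw [angAt_vec (c := (-1 : ℂ)) (b := ((2 : ℤ), (4 : ℤ))) (P₀ := ((3 : ℤ), (2 : ℤ))) (P₁ := ((1 : ℤ), (2 : ℤ))) (by norm_num)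
    (by rw [show ((3 : ℤ), (2 : ℤ)) - ((2 : ℤ), (4 : ℤ)) = ((1 : ℤ), (-2 : ℤ)) from by decide, im_neg_one_mul_toC]; norm_num)
    (by rw [show ((1 : ℤ), (2 : ℤ)) - ((2 : ℤ), (4 : ℤ)) = ((-1 : ℤ), (-2 : ℤ)) from by decide, im_neg_one_mul_toC]; norm_num) (by decide),
    show ((1 : ℤ), (2 : ℤ)) - ((2 : ℤ), (4 : ℤ)) = ((-1 : ℤ), (-2 : ℤ)) from by decide, show ((3 : ℤ), (2 : ℤ)) - ((2 : ℤ), (4 : ℤ)) = ((1 : ℤ), (-2 : ℤ)) from by decide]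
  rw [angAt_vec (c := (-1 : ℂ)) (b := ((2 : ℤ), (4 : ℤ))) (P₀ := ((5 : ℤ), (2 : ℤ))) (P₁ := ((4 : ℤ), (2 : ℤ))) (by norm_num)
    (by rw [show ((5 : ℤ), (2 : ℤ)) - ((2 : ℤ), (4 : ℤ)) = ((3 : ℤ), (-2 : ℤ)) from by decide, im_neg_one_mul_toC]; norm_num)
    (by rw [show ((4 : ℤ), (2 : ℤ)) - ((2 : ℤ), (4 : ℤ)) = ((2 : ℤ), (-2 : ℤ)) from by decide, im_neg_one_mul_toC]; norm_num) (by decide),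
    show ((4 : ℤ), (2 : ℤ)) - ((2 : ℤ), (4 : ℤ)) = ((2 : ℤ), (-2 : ℤ)) from by decide, show ((5 : ℤ), (2 : ℤ)) - ((2 : ℤ), (4 : ℤ)) = ((3 : ℤ), (-2 : ℤ)) from by decide]
  rw [angAt_vec (c := (-1 : ℂ)) (b := ((2 : ℤ), (4 : ℤ))) (P₀ := ((4 : ℤ), (2 : ℤ))) (P₁ := ((3 : ℤ), (3 : ℤ))) (by norm_num)
    (by rw [show ((4 : ℤ), (2 : ℤ)) - ((2 : ℤ), (4 : ℤ)) = ((2 : ℤ), (-2 : ℤ)) from by decide, im_neg_one_mul_toC]; norm_num)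
    (by rw [show ((3 : ℤ), (3 : ℤ)) - ((2 : ℤ), (4 : ℤ)) = ((1 : ℤ), (-1 : ℤ)) from by decide, im_neg_one_mul_toC]; norm_num) (by decide),
    show ((3 : ℤ), (3 : ℤ)) - ((2 : ℤ), (4 : ℤ)) = ((1 : ℤ), (-1 : ℤ)) from by decide, show ((4 : ℤ), (2 : ℤ)) - ((2 : ℤ), (4 : ℤ)) = ((2 : ℤ), (-2 : ℤ)) from by decide]
  rw [angAt_vec (c := (1 : ℂ)) (b := ((3 : ℤ), (3 : ℤ))) (P₀ := ((2 : ℤ), (4 : ℤ))) (P₁ := ((2 : ℤ), (3 : ℤ))) (one_ne_zero)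
    (by rw [show ((2 : ℤ), (4 : ℤ)) - ((3 : ℤ), (3 : ℤ)) = ((-1 : ℤ), (1 : ℤ)) from by decide, im_one_mul_toC]; norm_num)
    (by rw [show ((2 : ℤ), (3 : ℤ)) - ((3 : ℤ), (3 : ℤ)) = ((-1 : ℤ), (0 : ℤ)) from by decide, im_one_mul_toC]; norm_num) (by decide),
    show ((2 : ℤ), (3 : ℤ)) - ((3 : ℤ), (3 : ℤ)) = ((-1 : ℤ), (0 : ℤ)) from by decide, show ((2 : ℤ), (4 : ℤ)) - ((3 : ℤ), (3 : ℤ)) = ((-1 : ℤ), (1 : ℤ)) from by decide]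
  rw [angAt_vec (c := (-1 : ℂ)) (b := ((3 : ℤ), (3 : ℤ))) (P₀ := ((2 : ℤ), (3 : ℤ))) (P₁ := ((1 : ℤ), (2 : ℤ))) (by norm_num)
    (by rw [show ((2 : ℤ), (3 : ℤ)) - ((3 : ℤ), (3 : ℤ)) = ((-1 : ℤ), (0 : ℤ)) from by decide, im_neg_one_mul_toC]; norm_num)
    (by rw [show ((1 : ℤ), (2 : ℤ)) - ((3 : ℤ), (3 : ℤ)) = ((-2 : ℤ), (-1 : ℤ)) from by decide, im_neg_one_mul_toC]; norm_num) (by decide),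
    show ((1 : ℤ), (2 : ℤ)) - ((3 : ℤ), (3 : ℤ)) = ((-2 : ℤ), (-1 : ℤ)) from by decide, show ((2 : ℤ), (3 : ℤ)) - ((3 : ℤ), (3 : ℤ)) = ((-1 : ℤ), (0 : ℤ)) from by decide]
  rw [angAt_vec (c := (-1 : ℂ)) (b := ((3 : ℤ), (3 : ℤ))) (P₀ := ((5 : ℤ), (2 : ℤ))) (P₁ := ((3 : ℤ), (2 : ℤ))) (by norm_num)
    (by rw [show ((5 : ℤ), (2 : ℤ)) - ((3 : ℤ), (3 : ℤ)) = ((2 : ℤ), (-1 : ℤ)) from by decide, im_neg_one_mul_toC]; norm_num)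
    (by rw [show ((3 : ℤ), (2 : ℤ)) - ((3 : ℤ), (3 : ℤ)) = ((0 : ℤ), (-1 : ℤ)) from by decide, im_neg_one_mul_toC]; norm_num) (by decide),
    show ((3 : ℤ), (2 : ℤ)) - ((3 : ℤ), (3 : ℤ)) = ((0 : ℤ), (-1 : ℤ)) from by decide, show ((5 : ℤ), (2 : ℤ)) - ((3 : ℤ), (3 : ℤ)) = ((2 : ℤ), (-1 : ℤ)) from by decide]
  rw [angAt_vec (c := (-1 : ℂ)) (b := ((3 : ℤ), (3 : ℤ))) (P₀ := ((3 : ℤ), (2 : ℤ))) (P₁ := ((1 : ℤ), (2 : ℤ))) (by norm_num)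
    (by rw [show ((3 : ℤ), (2 : ℤ)) - ((3 : ℤ), (3 : ℤ)) = ((0 : ℤ), (-1 : ℤ)) from by decide, im_neg_one_mul_toC]; norm_num)
    (by rw [show ((1 : ℤ), (2 : ℤ)) - ((3 : ℤ), (3 : ℤ)) = ((-2 : ℤ), (-1 : ℤ)) from by decide, im_neg_one_mul_toC]; norm_num) (by decide),
    show ((1 : ℤ), (2 : ℤ)) - ((3 : ℤ), (3 : ℤ)) = ((-2 : ℤ), (-1 : ℤ)) from by decide, show ((3 : ℤ), (2 : ℤ)) - ((3 : ℤ), (3 : ℤ)) = ((0 : ℤ), (-1 : ℤ)) from by decide]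
  rw [angAt_vec (c := (-1 : ℂ)) (b := ((3 : ℤ), (3 : ℤ))) (P₀ := ((5 : ℤ), (2 : ℤ))) (P₁ := ((4 : ℤ), (2 : ℤ))) (by norm_num)
    (by rw [show ((5 : ℤ), (2 : ℤ)) - ((3 : ℤ), (3 : ℤ)) = ((2 : ℤ), (-1 : ℤ)) from by decide, im_neg_one_mul_toC]; norm_num)
    (by rw [show ((4 : ℤ), (2 : ℤ)) - ((3 : ℤ), (3 : ℤ)) = ((1 : ℤ), (-1 : ℤ)) from by decide, im_neg_one_mul_toC]; norm_num) (by decide),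
    show ((4 : ℤ), (2 : ℤ)) - ((3 : ℤ), (3 : ℤ)) = ((1 : ℤ), (-1 : ℤ)) from by decide, show ((5 : ℤ), (2 : ℤ)) - ((3 : ℤ), (3 : ℤ)) = ((2 : ℤ), (-1 : ℤ)) from by decide]
  have ha0 : Complex.arg ((-1 : ℂ) * toC ((-1 : ℤ), (0 : ℤ))) = 0 := by
    rw [show (-1 : ℂ) * toC ((-1 : ℤ), (0 : ℤ)) = 1 by apply Complex.ext <;> simp [toC]]; exact Complex.arg_one
  have ha1 : Complex.arg ((-1 : ℂ) * toC ((0 : ℤ), (-1 : ℤ))) = π / 2 := by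
    rw [show (-1 : ℂ) * toC ((0 : ℤ), (-1 : ℤ)) = I by apply Complex.ext <;> simp [toC]]; exact Complex.arg_I
  have ha2 : Complex.arg ((-1 : ℂ) * toC ((1 : ℤ), (-1 : ℤ))) = 3 * π / 4 := by
    rw [show (-1 : ℂ) * toC ((1 : ℤ), (-1 : ℤ)) = (-1 + I) by apply Complex.ext <;> simp [toC]]; exact arg_neg_one_add_I
  have ha3 : Complex.arg ((1 : ℂ) * toC ((-1 : ℤ), (0 : ℤ))) = π := by
    rw [show (1 : ℂ) * toC ((-1 : ℤ), (0 : ℤ)) = -1 by apply Complex.ext <;> simp [toC]]; exact Complex.arg_neg_one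
  have ha4 : Complex.arg ((1 : ℂ) * toC ((-1 : ℤ), (1 : ℤ))) = 3 * π / 4 := by
    rw [show (1 : ℂ) * toC ((-1 : ℤ), (1 : ℤ)) = (-1 + I) by apply Complex.ext <;> simp [toC]]; exact arg_neg_one_add_I
  have hb0_1 : Complex.arg (toC ((-1 : ℤ), (0 : ℤ))) = π := by
    rw [show toC ((-1 : ℤ), (0 : ℤ)) = -1 by apply Complex.ext <;> simp [toC]]; exact Complex.arg_neg_one
  have hb0_2 : Complex.arg (toC ((-1 : ℤ), (1 : ℤ))) = 3 * π / 4 := by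
    rw [show toC ((-1 : ℤ), (1 : ℤ)) = (-1 + I) by apply Complex.ext <;> simp [toC]]; exact arg_neg_one_add_I
  have ht0 : ((Complex.arg (toC ((-1 : ℤ), (1 : ℤ))) : Real.Angle) - (Complex.arg (toC ((-1 : ℤ), (0 : ℤ))) : Real.Angle)).toReal = (3 * π / 4) - (π) := by
    rw [hb0_2, hb0_1, ← Real.Angle.coe_sub]; exact toReal_coe_of_mem (by constructor <;> linarith)
  linarith [ha0, ha1, ha2, ha3, ha4, ht0]


/-- **The local constant is the tabulated excursion winding at right angles** (the twelve canonical
cases, by exact evaluation of the angles). [folklore] -/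
theorem Loc_eq {z₀ z₁ z₂ : Side} (hc : Canon z₀ z₁ z₂) : Loc z₀ z₁ z₂ = excursionWinding (π / 2) z₀ z₁ z₂ := by
  revert hc
  cases z₀ <;> cases z₁ <;> cases z₂ <;> intro hc <;> (try exact absurd hc (by decide))
  · exact Loc_W_S_E
  · exact Loc_W_N_E
  · exact Loc_W_N_S
  · exact Loc_E_S_W
  · exact Loc_E_S_N
  · exact Loc_E_N_W
  · exact Loc_S_W_N
  · exact Loc_S_E_W
  · exact Loc_S_E_N
  · exact Loc_N_W_E
  · exact Loc_N_W_S
  · exact Loc_N_E_S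

end Literature.Probability.RandomPlanarGeometry.SAW.YangBaxter
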